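import Literature.NumberTheory.EllipticCurves.PastenEigenSystemCountProofs
import Literature.NumberTheory.EllipticCurves.PeriodRelationsProofs
import Literature.NumberTheory.EllipticCurves.PastenSpectralDegreeIsogenyBoundProofs
import Literature.NumberTheory.EllipticCurves.ModularParametrizationProofs
import Literature.NumberTheory.EllipticCurves.ModularParametrizationHoldsProofs
import Literature.NumberTheory.EllipticCurves.DeligneHeckeEigenvalueBoundProofs
import Literature.NumberTheory.EllipticCurves.MurtySinhaMultiplicityOfTraceFormula
import Literature.NumberTheory.EllipticCurves.HeckeOperatorsEigenvalueBoundProofs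
import Literature.NumberTheory.EllipticCurves.LFunctionCoefficientBound
import Literature.NumberTheory.LFunctions.MertensFormula
import Mathlib.NumberTheory.Chebyshev
import HarnessLib

/-!
# Pasten's Theorem 7.5 from named facts only: congruence splitting at one good prime
# and Murty–Sinha's multiplicity bound in place of Murty's Lemma 11
# (proofs-only sibling of `PastenValuationProduct.lean`; theorems only, D-0026)

Topic `NumberTheory/EllipticCurves`. The named fact
`Literature.NumberTheory.EllipticCurves.pasten_thm_7_5` (`PastenValuationProduct.lean`; H. Pasten,
*Shimura curves and the abc conjecture*, J. Number Theory 254 (2024), Thm. 7.5, proof §7.4 p. 27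
with §3 p. 13 and the asymptotic clause of Thm. 7.2, proof p. 26: for every `ε > 0` and every
elliptic curve `E/ℚ` of conductor `N ≫_ε 1`, `log |Δ_E| < (1/4 + ε) N log N`) was reduced by this
seat to the hypotheses of `pasten_thm_7_5_of_modularity_of_optimalDegreeBound`
(`PastenValuationProductThm75Proofs`): the Modularity Theorem with integral Manin constant
(`nonempty_modularParametrizationData`), the Mazur–Kenku comparison
(`PastenShimura2024_minimalDegree_le_163_mul`) — both named facts of the tree — and `hδ`, the
asymptotic clause of Thm. 7.2, `log δ_{1,N} < (1/24 + ε) N log N` for `N ≫_ε 1`. In the siblings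
`…Thm75AsymptoticProofs`, `PastenEigenSystemCountProofs` and `…Thm75LeavesProofs` the clause `hδ`
was in turn proved from Thm. 5.5 (a theorem of the tree), Deligne's bound (a named fact) and ONE
un-vendored analytic input, Lemma 11 of M. R. Murty, *Bounds for congruence primes* (1999)
(`n_c ≪_ε N^{1+ε}`, resting on Rankin–Selberg theory at general level, level-uniform convexity and
the Hoffstein–Lockhart bound — none of it in the tree).

This file removes that last free hypothesis: it proves `hδ` — indeed the stronger
`log δ_{1,N} = o(N log N)` (`Pasten2024.exists_log_modularDegree_lt_of_murtySinha`) — from Thm. 5.5,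
the weight-`2` Ramanujan bound and the **named fact**
`murtySinha2009_eigenvalue_multiplicity_weightTwo` (`MurtySinhaMultiplicity.lean`: M. R. Murty,
K. Sinha, *Effective equidistribution of eigenvalues of Hecke operators*, J. Number Theory 129
(2009), eq. (1) p. 683: the multiplicity of an eigenvalue of `T_ℓ`, `ℓ ∤ N`, on `S₂(Γ₀(N))` is
`≪ dim S₂(Γ₀(N)) · log ℓ / log N`; in the tree itself reduced to the Eichler–Selberg trace formula,
`murtySinha2009_eigenvalue_multiplicity_weightTwo_of_traceFormula`). Consequently

  `pasten_thm_7_5` ⟸ `nonempty_modularParametrizationData` ∧ `PastenShimura2024_minimalDegree_le_163_mul`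
                    ∧ `Deligne1974_heckeT_eigenvalue_norm_le` ∧ `murtySinha2009_eigenvalue_multiplicity_weightTwo`,

four EXISTING named facts (`pasten_thm_7_5_of_modularity_mazurKenku_deligne_murtySinha`), with no
free hypothesis left; and, in the last section, even Deligne's bound is removed: the eigenvalue
bounds the argument needs follow from the Eichler–Selberg trace formula itself (positivity,
`norm_sq_le_of_traceFormula`) and from Hasse's theorem for `a_ℓ(E)` (a theorem of the tree), so that

  `pasten_thm_7_5` ⟸ `exists_isNewformOf` ∧ `PastenShimura2024_minimalDegree_le_163_mul`
                    ∧ (∀ N, `HeckeTraceFormulaGL2Level N 1 2`)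

(`pasten_thm_7_5_of_exists_isNewformOf_traceFormula`): modularity, Mazur–Kenku (with Edixhoven's
integrality inside the comparison fact) and the Eichler–Selberg trace formula.

## The argument (a deviation from the printed proof of Thm. 7.2, and why)

Pasten (proof of Thm. 7.2, p. 26) bounds every congruence modulus `η_{[χ₀]}(c)` through a
distinguishing index `n_c` of the class `c`, uniformly `n_c ≪_ε N^{1+ε}` by Murty's Lemma 11, and
sums `log η(c) < #c · ((1+ε)/2) log N + …` over the `(1/12 + o(1)) N` eigen-systems. Here instead
(the "congruence splitting at one good prime" of the tree's idea card
`serre-potential-log-free-szpiro`, hypothesis H1 of the moot route item `stmt-ABC-2613`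
`LogFreeDegreeBound`, which the present file thereby proves in its crude form) we fix ONE prime
`ℓ ∤ N` and split the minimal primes `P ≠ P_f` of the anemic Hecke ring `𝕋` (the classes
`c ≠ [χ₀]`) according as `t := T_ℓ − a_ℓ(f)` lies in `P` or not:

* `t ∉ P` (the class is distinguished from `χ₀` at `ℓ`): `log η_P ≤ #c · log(4√ℓ)` by Pasten's
  Prop. 5.4 with the integer polynomial of `T_ℓ` and the Hasse–Weil bound, exactly as on p. 26 but at
  the prime `ℓ` (`log_heckeCongruenceModulus_le_of_not_mem`);
* `t ∈ P` (the class agrees with `χ₀` at `ℓ`): `log η_P < #c · (log N + 4 log N / log log N)` —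
  Pasten's explicit bound (p. 26, `n_c < N³`), a theorem of the tree
  (`PastenShimura2024_log_heckeCongruenceModulus_lt_of_weight_two_bound`) — while the TOTAL size of
  these classes is small: `Σ_{P ∋ t} #c ≤ dim ker(T_ℓ − a_ℓ(f))`
  (`sum_finrank_quotient_le_finrank_ker`: `Σ_{P ∋ t} rank_ℤ(𝕋 ⧸ P) ≤ rank_ℤ(𝕋 ⧸ 𝔞)` for the
  common annihilator `𝔞 ⊆ P` of the eigenbasis vectors killed by `t`, by prime avoidance as in
  Part A of `PastenEigenSystemCountProofs`; and `rank_ℤ(𝕋 ⧸ 𝔞) ≤ #{systems on ker t} ≤ dim ker t`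
  by the lattice-and-reality argument of Part B there, run relative to `ker t` through an element
  `g ∈ 𝕋`, a polynomial in `t`, with `g = c ≠ 0` on `ker t` and `t g = 0` — this is where the
  semisimplicity of `𝕋` and Shimura's integral lattice enter), and `dim ker(T_ℓ − a) = dim Eig(T_ℓ, a)
  ≤ A · dim S₂(Γ₀(N)) · log ℓ / log 2N` is Murty–Sinha's bound.

With `Σ_{c ≠ [χ₀]} #c ≤ (1/12 + κ) N` (Prop. 7.1, proved in `PastenEigenSystemCountProofs`),
`dim S₂(Γ₀(N)) ≤ ψ(N)/12 + 1`, `ψ(N)/N = ∏_{p ∣ N} (1 + 1/p) ≤ exp(Σ_{p ∣ N} 1/p) ≪ log log N`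
(Mertens, the tree's `LFunctions.Mertens.abs_primeRecipSum_sub_le`) and a prime `ℓ ∤ N` with
`ℓ ≤ 2 log N + O(1)` (Chebyshev, Mathlib's `Chebyshev.theta_ge`), Thm. 5.5 gives
`log δ_{1,N} ≤ Σ_{P ≠ P_f} log η_P ≪ N (log log N)² = o(N log N)`, which is more than the
`(1/24 + ε) N log N` consumed by Thm. 7.5. (Unconditionally in the inputs of Murty–Sinha this is the
shape `N log log N · log ℓ₀` of Pasten's GRH clause, Thm. 7.4; the explicit constants are not
tracked here.) Everything else is as in the siblings; nothing is restated.

Main results: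

* `sum_finrank_quotient_le_finrank_ker` — `Σ_{P ∈ s} rank_ℤ(𝕋 ⧸ P) ≤ dim_ℂ ker t` for minimal primes
  `P ∋ t` of `𝕋 = anemicHeckeRing N k` (every weight);
* `Pasten2024.log_modularDegree_le_of_prime` — the one-prime splitting bound for `log δ_{1,N}`;
* `Pasten2024.exists_log_modularDegree_lt_of_murtySinha` — `log δ_{1,N} < ε N log N` for `N ≫_ε 1`;
* `Pasten2024.log_modularDegree_le_finrank_mul_log`, `Pasten2024.exists_log_minModularDegree_le_of_murtySinha`
  — the log-free shape `log δ_{1,N} ≤ C dim S₂(Γ₀(N)) log ℓ` (`ℓ ∤ N` any prime, `N ≥ 16`) and its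
  `minModularDegree` form (the conclusion of the benchmark `LogFreeDegreeBound`);
* `pasten_thm_7_5_of_modularity_mazurKenku_murtySinha_of_weight_two_bound`,
  `pasten_thm_7_5_of_modularity_mazurKenku_deligne_murtySinha`,
  `pasten_thm_7_5_of_exists_isNewformOf_murtySinha`, `pasten_thm_7_5_of_printed_inputs_murtySinha`,
  `pasten_thm_7_5_of_traceFormula_inputs` — Thm. 7.5 from named facts of the tree only (the last one
  from modularity, Mazur–Kenku, Deligne and the Eichler–Selberg trace formula);
* `ModularForms.norm_sq_le_of_traceFormula` — `|μ|² ≤ (p+1)(ψ(N)+1) + 10⁶ p¹² N` for the eigenvalues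
  of `T_p` on `S₂(Γ₀(N))` from the trace formula; `Pasten2024.exists_log_modularDegree_lt_of_traceFormula`
  — Thm. 7.2's asymptotic clause from the trace formula alone;
  `pasten_thm_7_5_of_modularity_mazurKenku_traceFormula`,
  `pasten_thm_7_5_of_exists_isNewformOf_traceFormula`, `pasten_thm_7_5_of_printed_inputs_traceFormula`
  — Thm. 7.5 without Deligne's bound;
* `ModularForms.norm_sq_le_of_primePowTrace`, `Pasten2024.log_modularDegree_le_of_primePowTraces`,
  `Pasten2024.exists_log_modularDegree_lt_of_primePowTraces`,
  `pasten_thm_7_5_of_modularity_mazurKenku_primePowTraces`,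
  `pasten_thm_7_5_of_exists_isNewformOf_primePowTraces`, `pasten_thm_7_5_of_printed_inputs_primePowTraces`
  — the same with the trace-formula input cut down to what is consumed: the identities
  `cuspidalHeckeTrace N 2 1 (p ^ c) = geometricSide N 1 2 (p ^ c)` for primes `p ∤ N` and `c ≥ 0`
  (all levels `N`), i.e. Schoof–van der Vlugt Thm. 2.2 at `n = p^c`, weight `2`, trivial character —
  the hypothesis of the tree's `murtySinha2009_eigenvalue_multiplicity_weightTwo_of_primePowTraces`;
  so `pasten_thm_7_5` ⟸ `exists_isNewformOf` ∧ `PastenShimura2024_minimalDegree_le_163_mul` ∧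
  (E–S at `n = p^c`, `(p, N) = 1`, `k = 2`, `χ = 1`);
* `Pasten2024.eigenvalue_norm_le_traceBound_of_trivial`, `Pasten2024.log_modularDegree_le_of_multiplicity_only`,
  `Pasten2024.exists_log_modularDegree_lt_of_murtySinha_only`,
  `pasten_thm_7_5_of_modularity_mazurKenku_murtySinha_only`,
  `pasten_thm_7_5_of_exists_isNewformOf_mazurKenku_murtySinha`,
  `pasten_thm_7_5_of_printed_inputs_murtySinha_only` — the eigenvalue bounds taken from the PROVED
  trivial bound `|μ| ≤ p + 1` (`norm_eigenvalue_heckeT_gamma0_two_le`,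
  `HeckeOperatorsEigenvalueBoundProofs`), so that

    `pasten_thm_7_5` ⟸ `exists_isNewformOf` ∧ `PastenShimura2024_minimalDegree_le_163_mul`
                      ∧ `murtySinha2009_eigenvalue_multiplicity_weightTwo`,

  three named facts of the tree and nothing else (no Deligne, no trace-formula hypothesis);
* `Pasten2024.log_modularDegree_le_finrank_mul_log_only`,
  `Pasten2024.exists_log_modularDegree_le_finrank_mul_log_of_murtySinha_only`,
  `Pasten2024.exists_log_minModularDegree_le_of_murtySinha_only` — the log-free benchmark shape
  `log δ_{1,N} ≤ C dim S₂(Γ₀(N)) log ℓ` (and its `minModularDegree` form) from the same three facts.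

## References

* H. Pasten, *Shimura curves and the abc conjecture*, J. Number Theory 254 (2024), 214–335,
  doi:10.1016/j.jnt.2023.07.002 = arXiv:1705.09251: Prop. 5.4 and §5.4 (p. 17), Thm. 5.5 (p. 18),
  §7.1 Prop. 7.1, Thm. 7.2 and its proof (p. 26), Thm. 7.4, §7.4 Thm. 7.5 (p. 27). [PastenShimura2024]
* M. R. Murty, K. Sinha, *Effective equidistribution of eigenvalues of Hecke operators*, J. Number
  Theory 129 (2009), 681–714: Thm. 2 (p. 682), eq. (1) (p. 683), Thm. 4. [MurtySinha2009]
* M. R. Murty, *Bounds for congruence primes*, Proc. Sympos. Pure Math. 66.1 (1999), §6 Lemma 11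
  (the input replaced here). [Murty1999CongruencePrimes]
* G. H. Hardy, E. M. Wright, *An Introduction to the Theory of Numbers*, Thm. 427 (Mertens).
  [HardyWright2008]
-/

noncomputable section

open scoped MatrixGroups ModularForm ComplexConjugate

open CongruenceSubgroup UpperHalfPlane Polynomial

namespace Literature.NumberTheory.EllipticCurves.ModularForms

/-! ### The kernel of an element of `𝕋`: eigenbasis description -/

section Kernel

variable {N : ℕ} [NeZero N] {k : ℤ}

/-- Powers of `t ∈ 𝕋` act on a simultaneous eigenvector by powers of the eigenvalue. [folklore] -/
theorem coe_pow_apply_eq_pow_smul {f : CuspForm (Gamma0 N) k} (hf : IsAnemicEigenvector f)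
    (t : anemicHeckeRing N k) (n : ℕ) :
    ((t ^ n : anemicHeckeRing N k) : Module.End ℂ (CuspForm (Gamma0 N) k)) f =
      anemicEigenvalue f t ^ n • f := by
  induction n with
  | zero => simp
  | succ n ih =>
    rw [pow_succ, Subalgebra.coe_mul, Module.End.mul_apply, hf.apply_eq_smul t, map_smul, ih,
      smul_smul, pow_succ, mul_comm]

/-- **`𝕋` acts semisimply**: if `tⁿ x = 0` for some `n ≥ 1` then `t x = 0` (`S_k(Γ₀(N))` has a
basis of simultaneous eigenvectors of `𝕋`, the Atkin–Lehner family). [cite: AtkinLehner1970, Thm. 5] -/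
theorem apply_eq_zero_of_pow_apply_eq_zero {ι : Type*} [Fintype ι]
    (v : ι → CuspForm (Gamma0 N) k) (hv : LinearIndependent ℂ v)
    (hsp : ⊤ ≤ Submodule.span ℂ (Set.range v)) (hev : ∀ i, IsAnemicEigenvector (v i))
    (t : anemicHeckeRing N k) {n : ℕ} (hn : n ≠ 0) (x : CuspForm (Gamma0 N) k)
    (hx : ((t ^ n : anemicHeckeRing N k) : Module.End ℂ (CuspForm (Gamma0 N) k)) x = 0) :
    (t : Module.End ℂ (CuspForm (Gamma0 N) k)) x = 0 := by
  classical
  let B := Module.Basis.mk hv hsp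
  have hB : ∀ i, B i = v i := fun i ↦ Module.Basis.mk_apply hv hsp i
  -- expand `x` and apply `tⁿ`
  have hxrep : x = ∑ i, B.repr x i • v i := by
    conv_lhs => rw [← B.sum_repr x]
    simp only [hB]
  have hpow : ∑ i, (B.repr x i * anemicEigenvalue (v i) t ^ n) • v i = 0 := by
    have h := hx
    rw [hxrep, map_sum] at h
    rw [← h]
    refine Finset.sum_congr rfl fun i _ ↦ ?_
    rw [map_smul, coe_pow_apply_eq_pow_smul (hev i) t n, smul_smul]
  have hcoef : ∀ i, B.repr x i * anemicEigenvalue (v i) t ^ n = 0 :=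
    Fintype.linearIndependent_iff.mp hv _ hpow
  have hcoef' : ∀ i, B.repr x i * anemicEigenvalue (v i) t = 0 := fun i ↦ by
    rcases mul_eq_zero.mp (hcoef i) with h | h
    · rw [h, zero_mul]
    · rw [(pow_eq_zero_iff hn).mp h, mul_zero]
  rw [hxrep, map_sum]
  refine Finset.sum_eq_zero fun i _ ↦ ?_
  rw [map_smul, (hev i).apply_eq_smul t, smul_smul, hcoef' i, zero_smul]

/-- **The kernel of `t ∈ 𝕋` is spanned by the eigenbasis vectors it contains.** [folklore] -/
theorem ker_le_span_of_eigenbasis {ι : Type*} [Fintype ι]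
    (v : ι → CuspForm (Gamma0 N) k) (hv : LinearIndependent ℂ v)
    (hsp : ⊤ ≤ Submodule.span ℂ (Set.range v)) (hev : ∀ i, IsAnemicEigenvector (v i))
    (t : anemicHeckeRing N k) :
    LinearMap.ker (t : Module.End ℂ (CuspForm (Gamma0 N) k)) ≤
      Submodule.span ℂ (v '' {i | (t : Module.End ℂ (CuspForm (Gamma0 N) k)) (v i) = 0}) := by
  intro x hx
  rw [LinearMap.mem_ker] at hx
  let B := Module.Basis.mk hv hsp
  have hB : ∀ i, B i = v i := fun i ↦ Module.Basis.mk_apply hv hsp i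
  have hxrep : x = ∑ i, B.repr x i • v i := by
    conv_lhs => rw [← B.sum_repr x]
    simp only [hB]
  have hsum : ∑ i, (B.repr x i * anemicEigenvalue (v i) t) • v i = 0 := by
    have h := hx
    rw [hxrep, map_sum] at h
    rw [← h]
    refine Finset.sum_congr rfl fun i _ ↦ ?_
    rw [map_smul, (hev i).apply_eq_smul t, smul_smul]
  have hcoef : ∀ i, B.repr x i * anemicEigenvalue (v i) t = 0 :=
    Fintype.linearIndependent_iff.mp hv _ hsum
  rw [hxrep]
  refine Submodule.sum_mem _ fun i _ ↦ ?_
  by_cases hi : (t : Module.End ℂ (CuspForm (Gamma0 N) k)) (v i) = 0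
  · exact Submodule.smul_mem _ _ (Submodule.subset_span ⟨i, hi, rfl⟩)
  · have ha : anemicEigenvalue (v i) t ≠ 0 := by
      intro h0
      apply hi
      rw [(hev i).apply_eq_smul t, h0, zero_smul]
    rw [(mul_eq_zero.mp (hcoef i)).resolve_right ha, zero_smul]
    exact Submodule.zero_mem _

/-- A set of eigenbasis vectors in `ker t` has at most `dim ker t` members. [folklore] -/
theorem card_le_finrank_ker {ι : Type*} [Fintype ι]
    (v : ι → CuspForm (Gamma0 N) k) (hv : LinearIndependent ℂ v) (t : anemicHeckeRing N k)
    (I : Finset ι) (hI : ∀ i ∈ I, (t : Module.End ℂ (CuspForm (Gamma0 N) k)) (v i) = 0) :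
    I.card ≤ Module.finrank ℂ (LinearMap.ker (t : Module.End ℂ (CuspForm (Gamma0 N) k))) := by
  haveI := finiteDimensional_cuspForm_gamma0 (N := N) k
  let u : ↥I → LinearMap.ker (t : Module.End ℂ (CuspForm (Gamma0 N) k)) :=
    fun i ↦ ⟨v i.1, LinearMap.mem_ker.mpr (hI i.1 i.2)⟩
  have hu : LinearIndependent ℂ u := by
    refine LinearIndependent.of_comp (LinearMap.ker (t : Module.End ℂ (CuspForm (Gamma0 N) k))).subtype ?_
    exact hv.comp (fun i : ↥I ↦ (i.1 : ι)) fun i j h ↦ Subtype.ext h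
  have h := hu.fintype_card_le_finrank
  rwa [Fintype.card_coe] at h

/-- **A polynomial in `t` which is a non-zero integer on `ker t` and maps into `ker t`.** For
`t ∈ 𝕋` there are `g ∈ 𝕋` and `c ∈ ℤ ∖ {0}` with `g w = c w` whenever `t w = 0`, and `t (g x) = 0`
for all `x`: write the minimal polynomial of the integral element `t` as `X^e g₀(X)` with
`g₀(0) = c ≠ 0` and take `g = g₀(t)`; then `tᵉ g = 0`, so `t g = 0` by semisimplicity, and
`g ≡ c (mod t𝕋)`. [folklore] -/
theorem exists_int_smul_on_ker {ι : Type*} [Fintype ι]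
    (v : ι → CuspForm (Gamma0 N) k) (hv : LinearIndependent ℂ v)
    (hsp : ⊤ ≤ Submodule.span ℂ (Set.range v)) (hev : ∀ i, IsAnemicEigenvector (v i))
    (t : anemicHeckeRing N k) :
    ∃ (g : anemicHeckeRing N k) (c : ℤ), c ≠ 0 ∧
      (∀ w, (t : Module.End ℂ (CuspForm (Gamma0 N) k)) w = 0 →
        (g : Module.End ℂ (CuspForm (Gamma0 N) k)) w = (c : ℂ) • w) ∧
      ∀ x, (t : Module.End ℂ (CuspForm (Gamma0 N) k))
        ((g : Module.End ℂ (CuspForm (Gamma0 N) k)) x) = 0 := by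
  have hint : IsIntegral ℤ t := Algebra.IsIntegral.isIntegral t
  set q : ℤ[X] := minpoly ℤ t with hq_def
  have hq0 : q ≠ 0 := minpoly.ne_zero hint
  have hqt : aeval t q = 0 := minpoly.aeval ℤ t
  obtain ⟨g₀, hqfac, hndvd⟩ := q.exists_eq_pow_rootMultiplicity_mul_and_not_dvd hq0 0
  rw [map_zero, sub_zero] at hqfac hndvd
  set e := q.rootMultiplicity 0 with he
  set c : ℤ := g₀.coeff 0 with hc_def
  have hc : c ≠ 0 := fun h ↦ hndvd (Polynomial.X_dvd_iff.mpr h)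
  refine ⟨aeval t g₀, c, hc, fun w hw ↦ ?_, fun x ↦ ?_⟩
  · -- `g₀(t) = t h(t) + c` acts by `c` on `ker t`
    have hsplit : aeval t g₀ = aeval t (divX g₀) * t + algebraMap ℤ (anemicHeckeRing N k) c := by
      conv_lhs => rw [← Polynomial.X_mul_divX_add g₀]
      rw [map_add, map_mul, aeval_X, aeval_C, hc_def, mul_comm]
    rw [hsplit, Subalgebra.coe_add, Subalgebra.coe_mul, LinearMap.add_apply, Module.End.mul_apply, hw,
      map_zero, zero_add, Subalgebra.coe_algebraMap, Algebra.algebraMap_eq_smul_one,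
      LinearMap.smul_apply, Module.End.one_apply, Int.cast_smul_eq_zsmul]
  · -- `tᵉ g₀(t) = q(t) = 0`, hence `t (g₀(t) x) = 0` by semisimplicity (or `g₀(t) = 0` if `e = 0`)
    have hzero : t ^ e * aeval t g₀ = 0 := by
      rw [← hqt, hqfac, map_mul, map_pow, aeval_X]
    rcases Nat.eq_zero_or_pos e with he0 | hepos
    · rw [he0, pow_zero, one_mul] at hzero
      rw [hzero, ZeroMemClass.coe_zero, LinearMap.zero_apply, map_zero]
    · refine apply_eq_zero_of_pow_apply_eq_zero v hv hsp hev t hepos.ne' _ ?_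
      rw [← Module.End.mul_apply, ← Subalgebra.coe_mul, hzero, ZeroMemClass.coe_zero,
        LinearMap.zero_apply]

end Kernel

/-! ### `rank_ℤ(𝕋 ⧸ 𝔞) ≤ #{systems on the vectors cut out by 𝔞}` (lattice and reality, relative form) -/

section RelativeRank

variable {N : ℕ} [NeZero N] {k : ℤ}

set_option maxHeartbeats 800000 in
/-- **Relative form of `rank_ℤ 𝕋 ≤ #{systems}`.** Let `v` be a simultaneous eigenbasis of
`S_k(Γ₀(N))`, `I` a set of indices and `𝔞 = ⋂_{i ∈ I} 𝕀_{v_i}` the ideal of `𝕋` killing the `v_i`,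
`i ∈ I`. Suppose some `g ∈ 𝕋` acts by a non-zero INTEGER `c` on the `v_i`, `i ∈ I`, and kills the
other `v_j`. Then `rank_ℤ(𝕋 ⧸ 𝔞)` is at most the number of distinct systems of eigenvalues of the
`v_i`, `i ∈ I`. Proof, as for `finrank_anemicHeckeRing_le_card_systems` (Shimura's `T_p`-stable
real lattice `b`, reality of the systems, rational functionals), run with the integer matrices
`B_l` of `β_l g` for lifts `β_l` of a `ℤ`-basis of `𝕋 ⧸ 𝔞`: an integer (or rational) combination
`U = Σ m_l β_l` with `Σ m_l B_l = 0` has `U g = 0`, hence `c · U v_i = U (g v_i) = 0`, i.e. `U ∈ 𝔞`;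
and a real combination `Σ c_l β_l` whose systems vanish at all `χ_{v_i}`, `i ∈ I`, kills `g V`,
whence `Σ c_l B_l = 0`. [cite: PastenShimura2024, §4.11 p. 16] -/
theorem finrank_quotient_le_card_systems_of_int_smul {ι : Type*} [Fintype ι]
    (v : ι → CuspForm (Gamma0 N) k) (hv : LinearIndependent ℂ v)
    (hsp : ⊤ ≤ Submodule.span ℂ (Set.range v)) (hev : ∀ i, IsAnemicEigenvector (v i))
    (I : Finset ι) (g : anemicHeckeRing N k) (c : ℤ) (hc : c ≠ 0)
    (hgI : ∀ i ∈ I, (g : Module.End ℂ (CuspForm (Gamma0 N) k)) (v i) = (c : ℂ) • v i)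
    (hgI' : ∀ i, i ∉ I → (g : Module.End ℂ (CuspForm (Gamma0 N) k)) (v i) = 0)
    (X : Finset (anemicHeckeRing N k → ℂ)) (hX : ∀ i ∈ I, anemicEigenvalue (v i) ∈ X) :
    Module.finrank ℤ (anemicHeckeRing N k ⧸ I.inf fun i ↦ eigenIdeal (v i)) ≤ X.card := by
  classical
  obtain ⟨𝔞, h𝔞_def⟩ : ∃ 𝔞 : Ideal (anemicHeckeRing N k), 𝔞 = I.inf fun i ↦ eigenIdeal (v i) :=
    ⟨_, rfl⟩
  rw [← h𝔞_def]
  have hmem𝔞 : ∀ x : anemicHeckeRing N k, x ∈ 𝔞 ↔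
      ∀ i ∈ I, (x : Module.End ℂ (CuspForm (Gamma0 N) k)) (v i) = 0 := fun x ↦ by
    rw [h𝔞_def, Submodule.mem_finsetInf]
    exact forall₂_congr fun i _ ↦ mem_eigenIdeal
  have hv0 : ∀ i, v i ≠ 0 := fun i ↦ hv.ne_zero i
  -- the eigenvalues are real
  have hre : ∀ i t, anemicEigenvalue (v i) t = ((anemicEigenvalue (v i) t).re : ℂ) :=
    fun i t ↦ anemicEigenvalue_eq_ofReal_re (hev i) (hv0 i) t
  -- Shimura's lattice
  obtain ⟨n, b, hb⟩ := exists_heckeStable_realBasis N k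
  -- `𝕋 ⧸ 𝔞` is finite free over `ℤ`
  haveI : Module.Finite ℤ (anemicHeckeRing N k ⧸ 𝔞) := Module.Finite.of_surjective
    (Ideal.Quotient.mkₐ ℤ 𝔞).toLinearMap (Ideal.Quotient.mkₐ_surjective ℤ 𝔞)
  haveI : Module.IsTorsionFree ℤ (anemicHeckeRing N k ⧸ 𝔞) := by
    refine Module.IsTorsionFree.of_smul_eq_zero fun m x hmx ↦ ?_
    by_cases hm : m = 0
    · exact Or.inl hm
    right
    obtain ⟨x, rfl⟩ := Ideal.Quotient.mk_surjective x
    rw [← map_zsmul (Ideal.Quotient.mk 𝔞), Ideal.Quotient.eq_zero_iff_mem, hmem𝔞] at hmx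
    rw [Ideal.Quotient.eq_zero_iff_mem, hmem𝔞]
    intro i hi
    have h := hmx i hi
    rw [Subalgebra.coe_smul, LinearMap.smul_apply, ← Int.cast_smul_eq_zsmul ℂ, smul_eq_zero,
      Int.cast_eq_zero] at h
    exact h.resolve_left hm
  haveI : Module.Free ℤ (anemicHeckeRing N k ⧸ 𝔞) := Module.free_of_finite_type_torsion_free'
  set r := Module.finrank ℤ (anemicHeckeRing N k ⧸ 𝔞) with hr
  let βq := Module.finBasis ℤ (anemicHeckeRing N k ⧸ 𝔞)
  have hlift : ∀ l : Fin r, ∃ u : anemicHeckeRing N k, Ideal.Quotient.mk 𝔞 u = βq l :=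
    fun l ↦ Ideal.Quotient.mk_surjective (βq l)
  choose β hβ using hlift
  -- integer matrices of `β l * g` in the real basis `b`
  have hBex : ∀ (l : Fin r) (j : Fin n), ∃ a : Fin n → ℤ,
      ∑ i, a i • b i = ((β l * g : anemicHeckeRing N k) : Module.End ℂ (CuspForm (Gamma0 N) k)) (b j) :=
    fun l j ↦ (Submodule.mem_span_range_iff_exists_fun ℤ).mp (apply_mem_span_of_heckeStable b hb (β l * g) j)
  choose B hB using hBex
  -- an operator vanishing on the real basis `b` vanishes
  have hbext : ∀ T : Module.End ℂ (CuspForm (Gamma0 N) k), (∀ j, T (b j) = 0) → T = 0 := by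
    intro T hTb
    refine LinearMap.ext fun w ↦ ?_
    rw [LinearMap.zero_apply, ← b.sum_repr w, map_sum]
    exact Finset.sum_eq_zero fun j _ ↦ by rw [T.map_smul_of_tower (b.repr w j) (b j), hTb, smul_zero]
  -- coercion of integer combinations of the `β l`
  have hcoe : ∀ m : Fin r → ℤ, ((∑ l, m l • β l : anemicHeckeRing N k) :
      Module.End ℂ (CuspForm (Gamma0 N) k)) =
      ∑ l, m l • (β l : Module.End ℂ (CuspForm (Gamma0 N) k)) := fun m ↦ by
    rw [← Subalgebra.coe_val, map_sum]
    exact Finset.sum_congr rfl fun l _ ↦ by rw [map_zsmul, Subalgebra.coe_val]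
  -- integer combinations of the `β l` applied to `g b_j`
  have hcombZ : ∀ (m : Fin r → ℤ) (j : Fin n),
      (∑ l, m l • (β l : Module.End ℂ (CuspForm (Gamma0 N) k)))
        ((g : Module.End ℂ (CuspForm (Gamma0 N) k)) (b j)) = ∑ i, (∑ l, m l * B l j i) • b i := by
    intro m j
    rw [LinearMap.sum_apply]
    have hlg : ∀ l, (β l : Module.End ℂ (CuspForm (Gamma0 N) k))
        ((g : Module.End ℂ (CuspForm (Gamma0 N) k)) (b j)) = ∑ i, B l j i • b i := fun l ↦ by
      rw [hB, Subalgebra.coe_mul, Module.End.mul_apply]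
    simp_rw [LinearMap.smul_apply, hlg, Finset.smul_sum, smul_smul, Finset.sum_smul]
    exact Finset.sum_comm
  -- an integer combination `U = Σ m_l β_l` with `U (g b_j) = 0` for all `j` lies in `𝔞`
  have hU𝔞 : ∀ m : Fin r → ℤ,
      (∀ j, (∑ l, m l • (β l : Module.End ℂ (CuspForm (Gamma0 N) k)))
        ((g : Module.End ℂ (CuspForm (Gamma0 N) k)) (b j)) = 0) →
      (∑ l, m l • β l : anemicHeckeRing N k) ∈ 𝔞 := by
    intro m hm
    have hop : (((∑ l, m l • β l) * g : anemicHeckeRing N k) :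
        Module.End ℂ (CuspForm (Gamma0 N) k)) = 0 := by
      refine hbext _ fun j ↦ ?_
      rw [Subalgebra.coe_mul, Module.End.mul_apply, hcoe m]
      exact hm j
    rw [hmem𝔞]
    intro i hi
    have h := congrArg (fun T : Module.End ℂ (CuspForm (Gamma0 N) k) ↦ T (v i)) hop
    simp only [LinearMap.zero_apply, Subalgebra.coe_mul, Module.End.mul_apply, hgI i hi,
      map_smul] at h
    exact (smul_eq_zero.mp h).resolve_left (Int.cast_ne_zero.mpr hc)
  -- the `B l` are `ℤ`-, hence `ℚ`-linearly independent
  have hBind : LinearIndependent ℚ fun l : Fin r ↦ (fun j i ↦ (B l j i : ℚ)) := by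
    rw [← LinearIndependent.iff_fractionRing ℤ ℚ, Fintype.linearIndependent_iff]
    intro m hm l₀
    have hmB : ∀ j i, ∑ l, m l * B l j i = 0 := fun j i ↦ by
      have h := congrFun (congrFun hm j) i
      simp only [Finset.sum_apply, Pi.smul_apply, Pi.zero_apply] at h
      simp only [zsmul_eq_mul] at h
      exact_mod_cast h
    have hmem : (∑ l, m l • β l : anemicHeckeRing N k) ∈ 𝔞 := by
      refine hU𝔞 m fun j ↦ ?_
      rw [hcombZ m j]
      exact Finset.sum_eq_zero fun i _ ↦ by rw [hmB j i, zero_smul]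
    have hq : ∑ l, m l • βq l = 0 := by
      have h := (Ideal.Quotient.eq_zero_iff_mem (I := 𝔞)).mpr hmem
      rw [map_sum] at h
      simp_rw [map_zsmul, hβ] at h
      exact h
    exact Fintype.linearIndependent_iff.mp βq.linearIndependent m hq l₀
  -- the real-linearly independent family in `ℝ^X`
  let F : Fin r → (↥X → ℝ) := fun l x ↦ (x.1 (β l)).re
  suffices hF : LinearIndependent ℝ F by
    have h := hF.fintype_card_le_finrank
    rwa [Fintype.card_fin, Module.finrank_fintype_fun_eq_card, Fintype.card_coe] at h
  rw [Fintype.linearIndependent_iff]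
  intro cf hcf
  -- the combination vanishes at every system `χ_i`, `i ∈ I`
  have hci : ∀ i ∈ I, ∑ l, cf l * (anemicEigenvalue (v i) (β l)).re = 0 := fun i hi ↦ by
    have h := congrFun hcf ⟨anemicEigenvalue (v i), hX i hi⟩
    simpa [F, Finset.sum_apply, Pi.smul_apply, smul_eq_mul] using h
  -- so the operator `Σ c_l β_l` kills `v i`, `i ∈ I`
  set T : Module.End ℂ (CuspForm (Gamma0 N) k) :=
    ∑ l, (cf l : ℂ) • (β l : Module.End ℂ (CuspForm (Gamma0 N) k)) with hT_def
  have hTv : ∀ i ∈ I, T (v i) = 0 := fun i hi ↦ by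
    rw [hT_def, LinearMap.sum_apply]
    simp_rw [LinearMap.smul_apply, (hev i).apply_eq_smul, smul_smul, ← Finset.sum_smul]
    rw [show ∑ l, (cf l : ℂ) * anemicEigenvalue (v i) (β l) =
        ((∑ l, cf l * (anemicEigenvalue (v i) (β l)).re : ℝ) : ℂ) by
      rw [Complex.ofReal_sum]
      exact Finset.sum_congr rfl fun l _ ↦ by rw [hre i, Complex.ofReal_re, Complex.ofReal_mul],
      hci i hi, Complex.ofReal_zero, zero_smul]
  -- hence `T ∘ g = 0`
  have hTg : T ∘ₗ (g : Module.End ℂ (CuspForm (Gamma0 N) k)) = 0 := by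
    refine (Module.Basis.mk hv hsp).ext fun i ↦ ?_
    rw [Module.Basis.coe_mk, LinearMap.zero_apply, LinearMap.comp_apply]
    by_cases hi : i ∈ I
    · rw [hgI i hi, map_smul, hTv i hi, smul_zero]
    · rw [hgI' i hi, map_zero]
  -- the real relation `Σ c_l B_l = 0`
  have hcB : ∀ j i, ∑ l, cf l * (B l j i : ℝ) = 0 := by
    intro j
    have hj : T ((g : Module.End ℂ (CuspForm (Gamma0 N) k)) (b j)) = 0 := by
      rw [← LinearMap.comp_apply, hTg, LinearMap.zero_apply]
    rw [hT_def, LinearMap.sum_apply] at hj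
    have hlg : ∀ l, (β l : Module.End ℂ (CuspForm (Gamma0 N) k))
        ((g : Module.End ℂ (CuspForm (Gamma0 N) k)) (b j)) = ∑ i, B l j i • b i := fun l ↦ by
      rw [hB, Subalgebra.coe_mul, Module.End.mul_apply]
    simp_rw [LinearMap.smul_apply, hlg, Finset.smul_sum, Complex.coe_smul] at hj
    have hj' : ∑ i, (∑ l, cf l * (B l j i : ℝ)) • b i = 0 := by
      rw [← hj, Finset.sum_comm]
      refine Finset.sum_congr rfl fun i _ ↦ ?_
      rw [Finset.sum_smul]
      refine Finset.sum_congr rfl fun l _ ↦ ?_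
      rw [← Int.cast_smul_eq_zsmul ℝ (B l j i) (b i), smul_smul]
    exact Fintype.linearIndependent_iff.mp b.linearIndependent _ hj'
  -- apply rational functionals
  intro l₀
  by_contra hl₀
  obtain ⟨π, hπ⟩ := Module.Projective.exists_dual_ne_zero ℚ hl₀
  have hq : ∑ l, (π (cf l)) • (fun j i ↦ (B l j i : ℚ)) = 0 := by
    funext j i
    simp only [Finset.sum_apply, Pi.smul_apply, Pi.zero_apply, smul_eq_mul]
    have h := congrArg π (hcB j i)
    rw [map_sum, map_zero] at h
    rw [← h]
    refine Finset.sum_congr rfl fun l _ ↦ ?_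
    rw [show cf l * (B l j i : ℝ) = (B l j i : ℤ) • cf l by rw [zsmul_eq_mul, mul_comm],
      map_zsmul, zsmul_eq_mul, mul_comm]
  exact hπ (Fintype.linearIndependent_iff.mp hBind (fun l ↦ π (cf l)) hq l₀)

end RelativeRank

/-! ### `Σ_{P ∋ t} rank_ℤ(𝕋 ⧸ P) ≤ dim_ℂ ker t` -/

section KernelCount

variable {N : ℕ} [NeZero N] {k : ℤ}

/-- **Part A relative to an ideal** (general form): for a commutative ring `R` finite over `ℤ`,
an ideal `𝔞` and a finite set `s` of pairwise incomparable primes `P ⊇ 𝔞` with `R ⧸ P` free,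
`Σ_{P ∈ s} rank_ℤ(R ⧸ P) ≤ rank_ℤ(R ⧸ 𝔞)`. Proof as for
`sum_finrank_quotient_le_finrank_of_pairwise_not_le` (avoidance elements `e_P ∉ P` lying in the
other primes, lifts `u_{P,l}` of `ℤ`-bases of the `R ⧸ P`), the family `e_P u_{P,l}` being
`ℤ`-linearly independent already in `R ⧸ 𝔞`: a relation there lifts to an element of `𝔞 ⊆ P₀`,
and reducing modulo `P₀` kills the terms with `P ≠ P₀`. [folklore] -/
theorem sum_finrank_quotient_le_finrank_quotient_of_pairwise_not_le {R : Type*} [CommRing R]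
    [Module.Finite ℤ R] (𝔞 : Ideal R) (s : Finset (Ideal R)) (hprime : ∀ P ∈ s, P.IsPrime)
    (hinc : ∀ P ∈ s, ∀ Q ∈ s, P ≠ Q → ¬ Q ≤ P) (hfree : ∀ P ∈ s, Module.Free ℤ (R ⧸ P))
    (h𝔞 : ∀ P ∈ s, 𝔞 ≤ P) :
    ∑ P ∈ s, Module.finrank ℤ (R ⧸ P) ≤ Module.finrank ℤ (R ⧸ 𝔞) := by
  classical
  haveI : Module.Finite ℤ (R ⧸ 𝔞) := Module.Finite.of_surjective
    (Ideal.Quotient.mkₐ ℤ 𝔞).toLinearMap (Ideal.Quotient.mkₐ_surjective ℤ 𝔞)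
  -- avoidance elements
  have hav : ∀ P ∈ s, ∃ e : R, e ∉ P ∧ ∀ Q ∈ s, Q ≠ P → e ∈ Q :=
    fun P hP ↦ exists_notMem_forall_mem_of_pairwise_not_le s hprime hinc hP
  choose! e heP heQ using hav
  -- linearly independent families of full size in the quotients, and lifts
  have hbasis : ∀ P ∈ s, ∃ b : Fin (Module.finrank ℤ (R ⧸ P)) → R ⧸ P, LinearIndependent ℤ b := by
    intro P hP
    haveI := hfree P hP
    haveI : Module.Finite ℤ (R ⧸ P) := Module.Finite.of_surjective
      (Ideal.Quotient.mkₐ ℤ P).toLinearMap (Ideal.Quotient.mkₐ_surjective ℤ P)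
    exact ⟨Module.finBasis ℤ _, (Module.finBasis ℤ _).linearIndependent⟩
  choose! b hb using hbasis
  have hlift : ∀ (P : Ideal R) (l : Fin (Module.finrank ℤ (R ⧸ P))),
      ∃ u : R, Ideal.Quotient.mk P u = b P l :=
    fun P l ↦ Ideal.Quotient.mk_surjective (b P l)
  choose u hu using hlift
  -- the family `(P, l) ↦ e_P u_{P,l} mod 𝔞` is linearly independent in `R ⧸ 𝔞`
  have hw : LinearIndependent ℤ
      fun i : (Σ P : ↥s, Fin (Module.finrank ℤ (R ⧸ P.1))) ↦
        Ideal.Quotient.mk 𝔞 (e i.1.1 * u i.1.1 i.2) := by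
    rw [Fintype.linearIndependent_iff]
    rintro c hc ⟨P₀, l₀⟩
    haveI : P₀.1.IsPrime := hprime P₀.1 P₀.2
    -- the relation lifts to an element of `𝔞 ⊆ P₀`
    have hc𝔞 : ∑ i : (Σ P : ↥s, Fin (Module.finrank ℤ (R ⧸ P.1))),
        (c i : R) * (e i.1.1 * u i.1.1 i.2) ∈ P₀.1 := by
      refine h𝔞 P₀.1 P₀.2 (Ideal.Quotient.eq_zero_iff_mem.mp ?_)
      rw [map_sum, ← hc]
      refine Finset.sum_congr rfl fun i _ ↦ ?_
      rw [map_mul, map_intCast, zsmul_eq_mul]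
    -- reduce modulo `P₀`
    have hred : ∑ i : (Σ P : ↥s, Fin (Module.finrank ℤ (R ⧸ P.1))),
        (c i : R ⧸ P₀.1) *
          (Ideal.Quotient.mk P₀.1 (e i.1.1) * Ideal.Quotient.mk P₀.1 (u i.1.1 i.2)) = 0 := by
      have h := Ideal.Quotient.eq_zero_iff_mem.mpr hc𝔞
      simpa only [map_sum, map_mul, map_intCast] using h
    rw [Fintype.sum_sigma] at hred
    have hvan : ∀ P : ↥s, P ≠ P₀ →
        ∑ l : Fin (Module.finrank ℤ (R ⧸ P.1)), (c ⟨P, l⟩ : R ⧸ P₀.1) *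
            (Ideal.Quotient.mk P₀.1 (e P.1) * Ideal.Quotient.mk P₀.1 (u P.1 l)) = 0 := by
      intro P hPP₀
      refine Finset.sum_eq_zero fun l _ ↦ ?_
      have hePmem : e P.1 ∈ P₀.1 := heQ P.1 P.2 P₀.1 P₀.2 (fun h ↦ hPP₀ (Subtype.ext h).symm)
      rw [Ideal.Quotient.eq_zero_iff_mem.mpr hePmem, zero_mul, mul_zero]
    rw [Finset.sum_eq_single P₀ (fun P _ hP ↦ hvan P hP) (fun h ↦ (h (Finset.mem_univ _)).elim)]
      at hred
    have hred' : Ideal.Quotient.mk P₀.1 (e P₀.1) *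
        ∑ l : Fin (Module.finrank ℤ (R ⧸ P₀.1)), (c ⟨P₀, l⟩ : R ⧸ P₀.1) * b P₀.1 l = 0 := by
      rw [Finset.mul_sum, ← hred]
      refine Finset.sum_congr rfl fun l _ ↦ ?_
      rw [hu]
      ring
    have he0 : Ideal.Quotient.mk P₀.1 (e P₀.1) ≠ 0 := fun h ↦
      heP P₀.1 P₀.2 (Ideal.Quotient.eq_zero_iff_mem.mp h)
    have hsum : ∑ l : Fin (Module.finrank ℤ (R ⧸ P₀.1)), c ⟨P₀, l⟩ • b P₀.1 l = 0 := by
      simpa only [zsmul_eq_mul] using (mul_eq_zero.mp hred').resolve_left he0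
    exact Fintype.linearIndependent_iff.mp (hb P₀.1 P₀.2) (fun l ↦ c ⟨P₀, l⟩) hsum l₀
  have hcard := hw.fintype_card_le_finrank
  rw [Fintype.card_sigma] at hcard
  simp only [Fintype.card_fin] at hcard
  rwa [Finset.sum_coe_sort s (fun P ↦ Module.finrank ℤ (R ⧸ P))] at hcard

/-- **`Σ_{P ∈ s} rank_ℤ(𝕋 ⧸ P) ≤ rank_ℤ(𝕋 ⧸ 𝔞)`** for minimal primes `P ⊇ 𝔞` of the Hecke ring
`𝕋 = anemicHeckeRing N k` (incomparable, with free quotients `free_quotient_of_mem_minimalPrimes`).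
[folklore] -/
theorem sum_finrank_quotient_le_finrank_quotient (𝔞 : Ideal (anemicHeckeRing N k))
    (s : Finset (Ideal (anemicHeckeRing N k)))
    (hs : ∀ P ∈ s, P ∈ minimalPrimes (anemicHeckeRing N k)) (h𝔞 : ∀ P ∈ s, 𝔞 ≤ P) :
    ∑ P ∈ s, Module.finrank ℤ (anemicHeckeRing N k ⧸ P) ≤
      Module.finrank ℤ (anemicHeckeRing N k ⧸ 𝔞) :=
  sum_finrank_quotient_le_finrank_quotient_of_pairwise_not_le 𝔞 s (fun P hP ↦ (hs P hP).1.1)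
    (fun P hP Q hQ hPQ hle ↦ hPQ (le_antisymm ((hs P hP).2 ⟨(hs Q hQ).1.1, bot_le⟩ hle) hle))
    (fun P hP ↦ free_quotient_of_mem_minimalPrimes (hs P hP)) h𝔞

/-- **`Σ_{P ∈ s} rank_ℤ(𝕋 ⧸ P) ≤ dim_ℂ ker t` for minimal primes `P ∋ t`, over a simultaneous
eigenbasis `v`.** With `I = {i : t v_i = 0}` and `𝔞 = ⋂_{i ∈ I} 𝕀_{v_i}`: every minimal `P ∋ t` is
`𝕀_φ` for an Atkin–Lehner eigenform `φ` (`exists_isNewform0_eigenIdeal_eq_of_mem_minimalPrimes`)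
with `t φ = 0`, so `φ ∈ ker t ⊆ span{v_i : i ∈ I}` and `𝔞 ⊆ P`; hence
`Σ rank(𝕋 ⧸ P) ≤ rank(𝕋 ⧸ 𝔞) ≤ #{χ_{v_i} : i ∈ I} ≤ #I ≤ dim ker t`
(`sum_finrank_quotient_le_finrank_quotient`, `finrank_quotient_le_card_systems_of_int_smul` with the
element of `exists_int_smul_on_ker`, `card_filter_le_finrank_ker`). [cite: PastenShimura2024, §4.11 p. 16] -/
theorem sum_finrank_quotient_le_finrank_ker_of_eigenbasis {ι : Type*} [Fintype ι]
    (v : ι → CuspForm (Gamma0 N) k) (hv : LinearIndependent ℂ v)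
    (hsp : ⊤ ≤ Submodule.span ℂ (Set.range v)) (hev : ∀ i, IsAnemicEigenvector (v i))
    (t : anemicHeckeRing N k) (s : Finset (Ideal (anemicHeckeRing N k)))
    (hs : ∀ P ∈ s, P ∈ minimalPrimes (anemicHeckeRing N k)) (ht : ∀ P ∈ s, t ∈ P) :
    ∑ P ∈ s, Module.finrank ℤ (anemicHeckeRing N k ⧸ P) ≤
      Module.finrank ℂ (LinearMap.ker (t : Module.End ℂ (CuspForm (Gamma0 N) k))) := by
  classical
  set I : Finset ι := Finset.univ.filter fun i ↦
    (t : Module.End ℂ (CuspForm (Gamma0 N) k)) (v i) = 0 with hI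
  have hmemI : ∀ i, i ∈ I ↔ (t : Module.End ℂ (CuspForm (Gamma0 N) k)) (v i) = 0 := fun i ↦ by
    rw [hI, Finset.mem_filter]
    exact ⟨fun h ↦ h.2, fun h ↦ ⟨Finset.mem_univ _, h⟩⟩
  set 𝔞 : Ideal (anemicHeckeRing N k) := I.inf fun i ↦ eigenIdeal (v i) with h𝔞_def
  have hmem𝔞 : ∀ x : anemicHeckeRing N k, x ∈ 𝔞 ↔
      ∀ i ∈ I, (x : Module.End ℂ (CuspForm (Gamma0 N) k)) (v i) = 0 := fun x ↦ by
    rw [h𝔞_def, Submodule.mem_finsetInf]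
    exact forall₂_congr fun i _ ↦ mem_eigenIdeal
  have hv0 : ∀ i, v i ≠ 0 := fun i ↦ hv.ne_zero i
  -- the element `g`
  obtain ⟨g, c, hc, hgker, hgrange⟩ := exists_int_smul_on_ker v hv hsp hev t
  have hgI : ∀ i ∈ I, (g : Module.End ℂ (CuspForm (Gamma0 N) k)) (v i) = (c : ℂ) • v i :=
    fun i hi ↦ hgker (v i) ((hmemI i).mp hi)
  have hgI' : ∀ i, i ∉ I → (g : Module.End ℂ (CuspForm (Gamma0 N) k)) (v i) = 0 := by
    intro i hi
    rw [hmemI] at hi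
    have h := hgrange (v i)
    rw [(hev i).apply_eq_smul g, map_smul, (hev i).apply_eq_smul t, smul_smul] at h
    have ht0 : anemicEigenvalue (v i) t ≠ 0 := by
      intro h0
      apply hi
      rw [(hev i).apply_eq_smul t, h0, zero_smul]
    have hg0 : anemicEigenvalue (v i) g = 0 := by
      rcases smul_eq_zero.mp h with h1 | h1
      · exact (mul_eq_zero.mp h1).resolve_right ht0
      · exact absurd h1 (hv0 i)
    rw [(hev i).apply_eq_smul g, hg0, zero_smul]
  -- `𝔞 ⊆ P` for `P ∈ s`
  have h𝔞P : ∀ P ∈ s, 𝔞 ≤ P := by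
    intro P hP x hx
    obtain ⟨y, φg, hφg, hφ0, hPφ⟩ := exists_isNewform0_eigenIdeal_eq_of_mem_minimalPrimes (hs P hP)
    set φ := degeneracyMap0 y.1.1 N y.1.2 k φg with hφ
    have htφ : (t : Module.End ℂ (CuspForm (Gamma0 N) k)) φ = 0 := by
      have h := ht P hP
      rw [hPφ] at h
      exact mem_eigenIdeal.mp h
    have hφspan := ker_le_span_of_eigenbasis v hv hsp hev t (LinearMap.mem_ker.mpr htφ)
    rw [hPφ, mem_eigenIdeal]
    have hle : Submodule.span ℂ (v '' {i | (t : Module.End ℂ (CuspForm (Gamma0 N) k)) (v i) = 0}) ≤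
        LinearMap.ker (x : Module.End ℂ (CuspForm (Gamma0 N) k)) := by
      rw [Submodule.span_le]
      rintro _ ⟨i, hi, rfl⟩
      exact LinearMap.mem_ker.mpr (((hmem𝔞 x).mp hx) i ((hmemI i).mpr hi))
    exact LinearMap.mem_ker.mp (hle hφspan)
  calc ∑ P ∈ s, Module.finrank ℤ (anemicHeckeRing N k ⧸ P)
      ≤ Module.finrank ℤ (anemicHeckeRing N k ⧸ 𝔞) :=
        sum_finrank_quotient_le_finrank_quotient 𝔞 s hs h𝔞P
    _ ≤ (I.image fun i ↦ anemicEigenvalue (v i)).card :=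
        finrank_quotient_le_card_systems_of_int_smul v hv hsp hev I g c hc hgI hgI' _
          fun i hi ↦ Finset.mem_image_of_mem _ hi
    _ ≤ I.card := Finset.card_image_le
    _ ≤ Module.finrank ℂ (LinearMap.ker (t : Module.End ℂ (CuspForm (Gamma0 N) k))) :=
        card_le_finrank_ker v hv t I fun i hi ↦ (hmemI i).mp hi

/-- **`Σ_{P ∈ s} rank_ℤ(𝕋 ⧸ P) ≤ dim_ℂ ker t` for any finite set `s` of minimal primes of
`𝕋 = 𝕋_{1,N}` (any weight) all containing `t ∈ 𝕋`**: the total size `Σ #c` of the classes of systems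
of Hecke eigenvalues `c` with `χ(t) = 0` for `χ ∈ c` is at most the dimension of the kernel of `t`
on `S_k(Γ₀(N))` (with the Atkin–Lehner eigenbasis in
`sum_finrank_quotient_le_finrank_ker_of_eigenbasis`). For `t = T_ℓ − a` this kernel is the
`a`-eigenspace of `T_ℓ`, whose dimension Murty–Sinha bound. [cite: PastenShimura2024, §4.11 p. 16] -/
theorem sum_finrank_quotient_le_finrank_ker (t : anemicHeckeRing N k)
    (s : Finset (Ideal (anemicHeckeRing N k)))
    (hs : ∀ P ∈ s, P ∈ minimalPrimes (anemicHeckeRing N k)) (ht : ∀ P ∈ s, t ∈ P) :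
    ∑ P ∈ s, Module.finrank ℤ (anemicHeckeRing N k ⧸ P) ≤
      Module.finrank ℂ (LinearMap.ker (t : Module.End ℂ (CuspForm (Gamma0 N) k))) := by
  classical
  haveI := finite_atkinLehnerIndex N
  haveI : Fintype (AtkinLehnerIndex N) := Fintype.ofFinite _
  haveI : ∀ y : {y : AtkinLehnerIndex N // y.1.2 = 1}, Fintype ↥(newforms0 y.1.1.1 k) :=
    fun y ↦ (finite_newforms0_holds y.1.1.1 k).fintype
  exact sum_finrank_quotient_le_finrank_ker_of_eigenbasis _
    (linearIndependent_degeneracyMap0_newforms N k) (span_degeneracyMap0_newforms_eq_top N k)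
    (isAnemicEigenvector_degeneracyMap0_newforms N k) t s hs ht

end KernelCount

/-! ### Two analytic lemmas: a small prime off `N` (Chebyshev), and `ψ(N) ≪ N log log N` (Mertens) -/

section Analytic

open Filter Asymptotics Real

/-- `log(x + 1) = o(x)`. [folklore] -/
private theorem isLittleO_log_add_one_id :
    (fun x : ℝ ↦ Real.log (x + 1)) =o[atTop] fun x ↦ x := by
  have h1 : (fun x : ℝ ↦ Real.log (x + 1)) =o[atTop] fun x ↦ x + 1 :=
    Real.isLittleO_log_id_atTop.comp_tendsto (tendsto_atTop_add_const_right _ 1 tendsto_id)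
  have h2 : (fun x : ℝ ↦ x + 1) =O[atTop] fun x ↦ x := by
    refine IsBigO.of_bound 2 ?_
    filter_upwards [eventually_ge_atTop (1 : ℝ)] with x hx
    rw [Real.norm_of_nonneg (by linarith), Real.norm_of_nonneg (by linarith)]
    linarith
  exact h1.trans_isBigO h2

/-- `√x log x = o(x)`. [folklore] -/
private theorem isLittleO_sqrt_mul_log_id :
    (fun x : ℝ ↦ Real.sqrt x * Real.log x) =o[atTop] fun x ↦ x := by
  have h1 : (fun x : ℝ ↦ Real.log x) =o[atTop] fun x ↦ x ^ (1 / 2 : ℝ) :=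
    isLittleO_log_rpow_atTop (by norm_num)
  have h2 : (fun x : ℝ ↦ Real.sqrt x * Real.log x) =o[atTop] fun x ↦ Real.sqrt x * x ^ (1 / 2 : ℝ) :=
    IsBigO.mul_isLittleO (isBigO_refl _ _) h1
  refine h2.trans_isBigO (IsBigO.of_bound 1 ?_)
  filter_upwards [eventually_ge_atTop (0 : ℝ)] with x hx
  rw [Real.sqrt_eq_rpow, ← Real.rpow_add' hx (by norm_num), show (1 / 2 + 1 / 2 : ℝ) = 1 by norm_num,
    Real.rpow_one, one_mul]

/-- **Chebyshev, eventual form**: `θ(n) ≥ n/2` for all large `n` (from Mathlib's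
`Chebyshev.theta_ge`: `θ(n) ≥ n log 2 − log(n+1) − 2√n log n`). [folklore] -/
private theorem exists_forall_half_le_theta :
    ∃ n₀ : ℕ, ∀ n : ℕ, n₀ ≤ n → (n : ℝ) / 2 ≤ Chebyshev.theta (n : ℝ) := by
  have h : (fun y : ℝ ↦ Real.log (y + 1) + 2 * (Real.sqrt y * Real.log y)) =o[atTop] fun y ↦ y :=
    isLittleO_log_add_one_id.add (isLittleO_sqrt_mul_log_id.const_mul_left 2)
  have hev := h.def (show (0 : ℝ) < Real.log 2 - 1 / 2 by have := Real.log_two_gt_d9; linarith)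
  rw [Filter.eventually_atTop] at hev
  obtain ⟨y₀, hy₀⟩ := hev
  refine ⟨Nat.ceil (max y₀ 1), fun n hn ↦ ?_⟩
  have hny : y₀ ≤ (n : ℝ) := le_trans (le_trans (le_max_left _ _) (Nat.le_ceil _)) (by exact_mod_cast hn)
  have hn1 : (1 : ℝ) ≤ n := le_trans (le_trans (le_max_right _ _) (Nat.le_ceil _)) (by exact_mod_cast hn)
  have hb := hy₀ n hny
  have hnn : 0 ≤ Real.log ((n : ℝ) + 1) + 2 * (Real.sqrt n * Real.log n) := by
    have : 0 ≤ Real.log ((n : ℝ) + 1) := Real.log_nonneg (by linarith)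
    have : 0 ≤ Real.sqrt n * Real.log n := mul_nonneg (Real.sqrt_nonneg _) (Real.log_nonneg hn1)
    positivity
  rw [Real.norm_of_nonneg hnn, Real.norm_of_nonneg (Nat.cast_nonneg n)] at hb
  have hθ := Chebyshev.theta_ge n
  linarith

/-- **A prime `ℓ ∤ N` with `ℓ ≤ 2 log N + O(1)`**: if every prime `p ≤ n` divides `N` then
`θ(n) = log ∏_{p ≤ n} p ≤ log N`, while `θ(n) ≥ n/2` for `n` large. [folklore] -/
theorem exists_prime_not_dvd_le_log :
    ∃ C : ℝ, ∀ N : ℕ, N ≠ 0 → ∃ ℓ : ℕ, ℓ.Prime ∧ ¬ ℓ ∣ N ∧ (ℓ : ℝ) ≤ 2 * Real.log N + C := by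
  obtain ⟨n₀, hn₀⟩ := exists_forall_half_le_theta
  refine ⟨n₀ + 2, fun N hN ↦ ?_⟩
  set n : ℕ := ⌊2 * Real.log N⌋₊ + n₀ + 2 with hn
  have hlogN : 0 ≤ Real.log N := Real.log_natCast_nonneg N
  -- some prime `≤ n` does not divide `N`
  by_contra hcon
  push Not at hcon
  have hall : ∀ p : ℕ, p.Prime → p ≤ n → p ∣ N := by
    intro p hp hpn
    by_contra hpN
    have h := hcon p hp hpN
    have hfl : (⌊2 * Real.log N⌋₊ : ℝ) ≤ 2 * Real.log N := Nat.floor_le (by positivity)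
    have hpn' : (p : ℝ) ≤ n := by exact_mod_cast hpn
    rw [hn] at hpn'
    push_cast at hpn'
    linarith
  -- hence `primorial n ∣ N` and `θ n ≤ log N`
  have hdvd : primorial n ∣ N := by
    unfold primorial
    exact Finset.prod_primes_dvd N (fun p hp ↦ (Finset.mem_filter.mp hp).2.prime)
      fun p hp ↦ hall p (Finset.mem_filter.mp hp).2
        (Nat.lt_succ_iff.mp (Finset.mem_range.mp (Finset.mem_filter.mp hp).1))
  have hθle : Chebyshev.theta (n : ℝ) ≤ Real.log N := by
    rw [Chebyshev.theta_eq_log_primorial, Nat.floor_natCast]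
    exact Real.log_le_log (by exact_mod_cast primorial_pos n)
      (by exact_mod_cast Nat.le_of_dvd (Nat.pos_of_ne_zero hN) hdvd)
  -- but `θ n ≥ n/2 > log N`
  have hθge := hn₀ n (by rw [hn]; omega)
  have hngt : Real.log N < (n : ℝ) / 2 := by
    have hfl : 2 * Real.log N < (⌊2 * Real.log N⌋₊ : ℝ) + 1 := Nat.lt_floor_add_one _
    have hn₀0 : (0 : ℝ) ≤ n₀ := Nat.cast_nonneg n₀
    rw [hn]
    push_cast
    linarith
  linarith

/-- `Σ_{p ∣ N} 1/p ≤ Σ_{p ≤ log N} 1/p + ω(N)/log N`. [folklore] -/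
private theorem sum_primeFactors_inv_le (N : ℕ) (hN : N ≠ 0) :
    ∑ p ∈ N.primeFactors, (p : ℝ)⁻¹ ≤
      Literature.NumberTheory.LFunctions.Mertens.primeRecipSum (Real.log N) +
        N.primeFactors.card * (Real.log N)⁻¹ := by
  classical
  set y : ℕ := ⌊Real.log N⌋₊ with hy
  rw [← Finset.sum_filter_add_sum_filter_not N.primeFactors (fun p ↦ p ≤ y)]
  refine add_le_add ?_ ?_
  · -- small primes: a sub-sum of `primeRecipSum`
    unfold Literature.NumberTheory.LFunctions.Mertens.primeRecipSum
    refine Finset.sum_le_sum_of_subset_of_nonneg (fun p hp ↦ ?_) fun _ _ _ ↦ by positivity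
    rw [Finset.mem_filter] at hp
    exact Nat.mem_primesLE.mpr ⟨hp.2, Nat.prime_of_mem_primeFactors hp.1⟩
  · -- large primes: each term is `≤ 1/log N`, and there are at most `ω(N)` of them
    have hterm : ∀ p ∈ N.primeFactors.filter (fun p ↦ ¬ p ≤ y), (p : ℝ)⁻¹ ≤ (Real.log N)⁻¹ := by
      intro p hp
      rw [Finset.mem_filter, not_le] at hp
      have hp1 : (y : ℝ) + 1 ≤ p := by exact_mod_cast hp.2
      have hlt : Real.log N < (y : ℝ) + 1 := Nat.lt_floor_add_one _
      have hppos : (0 : ℝ) < p := by exact_mod_cast (Nat.prime_of_mem_primeFactors hp.1).pos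
      -- `N ≥ p ≥ 2`, so `log N > 0`
      have hN2 : (2 : ℝ) ≤ N := by
        have h2p := (Nat.prime_of_mem_primeFactors hp.1).two_le
        have hpN := Nat.le_of_dvd (Nat.pos_of_ne_zero hN) (Nat.dvd_of_mem_primeFactors hp.1)
        exact_mod_cast h2p.trans hpN
      have hl : 0 < Real.log N := Real.log_pos (by linarith)
      exact (inv_le_inv₀ hppos hl).mpr (by linarith)
    calc ∑ p ∈ N.primeFactors.filter (fun p ↦ ¬ p ≤ y), (p : ℝ)⁻¹
        ≤ ∑ p ∈ N.primeFactors.filter (fun p ↦ ¬ p ≤ y), (Real.log N)⁻¹ := Finset.sum_le_sum hterm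
      _ = (N.primeFactors.filter (fun p ↦ ¬ p ≤ y)).card * (Real.log N)⁻¹ := by
          rw [Finset.sum_const, nsmul_eq_mul]
      _ ≤ N.primeFactors.card * (Real.log N)⁻¹ :=
          mul_le_mul_of_nonneg_right (by exact_mod_cast Finset.card_le_card (Finset.filter_subset _ _))
            (inv_nonneg.mpr (Real.log_natCast_nonneg N))

/-- `2^{ω(N)} ≤ N`, i.e. `ω(N) log 2 ≤ log N`. [folklore] -/
private theorem card_primeFactors_mul_log_two_le (N : ℕ) (hN : N ≠ 0) :
    (N.primeFactors.card : ℝ) * Real.log 2 ≤ Real.log N := by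
  have h : 2 ^ N.primeFactors.card ≤ N := by
    calc 2 ^ N.primeFactors.card = ∏ _p ∈ N.primeFactors, 2 := (Finset.prod_const 2).symm
      _ ≤ ∏ p ∈ N.primeFactors, p := Finset.prod_le_prod (fun _ _ ↦ Nat.zero_le _) fun p hp ↦
          (Nat.prime_of_mem_primeFactors hp).two_le
      _ ≤ N := Nat.le_of_dvd (Nat.pos_of_ne_zero hN) (Nat.prod_primeFactors_dvd N)
  have h' : ((2 : ℕ) : ℝ) ^ N.primeFactors.card ≤ N := by exact_mod_cast h
  have h'' := Real.log_le_log (by positivity) h'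
  rwa [Real.log_pow, Nat.cast_ofNat] at h''

/-- **`∏_{p ∣ N} (1 + 1/p) ≤ C log log N` for `N ≥ 16`** (Mertens: `Σ_{p ≤ x} 1/p ≤ log log x + B₁ +
8/log x`, the tree's `abs_primeRecipSum_sub_le`, at `x = log N`, plus `ω(N)/log N ≤ 1/log 2`, and
`1 + u ≤ eᵘ`). [cite: HardyWright2008, Thm 427 (§22.7)] -/
theorem exists_prod_primeFactors_one_add_inv_le :
    ∃ C : ℝ, 0 < C ∧ ∀ N : ℕ, 16 ≤ N →
      ∏ p ∈ N.primeFactors, (1 + (p : ℝ)⁻¹) ≤ C * Real.log (Real.log N) := by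
  set M := Literature.NumberTheory.LFunctions.Mertens.meisselMertens with hM
  refine ⟨Real.exp (|M| + 8 / Real.log 2 + (Real.log 2)⁻¹), Real.exp_pos _, fun N hN ↦ ?_⟩
  have hN0 : N ≠ 0 := by omega
  have hNr : (16 : ℝ) ≤ N := by exact_mod_cast hN
  -- `log N ≥ 2` and `log log N ≥ log 2`
  have hlogN : 2 ≤ Real.log N := by
    rw [Real.le_log_iff_exp_le (by linarith)]
    have h := Real.exp_one_lt_d9
    have h2 : Real.exp 2 = Real.exp 1 * Real.exp 1 := by rw [← Real.exp_add]; norm_num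
    nlinarith [Real.exp_pos 1]
  have hlogN0 : 0 < Real.log N := by linarith
  have hloglog : Real.log 2 ≤ Real.log (Real.log N) := Real.log_le_log two_pos hlogN
  have hlog2 : 0 < Real.log 2 := Real.log_pos one_lt_two
  have hloglog0 : 0 < Real.log (Real.log N) := lt_of_lt_of_le hlog2 hloglog
  -- Mertens at `x = log N`
  have hMert := Literature.NumberTheory.LFunctions.Mertens.abs_primeRecipSum_sub_le hlogN
  have hprs : Literature.NumberTheory.LFunctions.Mertens.primeRecipSum (Real.log N) ≤
      Real.log (Real.log (Real.log N)) + |M| + 8 / Real.log 2 := by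
    have h1 := (abs_le.mp hMert).2
    have h2 : 8 / Real.log (Real.log N) ≤ 8 / Real.log 2 :=
      div_le_div_of_nonneg_left (by norm_num) hlog2 hloglog
    have h3 : M ≤ |M| := le_abs_self M
    linarith
  -- `Σ_{p ∣ N} 1/p ≤ log log log N + const`
  have hsum : ∑ p ∈ N.primeFactors, (p : ℝ)⁻¹ ≤
      Real.log (Real.log (Real.log N)) + (|M| + 8 / Real.log 2 + (Real.log 2)⁻¹) := by
    have h1 := sum_primeFactors_inv_le N hN0
    have hω : (N.primeFactors.card : ℝ) * (Real.log N)⁻¹ ≤ (Real.log 2)⁻¹ := by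
      rw [mul_inv_le_iff₀ hlogN0, ← div_eq_inv_mul, le_div_iff₀ hlog2]
      exact card_primeFactors_mul_log_two_le N hN0
    linarith
  -- `∏ (1 + 1/p) ≤ exp(Σ 1/p)`
  have hprod : ∏ p ∈ N.primeFactors, (1 + (p : ℝ)⁻¹) ≤ Real.exp (∑ p ∈ N.primeFactors, (p : ℝ)⁻¹) := by
    rw [Real.exp_sum]
    exact Finset.prod_le_prod (fun p _ ↦ by positivity) fun p _ ↦ by
      have := Real.add_one_le_exp ((p : ℝ)⁻¹); linarith
  calc ∏ p ∈ N.primeFactors, (1 + (p : ℝ)⁻¹)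
      ≤ Real.exp (∑ p ∈ N.primeFactors, (p : ℝ)⁻¹) := hprod
    _ ≤ Real.exp (Real.log (Real.log (Real.log N)) + (|M| + 8 / Real.log 2 + (Real.log 2)⁻¹)) :=
        Real.exp_le_exp.mpr hsum
    _ = Real.exp (|M| + 8 / Real.log 2 + (Real.log 2)⁻¹) * Real.log (Real.log N) := by
        rw [Real.exp_add, Real.exp_log hloglog0, mul_comm]

variable (N : ℕ) [NeZero N]

/-- `ψ(N) = N ∏_{p ∣ N} (1 + 1/p)` over `ℝ` (`gamma0Index_eq_mul_prod_one_add_inv`). [folklore] -/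
theorem gamma0Index_eq_mul_prod_one_add_inv_real :
    (gamma0Index N : ℝ) = N * ∏ p ∈ N.primeFactors, (1 + (p : ℝ)⁻¹) := by
  have hN : N ≠ 0 := NeZero.ne N
  have hNprod : (N : ℝ) = ∏ p ∈ N.primeFactors, (p : ℝ) ^ (N.factorization p) := by
    have h := congrArg (Nat.cast (R := ℝ)) (Nat.prod_factorization_pow_eq_self hN)
    rw [Finsupp.prod, Nat.support_factorization] at h
    push_cast at h
    exact h.symm
  unfold gamma0Index
  rw [Finsupp.prod, Nat.support_factorization, Nat.cast_prod, hNprod, ← Finset.prod_mul_distrib]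
  refine Finset.prod_congr rfl fun p hp ↦ ?_
  have hprime : p.Prime := Nat.prime_of_mem_primeFactors hp
  have hp0 : (p : ℝ) ≠ 0 := Nat.cast_ne_zero.mpr hprime.ne_zero
  have hk : 0 < N.factorization p :=
    Nat.Prime.factorization_pos_of_dvd hprime hN (Nat.dvd_of_mem_primeFactors hp)
  obtain ⟨j, hj⟩ : ∃ j, N.factorization p = j + 1 := ⟨N.factorization p - 1, by omega⟩
  rw [hj, Nat.add_sub_cancel]
  push_cast
  rw [pow_succ]
  field_simp

/-- **`dim S₂(Γ₀(N)) ≤ ψ(N)/12 + 1`** (genus formula, `twelve_mul_finrank_cuspForm_two_add_le_gamma0Index`).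
[cite: DiamondShurman2005, Thm. 3.1.1] -/
theorem finrank_cuspForm_two_le_gamma0Index :
    (Module.finrank ℂ (CuspForm (Gamma0 N) 2) : ℝ) ≤ (gamma0Index N : ℝ) / 12 + 1 := by
  have h := twelve_mul_finrank_cuspForm_two_add_le_gamma0Index N
  have h' : 12 * Module.finrank ℂ (CuspForm (Gamma0 N) 2) ≤ 12 + gamma0Index N := by omega
  have h'' : (12 : ℝ) * Module.finrank ℂ (CuspForm (Gamma0 N) 2) ≤ 12 + gamma0Index N := by
    exact_mod_cast h'
  linarith

end Analytic

end Literature.NumberTheory.EllipticCurves.ModularForms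

namespace Literature.NumberTheory.EllipticCurves

open ModularForms WeierstrassCurve

namespace Pasten2024

/-! ### The congruence modulus of a class distinguished at a given prime -/

variable {N : ℕ} [NeZero N] {W : WeierstrassCurve ℚ}

/-- **`log η_{[χ₀]}(P) ≤ #c · (log 4 + ½ log ℓ)` for a class distinguished from `χ₀` at the prime
`ℓ ∤ N`** (Pasten, proof of Thm. 7.2, p. 26: `η ≤ |P(a_ℓ(f))| ≤ (2√ℓ + |a_ℓ(f)|)^{#c} ≤ (4√ℓ)^{#c}` by
Prop. 5.4 with the integer polynomial of `T_ℓ` and the Hasse–Weil bound `h2`), for a minimal prime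
`P` of `𝕋` NOT containing `T_ℓ − a_ℓ(f)`; as steps (3)–(7) of
`log_heckeCongruenceModulus_le_of_distinguishingIndex`, at the given prime.
[cite: PastenShimura2024, proof of Thm. 7.2, p. 26] -/
theorem log_heckeCongruenceModulus_le_of_not_mem
    (h2 : ∀ (N : ℕ) [NeZero N] (p : ℕ) [NeZero p], p.Prime → ¬ p ∣ N → ∀ μ : ℂ,
      Module.End.HasEigenvalue (heckeT (Gamma0 N) 2 p) μ → ‖μ‖ ≤ 2 * Real.sqrt p)
    [W.IsElliptic] (D : ModularParametrizationData W N) {ℓ : ℕ} (hℓ : ℓ.Prime) (hℓN : ¬ ℓ ∣ N)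
    {P : Ideal (anemicHeckeRing N 2)} (hP : P ∈ minimalPrimes (anemicHeckeRing N 2))
    (hPne : P ≠ eigenIdeal D.f)
    (htP : (haveI : NeZero ℓ := ⟨hℓ.ne_zero⟩;
      anemicHeckeRing.T N 2 ℓ hℓ hℓN -
        (intEigencharacter D.hasIntegralEigenvalues_f D.f_ne_zero (anemicHeckeRing.T N 2 ℓ hℓ hℓN) :
          anemicHeckeRing N 2)) ∉ P) :
    Real.log (heckeCongruenceModulus D.f P) ≤
      (Module.finrank ℤ (anemicHeckeRing N 2 ⧸ P) : ℝ) * (Real.log 4 + Real.log ℓ / 2) := by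
  haveI : NeZero ℓ := ⟨hℓ.ne_zero⟩
  have hf := D.hasIntegralEigenvalues_f
  have hf0 := D.f_ne_zero
  set t : anemicHeckeRing N 2 := anemicHeckeRing.T N 2 ℓ hℓ hℓN with ht
  set a : ℤ := intEigencharacter hf hf0 t with ha_def
  -- the monic integer polynomial killing `T_ℓ`, with roots bounded by `2 √ℓ`
  obtain ⟨q, -, hq0, hroots⟩ := exists_monic_aeval_heckeT_eq_zero_norm_le N 2 ℓ hℓ
    (fun μ hμ ↦ h2 N ℓ hℓ hℓN μ hμ)
  have hqt : aeval t q = 0 := by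
    have h1 := Polynomial.aeval_algHom_apply (anemicHeckeRing N 2).val t q
    rw [Subalgebra.coe_val, ht, anemicHeckeRing.coe_T, hq0] at h1
    rw [ht]
    exact Subtype.ext (h1.symm.trans (ZeroMemClass.coe_zero _).symm)
  -- `|a| ≤ 2 √ℓ`
  have habs : |(a : ℝ)| ≤ 2 * Real.sqrt ℓ := by
    have hev : Module.End.HasEigenvalue (heckeT (Gamma0 N) 2 ℓ) (a : ℂ) := by
      refine Module.End.hasEigenvalue_of_hasEigenvector ⟨Module.End.mem_eigenspace_iff.mpr ?_, hf0⟩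
      rw [← anemicHeckeRing.coe_T N 2 ℓ hℓ hℓN, ← ht, intEigencharacter_spec hf hf0 t]
    have := h2 N ℓ hℓ hℓN _ hev
    rwa [Complex.norm_intCast] at this
  -- `η ≤ (2 √ℓ + |a|)^{#c} ≤ (4 √ℓ)^{#c}`
  have hη := heckeCongruenceModulus_le_pow_finrank hf hf0 hP htP hqt (by positivity) hroots
  set r := Module.finrank ℤ (anemicHeckeRing N 2 ⧸ P) with hr
  have hℓ0 : (0 : ℝ) < ℓ := by exact_mod_cast hℓ.pos
  have hsqrt : 0 < Real.sqrt ℓ := Real.sqrt_pos.mpr hℓ0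
  have hη' : (heckeCongruenceModulus D.f P : ℝ) ≤ (4 * Real.sqrt ℓ) ^ r :=
    hη.trans (pow_le_pow_left₀ (by positivity) (by linarith) r)
  have hηpos : (0 : ℝ) < heckeCongruenceModulus D.f P := by
    exact_mod_cast heckeCongruenceModulus_pos hf hf0 hP hPne
  have h := Real.log_le_log hηpos hη'
  rwa [Real.log_pow, Real.log_mul (by norm_num) hsqrt.ne', Real.log_sqrt hℓ0.le] at h

/-! ### `log δ_{1,N}` split at one good prime -/

/-- **Congruence splitting at one good prime** (hypothesis H1 of the tree's route item
`LogFreeDegreeBound`, crude form, here PROVED): for an elliptic `W` with datum `D` of minimal degree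
in its class at level `N ≥ 11` and a prime `ℓ ∤ N`,

  `log δ_{1,N} ≤ (Σ_{P ≠ P_f} #c) · (log 4 + ½ log ℓ) + dim Eig(T_ℓ, a_ℓ(f)) · (log N + 4 log N / log log N)`.

Proof: `log δ ≤ Σ_{P ≠ P_f} log η_P` (Thm. 5.5, `PastenShimura2024_thm_5_5_holds`); the `P ∌ t`,
`t = T_ℓ − a_ℓ(f)`, contribute `≤ #c (log 4 + ½ log ℓ)` each
(`log_heckeCongruenceModulus_le_of_not_mem`); the `P ∋ t` contribute `< #c (log N + 4 log N/log log N)`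
each (`PastenShimura2024_log_heckeCongruenceModulus_lt_of_weight_two_bound`) and
`Σ_{P ∋ t} #c ≤ dim ker t = dim Eig(T_ℓ, a_ℓ(f))` (`sum_finrank_quotient_le_finrank_ker`).
[cite: PastenShimura2024, Thm. 5.5 and proof of Thm. 7.2 (p. 26)] -/
theorem log_modularDegree_le_of_prime
    (h2 : ∀ (N : ℕ) [NeZero N] (p : ℕ) [NeZero p], p.Prime → ¬ p ∣ N → ∀ μ : ℂ,
      Module.End.HasEigenvalue (heckeT (Gamma0 N) 2 p) μ → ‖μ‖ ≤ 2 * Real.sqrt p)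
    [W.IsElliptic] (D : ModularParametrizationData W N)
    (hmin : ∀ (W' : WeierstrassCurve ℚ) [W'.IsElliptic] (D' : ModularParametrizationData W' N),
      D'.f = D.f → D.modularDegree ≤ D'.modularDegree)
    (hN : 11 ≤ N) {ℓ : ℕ} [NeZero ℓ] (hℓ : ℓ.Prime) (hℓN : ¬ ℓ ∣ N) :
    Real.log (D.modularDegree : ℝ) ≤
      (∑ P ∈ (finite_minimalPrimes_anemicHeckeRing N 2).toFinset.erase (eigenIdeal D.f),
          (Module.finrank ℤ (anemicHeckeRing N 2 ⧸ P) : ℝ)) * (Real.log 4 + Real.log ℓ / 2) +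
        (Module.finrank ℂ (Module.End.eigenspace (heckeT (Gamma0 N) 2 ℓ)
          ((qExpansion 1 ⇑D.f).coeff ℓ)) : ℝ) *
          (Real.log N + 4 * Real.log N / Real.log (Real.log N)) := by
  classical
  have hf := D.hasIntegralEigenvalues_f
  have hf0 := D.f_ne_zero
  have hnew : IsNewform0 D.f := D.isNewformOf.1
  set M := (finite_minimalPrimes_anemicHeckeRing N 2).toFinset with hM
  set Pf := eigenIdeal D.f with hPf
  set T : anemicHeckeRing N 2 := anemicHeckeRing.T N 2 ℓ hℓ hℓN with hT
  set a : ℤ := intEigencharacter hf hf0 T with ha_def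
  set t : anemicHeckeRing N 2 := T - (a : anemicHeckeRing N 2) with ht
  have ha : (a : ℂ) = (qExpansion 1 ⇑D.f).coeff ℓ := by
    rw [ha_def, cast_intEigencharacter, hT, eigencharacter_T,
      heckeEigenvalue_eq_coeff_of_isNormalized hnew.2.2 hℓ (hnew.2.1 ℓ hℓ)]
  set cℓ : ℝ := Real.log 4 + Real.log ℓ / 2 with hcℓ
  set cN : ℝ := Real.log N + 4 * Real.log N / Real.log (Real.log N) with hcN
  have hcℓ0 : 0 ≤ cℓ := by
    have : 0 ≤ Real.log 4 := Real.log_nonneg (by norm_num)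
    have : 0 ≤ Real.log ℓ := Real.log_natCast_nonneg ℓ
    positivity
  have hcN0 : 0 ≤ cN := by
    have h1 : 0 ≤ Real.log N := Real.log_natCast_nonneg N
    have h3 : (3 : ℝ) ≤ N := by exact_mod_cast (show 3 ≤ N by omega)
    have h2 : 0 < Real.log (Real.log N) := by
      refine Real.log_pos ?_
      rw [Real.lt_log_iff_exp_lt (by linarith)]
      have := Real.exp_one_lt_d9
      linarith
    positivity
  -- Thm 5.5
  have h55 := log_modularDegree_le_sum_log_heckeCongruenceModulus PastenShimura2024_thm_5_5_holds D hmin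
  rw [← hM, ← hPf] at h55
  -- split the classes at `t`
  rw [← Finset.sum_filter_add_sum_filter_not (M.erase Pf) (fun P ↦ t ∈ P)] at h55
  have hmemM : ∀ P ∈ M.erase Pf, P ∈ minimalPrimes (anemicHeckeRing N 2) ∧ P ≠ Pf := fun P hP ↦
    ⟨(finite_minimalPrimes_anemicHeckeRing N 2).mem_toFinset.mp (Finset.mem_of_mem_erase hP),
      Finset.ne_of_mem_erase hP⟩
  -- classes agreeing at `ℓ`
  have hagr : ∑ P ∈ (M.erase Pf).filter (fun P ↦ t ∈ P), Real.log (heckeCongruenceModulus D.f P : ℝ) ≤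
      (∑ P ∈ (M.erase Pf).filter (fun P ↦ t ∈ P), (Module.finrank ℤ (anemicHeckeRing N 2 ⧸ P) : ℝ)) * cN := by
    rw [Finset.sum_mul]
    refine Finset.sum_le_sum fun P hP ↦ ?_
    obtain ⟨hPmin, hPne⟩ := hmemM P (Finset.mem_of_mem_filter P hP)
    exact (PastenShimura2024_log_heckeCongruenceModulus_lt_of_weight_two_bound h2 N W D hN P hPmin
      hPne).le
  -- classes distinguished at `ℓ`
  have hdist : ∑ P ∈ (M.erase Pf).filter (fun P ↦ ¬ t ∈ P), Real.log (heckeCongruenceModulus D.f P : ℝ) ≤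
      (∑ P ∈ (M.erase Pf).filter (fun P ↦ ¬ t ∈ P), (Module.finrank ℤ (anemicHeckeRing N 2 ⧸ P) : ℝ)) * cℓ := by
    rw [Finset.sum_mul]
    refine Finset.sum_le_sum fun P hP ↦ ?_
    obtain ⟨hPmin, hPne⟩ := hmemM P (Finset.mem_of_mem_filter P hP)
    have htP : t ∉ P := (Finset.mem_filter.mp hP).2
    exact log_heckeCongruenceModulus_le_of_not_mem h2 D hℓ hℓN hPmin hPne htP
  -- the count of the agreeing classes
  have hcount : (∑ P ∈ (M.erase Pf).filter (fun P ↦ t ∈ P),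
      (Module.finrank ℤ (anemicHeckeRing N 2 ⧸ P) : ℝ)) ≤
      Module.finrank ℂ (Module.End.eigenspace (heckeT (Gamma0 N) 2 ℓ) ((qExpansion 1 ⇑D.f).coeff ℓ)) := by
    have h := sum_finrank_quotient_le_finrank_ker t ((M.erase Pf).filter fun P ↦ t ∈ P)
      (fun P hP ↦ (hmemM P (Finset.mem_of_mem_filter P hP)).1) (fun P hP ↦ (Finset.mem_filter.mp hP).2)
    have hker : LinearMap.ker (t : Module.End ℂ (CuspForm (Gamma0 N) 2)) =
        Module.End.eigenspace (heckeT (Gamma0 N) 2 ℓ) ((qExpansion 1 ⇑D.f).coeff ℓ) := by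
      ext w
      rw [LinearMap.mem_ker, Module.End.mem_eigenspace_iff, ht, Subalgebra.coe_sub, LinearMap.sub_apply,
        hT, anemicHeckeRing.coe_T, sub_eq_zero, ← ha, SubringClass.coe_intCast, Module.End.intCast_apply,
        Int.cast_smul_eq_zsmul]
    rw [hker] at h
    exact_mod_cast h
  -- the count of the distinguished classes
  have hcount' : (∑ P ∈ (M.erase Pf).filter (fun P ↦ ¬ t ∈ P),
      (Module.finrank ℤ (anemicHeckeRing N 2 ⧸ P) : ℝ)) ≤
      ∑ P ∈ M.erase Pf, (Module.finrank ℤ (anemicHeckeRing N 2 ⧸ P) : ℝ) :=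
    Finset.sum_le_sum_of_subset_of_nonneg (Finset.filter_subset _ _) fun _ _ _ ↦ Nat.cast_nonneg _
  calc Real.log (D.modularDegree : ℝ)
      ≤ _ := h55
    _ ≤ (∑ P ∈ (M.erase Pf).filter (fun P ↦ t ∈ P), (Module.finrank ℤ (anemicHeckeRing N 2 ⧸ P) : ℝ)) * cN +
        (∑ P ∈ (M.erase Pf).filter (fun P ↦ ¬ t ∈ P), (Module.finrank ℤ (anemicHeckeRing N 2 ⧸ P) : ℝ)) * cℓ :=
        add_le_add hagr hdist
    _ ≤ (Module.finrank ℂ (Module.End.eigenspace (heckeT (Gamma0 N) 2 ℓ)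
          ((qExpansion 1 ⇑D.f).coeff ℓ)) : ℝ) * cN +
        (∑ P ∈ M.erase Pf, (Module.finrank ℤ (anemicHeckeRing N 2 ⧸ P) : ℝ)) * cℓ :=
        add_le_add (mul_le_mul_of_nonneg_right hcount hcN0) (mul_le_mul_of_nonneg_right hcount' hcℓ0)
    _ = _ := by rw [add_comm]

/-- **The one-prime bound with Murty–Sinha's multiplicity estimate**: with `A` the constant of
`murtySinha2009_eigenvalue_multiplicity_weightTwo` (and `|a_ℓ(f)| ≤ 2√ℓ` by `h2`),

  `log δ_{1,N} ≤ (Σ_{P ≠ P_f} #c)(log 4 + ½ log ℓ) + A · dim S₂(Γ₀(N)) · log ℓ / log 2N · (log N + 4 log N/log log N)`.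

[cite: PastenShimura2024, proof of Thm. 7.2, p. 26] [cite: MurtySinha2009, eq. (1) p. 683] -/
theorem log_modularDegree_le_of_multiplicity {A : ℝ}
    (hA : ∀ (N : ℕ) [NeZero N] (p : ℕ) [NeZero p], p.Prime → ¬ p ∣ N →
      ∀ α : ℝ, |α| ≤ 2 * Real.sqrt p →
        (Module.finrank ℂ (Module.End.eigenspace (heckeT (Gamma0 N) 2 p) (α : ℂ)) : ℝ) ≤
          A * Module.finrank ℂ (CuspForm (Gamma0 N) 2) * Real.log p / Real.log (2 * N))
    (h2 : ∀ (N : ℕ) [NeZero N] (p : ℕ) [NeZero p], p.Prime → ¬ p ∣ N → ∀ μ : ℂ,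
      Module.End.HasEigenvalue (heckeT (Gamma0 N) 2 p) μ → ‖μ‖ ≤ 2 * Real.sqrt p)
    [W.IsElliptic] (D : ModularParametrizationData W N)
    (hmin : ∀ (W' : WeierstrassCurve ℚ) [W'.IsElliptic] (D' : ModularParametrizationData W' N),
      D'.f = D.f → D.modularDegree ≤ D'.modularDegree)
    (hN : 11 ≤ N) {ℓ : ℕ} [NeZero ℓ] (hℓ : ℓ.Prime) (hℓN : ¬ ℓ ∣ N) :
    Real.log (D.modularDegree : ℝ) ≤
      (∑ P ∈ (finite_minimalPrimes_anemicHeckeRing N 2).toFinset.erase (eigenIdeal D.f),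
          (Module.finrank ℤ (anemicHeckeRing N 2 ⧸ P) : ℝ)) * (Real.log 4 + Real.log ℓ / 2) +
        A * Module.finrank ℂ (CuspForm (Gamma0 N) 2) * Real.log ℓ / Real.log (2 * N) *
          (Real.log N + 4 * Real.log N / Real.log (Real.log N)) := by
  have hf := D.hasIntegralEigenvalues_f
  have hf0 := D.f_ne_zero
  have hnew : IsNewform0 D.f := D.isNewformOf.1
  set T : anemicHeckeRing N 2 := anemicHeckeRing.T N 2 ℓ hℓ hℓN with hT
  set a : ℤ := intEigencharacter hf hf0 T with ha_def
  have ha : (a : ℂ) = (qExpansion 1 ⇑D.f).coeff ℓ := by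
    rw [ha_def, cast_intEigencharacter, hT, eigencharacter_T,
      heckeEigenvalue_eq_coeff_of_isNormalized hnew.2.2 hℓ (hnew.2.1 ℓ hℓ)]
  have habs : |(a : ℝ)| ≤ 2 * Real.sqrt ℓ := by
    have hev : Module.End.HasEigenvalue (heckeT (Gamma0 N) 2 ℓ) (a : ℂ) := by
      refine Module.End.hasEigenvalue_of_hasEigenvector ⟨Module.End.mem_eigenspace_iff.mpr ?_, hf0⟩
      rw [← anemicHeckeRing.coe_T N 2 ℓ hℓ hℓN, ← hT, intEigencharacter_spec hf hf0 T]
    have := h2 N ℓ hℓ hℓN _ hev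
    rwa [Complex.norm_intCast] at this
  have hmult := hA N ℓ hℓ hℓN (a : ℝ) habs
  rw [Complex.ofReal_intCast, ha] at hmult
  have hcN0 : 0 ≤ Real.log N + 4 * Real.log N / Real.log (Real.log N) := by
    have h1 : 0 ≤ Real.log N := Real.log_natCast_nonneg N
    have h3 : (3 : ℝ) ≤ N := by exact_mod_cast (show 3 ≤ N by omega)
    have h2 : 0 < Real.log (Real.log N) := by
      refine Real.log_pos ?_
      rw [Real.lt_log_iff_exp_lt (by linarith)]
      have := Real.exp_one_lt_d9
      linarith
    positivity
  exact (log_modularDegree_le_of_prime h2 D hmin hN hℓ hℓN).trans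
    (add_le_add le_rfl (mul_le_mul_of_nonneg_right hmult hcN0))

/-! ### Thm. 7.2, asymptotic clause — indeed `log δ_{1,N} = o(N log N)` — from Murty–Sinha -/

open Filter Asymptotics in
/-- The numerical endgame: for constants `K₁, K₂, C ≥ 0` and `ε > 0`, eventually in `u = log N`,
`K₁ (log 4 + ½ L) + K₂ (log u + 1) L ≤ ε u` where `L = log(2u + C)`. [folklore] -/
private theorem eventually_endgame_le {K₁ K₂ C : ℝ} (hK₁ : 0 ≤ K₁) (hK₂ : 0 ≤ K₂) (hC : 0 ≤ C)
    {ε : ℝ} (hε : 0 < ε) :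
    ∃ u₀ : ℝ, ∀ u : ℝ, u₀ ≤ u →
      K₁ * (Real.log 4 + Real.log (2 * u + C) / 2) +
        K₂ * (Real.log u + 1) * Real.log (2 * u + C) ≤ ε * u := by
  -- `L ≤ 2 log u` for `u ≥ max C 3`, so the left side is
  -- `≤ K₁ log 4 + (K₁ + 2 K₂) log u + 2 K₂ (log u)²`, which is `o(u)`
  have hlo : (fun u : ℝ ↦ K₁ * Real.log 4 + (K₁ + 2 * K₂) * Real.log u + 2 * K₂ * Real.log u ^ 2)
      =o[atTop] fun u ↦ u := by
    have h0 : (fun _ : ℝ ↦ K₁ * Real.log 4) =o[atTop] fun u : ℝ ↦ u :=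
      isLittleO_const_id_atTop _
    have h1 : (fun u : ℝ ↦ (K₁ + 2 * K₂) * Real.log u) =o[atTop] fun u ↦ u :=
      Real.isLittleO_log_id_atTop.const_mul_left _
    have h2 : (fun u : ℝ ↦ 2 * K₂ * Real.log u ^ 2) =o[atTop] fun u ↦ u :=
      (Real.isLittleO_pow_log_id_atTop (n := 2)).const_mul_left _
    exact (h0.add h1).add h2
  have hev := hlo.def hε
  rw [Filter.eventually_atTop] at hev
  obtain ⟨u₁, hu₁⟩ := hev
  refine ⟨max u₁ (max C 3), fun u hu ↦ ?_⟩
  have hu1 : u₁ ≤ u := le_trans (le_max_left _ _) hu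
  have huC : C ≤ u := le_trans ((le_max_left _ _).trans (le_max_right _ _)) hu
  have hu3 : 3 ≤ u := le_trans ((le_max_right _ _).trans (le_max_right _ _)) hu
  have hlogu : 1 ≤ Real.log u := by
    rw [Real.le_log_iff_exp_le (by linarith)]
    have := Real.exp_one_lt_d9
    linarith
  have hlogu0 : 0 < Real.log u := by linarith
  -- `L ≤ 2 log u`
  have hL : Real.log (2 * u + C) ≤ 2 * Real.log u := by
    have h3u : 2 * u + C ≤ u * u := by nlinarith
    calc Real.log (2 * u + C) ≤ Real.log (u * u) := Real.log_le_log (by linarith) h3u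
      _ = 2 * Real.log u := by rw [Real.log_mul (by linarith) (by linarith)]; ring
  have hL0 : 0 ≤ Real.log (2 * u + C) := Real.log_nonneg (by linarith)
  have hb := hu₁ u hu1
  have hnn : 0 ≤ K₁ * Real.log 4 + (K₁ + 2 * K₂) * Real.log u + 2 * K₂ * Real.log u ^ 2 := by
    have : 0 ≤ Real.log 4 := Real.log_nonneg (by norm_num)
    positivity
  rw [Real.norm_of_nonneg hnn, Real.norm_of_nonneg (by linarith)] at hb
  have hK₂' : 0 ≤ K₂ * (Real.log u + 1) := by positivity
  calc K₁ * (Real.log 4 + Real.log (2 * u + C) / 2) + K₂ * (Real.log u + 1) * Real.log (2 * u + C)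
      ≤ K₁ * (Real.log 4 + 2 * Real.log u / 2) + K₂ * (Real.log u + 1) * (2 * Real.log u) :=
        add_le_add (mul_le_mul_of_nonneg_left (by linarith) hK₁) (mul_le_mul_of_nonneg_left hL hK₂')
    _ = K₁ * Real.log 4 + (K₁ + 2 * K₂) * Real.log u + 2 * K₂ * Real.log u ^ 2 := by ring
    _ ≤ ε * u := hb

set_option maxHeartbeats 400000 in
/-- **Thm. 7.2, asymptotic clause (`D = 1`, `M = N`), indeed `log δ_{1,N} = o(N log N)`, from
Murty–Sinha's multiplicity bound instead of Murty's Lemma 11.** Granted the weight-`2`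
Ramanujan–Petersson bound `h2` and the named fact `murtySinha2009_eigenvalue_multiplicity_weightTwo`:
for every `ε > 0` there is `N₁` such that `log δ_{1,N} < ε N log N` for every datum `D` of minimal
degree in its class at level `N ≥ N₁` (`D.modularDegree = δ_{1,N}`). Proof: in
`log_modularDegree_le_of_multiplicity` take a prime `ℓ ∤ N` with `ℓ ≤ 2 log N + C`
(`exists_prime_not_dvd_le_log`); bound `Σ_{P ≠ P_f} #c ≤ (1/12 + 1) N`
(`exists_sum_erase_finrank_quotient_le`, Prop. 7.1), `dim S₂(Γ₀(N)) ≤ ψ(N)/12 + 1 ≤ C' N log log N`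
(`finrank_cuspForm_two_le_gamma0Index`, `exists_prod_primeFactors_one_add_inv_le`),
`log ℓ/log 2N · (log N + 4 log N/log log N) ≤ 5 log ℓ` (`N ≥ 16`); the total is
`≪ N (log log N) log(2 log N + C) = o(N log N)` (`eventually_endgame_le`). This replaces the input
"`n_c ≪_ε N^{1+ε}` from Lemma 11 in [MurtyBounds]" of the printed proof (p. 26).
[cite: PastenShimura2024, Thm. 7.2 (asymptotic clause) and its proof, p. 26]
[cite: MurtySinha2009, eq. (1) p. 683 and Theorem 2 p. 682] -/
theorem exists_log_modularDegree_lt_of_murtySinha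
    (hMS : murtySinha2009_eigenvalue_multiplicity_weightTwo)
    (h2 : ∀ (N : ℕ) [NeZero N] (p : ℕ) [NeZero p], p.Prime → ¬ p ∣ N → ∀ μ : ℂ,
      Module.End.HasEigenvalue (heckeT (Gamma0 N) 2 p) μ → ‖μ‖ ≤ 2 * Real.sqrt p)
    {ε : ℝ} (hε : 0 < ε) :
    ∃ N₁ : ℕ, ∀ (N : ℕ) [NeZero N] (W : WeierstrassCurve ℚ) [W.IsElliptic]
      (D : ModularParametrizationData W N),
      (∀ (W' : WeierstrassCurve ℚ) [W'.IsElliptic] (D' : ModularParametrizationData W' N),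
          D'.f = D.f → D.modularDegree ≤ D'.modularDegree) →
        N₁ ≤ N → Real.log (D.modularDegree : ℝ) < ε * (N : ℝ) * Real.log N := by
  obtain ⟨A, hA⟩ := hMS
  set A' : ℝ := max A 0 with hA'
  have hA'0 : 0 ≤ A' := le_max_right _ _
  obtain ⟨C₀, hC₀⟩ := exists_prime_not_dvd_le_log
  set C : ℝ := max C₀ 0 with hC_def
  have hC0 : 0 ≤ C := le_max_right _ _
  obtain ⟨C₁, hC₁pos, hC₁⟩ := exists_prod_primeFactors_one_add_inv_le
  obtain ⟨N₂, hN₂⟩ := exists_sum_erase_finrank_quotient_le (κ := 1) one_pos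
  -- constants of the endgame: `K₁ = 13/12 + 1`, `K₂ = 5 A' (C₁/12 + 1)`, `ε/2`
  obtain ⟨u₀, hu₀⟩ := eventually_endgame_le (K₁ := 1 / 12 + 1) (K₂ := 5 * A' * (C₁ / 12 + 1)) (C := C)
    (by norm_num) (by positivity) hC0 (half_pos hε)
  -- thresholds: `N ≥ N₂`, `N ≥ 21 (≥ e^e)`, `log N ≥ u₀`
  refine ⟨max N₂ (max 21 (Nat.ceil (Real.exp u₀))), fun N _ W _ D hmin hN ↦ ?_⟩
  have hN₂N : N₂ ≤ N := le_trans (le_max_left _ _) hN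
  have hN21 : 21 ≤ N := le_trans ((le_max_left _ _).trans (le_max_right _ _)) hN
  have hN16 : 16 ≤ N := by omega
  have hNexp : (Nat.ceil (Real.exp u₀) : ℝ) ≤ N := by
    exact_mod_cast le_trans ((le_max_right _ _).trans (le_max_right _ _)) hN
  have hN0 : N ≠ 0 := by omega
  have hN11 : 11 ≤ N := by omega
  have hNr : (16 : ℝ) ≤ N := by exact_mod_cast hN16
  have hNpos : (0 : ℝ) < N := by linarith
  set u : ℝ := Real.log N with hu
  have hu0 : u₀ ≤ u := by
    rw [hu, Real.le_log_iff_exp_le hNpos]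
    exact (Nat.le_ceil _).trans hNexp
  have hlogN : 2 ≤ u := by
    rw [hu, Real.le_log_iff_exp_le hNpos]
    have h := Real.exp_one_lt_d9
    have h2 : Real.exp 2 = Real.exp 1 * Real.exp 1 := by rw [← Real.exp_add]; norm_num
    nlinarith [Real.exp_pos 1]
  have hlogN0 : 0 < u := by linarith
  have hN21r : (21 : ℝ) ≤ N := by exact_mod_cast hN21
  have hloglog1 : 1 ≤ Real.log u := by
    rw [Real.le_log_iff_exp_le hlogN0]
    have hexp : Real.exp 1 < 2.7182818286 := Real.exp_one_lt_d9
    have hepos : 0 < Real.exp 1 := Real.exp_pos 1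
    -- `u = log N ≥ log 21 ≥ 3 ≥ e`, via `e³ ≤ 21`
    have hee : Real.exp (Real.exp 1) ≤ (21 : ℝ) := by
      have h3 : Real.exp 1 ≤ 3 := by linarith
      have hsq : Real.exp 1 * Real.exp 1 ≤ 7.39 := by nlinarith
      calc Real.exp (Real.exp 1) ≤ Real.exp 3 := Real.exp_le_exp.mpr h3
        _ = Real.exp 1 * Real.exp 1 * Real.exp 1 := by rw [← Real.exp_add, ← Real.exp_add]; norm_num
        _ ≤ 21 := by nlinarith
    rw [hu, Real.le_log_iff_exp_le hNpos]
    exact hee.trans hN21r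
  -- the prime `ℓ`
  obtain ⟨ℓ, hℓ, hℓN, hℓle⟩ := hC₀ N hN0
  haveI : NeZero ℓ := ⟨hℓ.ne_zero⟩
  have hℓ2 : (2 : ℝ) ≤ ℓ := by exact_mod_cast hℓ.two_le
  have hℓC : (ℓ : ℝ) ≤ 2 * u + C := hℓle.trans (by rw [hu]; exact add_le_add le_rfl (le_max_left _ _))
  have hlogℓ : Real.log ℓ ≤ Real.log (2 * u + C) := Real.log_le_log (by linarith) hℓC
  have hlogℓ0 : 0 ≤ Real.log ℓ := Real.log_nonneg (by linarith)
  have hL0 : 0 ≤ Real.log (2 * u + C) := hlogℓ0.trans hlogℓ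
  have hC₁0 : 0 ≤ C₁ := hC₁pos.le
  -- the one-prime bound
  have hmain := log_modularDegree_le_of_multiplicity hA h2 D hmin hN11 hℓ hℓN
  -- (i) the count of classes
  have hS := hN₂ N W D hN₂N
  have hS0 : 0 ≤ ∑ P ∈ (finite_minimalPrimes_anemicHeckeRing N 2).toFinset.erase (eigenIdeal D.f),
      (Module.finrank ℤ (anemicHeckeRing N 2 ⧸ P) : ℝ) := Finset.sum_nonneg fun _ _ ↦ Nat.cast_nonneg _
  -- (ii) `dim S₂(Γ₀(N)) ≤ C₁ N log log N / 12 + 1 ≤ (C₁/12 + 1) N log u`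
  have hdim : (Module.finrank ℂ (CuspForm (Gamma0 N) 2) : ℝ) ≤ (C₁ / 12 + 1) * N * Real.log u := by
    have h1 := finrank_cuspForm_two_le_gamma0Index N
    have h2' := hC₁ N hN16
    rw [gamma0Index_eq_mul_prod_one_add_inv_real N] at h1
    have h3 : (N : ℝ) * ∏ p ∈ N.primeFactors, (1 + (p : ℝ)⁻¹) ≤ N * (C₁ * Real.log u) :=
      mul_le_mul_of_nonneg_left h2' hNpos.le
    have h4 : (1 : ℝ) ≤ N * Real.log u := by nlinarith
    calc (Module.finrank ℂ (CuspForm (Gamma0 N) 2) : ℝ)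
        ≤ N * (C₁ * Real.log u) / 12 + 1 := by linarith
      _ ≤ N * (C₁ * Real.log u) / 12 + N * Real.log u := by linarith
      _ = (C₁ / 12 + 1) * N * Real.log u := by ring
  -- (iii) `log ℓ / log 2N · c_N ≤ 5 log ℓ`
  have hcN : Real.log N + 4 * Real.log N / Real.log (Real.log N) ≤ 5 * u := by
    rw [← hu]
    have h : 4 * u / Real.log u ≤ 4 * u := by
      rw [div_le_iff₀ (by linarith)]
      nlinarith
    linarith
  have hcN0 : 0 ≤ Real.log N + 4 * Real.log N / Real.log (Real.log N) := by
    rw [← hu]; positivity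
  have hlog2N : u ≤ Real.log (2 * N) := by
    rw [hu]; exact Real.log_le_log hNpos (by linarith)
  have hlog2N0 : 0 < Real.log (2 * N) := lt_of_lt_of_le hlogN0 hlog2N
  have hterm2 : A * Module.finrank ℂ (CuspForm (Gamma0 N) 2) * Real.log ℓ / Real.log (2 * N) *
      (Real.log N + 4 * Real.log N / Real.log (Real.log N)) ≤
      5 * A' * (C₁ / 12 + 1) * (Real.log u + 1) * Real.log (2 * u + C) * N := by
    have hdim0 : (0 : ℝ) ≤ Module.finrank ℂ (CuspForm (Gamma0 N) 2) := Nat.cast_nonneg _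
    -- replace `A` by `A' ≥ A`, `A' ≥ 0`
    have h1 : A * Module.finrank ℂ (CuspForm (Gamma0 N) 2) * Real.log ℓ / Real.log (2 * N) ≤
        A' * Module.finrank ℂ (CuspForm (Gamma0 N) 2) * Real.log ℓ / Real.log (2 * N) := by
      apply div_le_div_of_nonneg_right _ hlog2N0.le
      exact mul_le_mul_of_nonneg_right (mul_le_mul_of_nonneg_right (le_max_left _ _) hdim0) hlogℓ0
    -- `c_N / log 2N ≤ 5`
    have h2' : A' * Module.finrank ℂ (CuspForm (Gamma0 N) 2) * Real.log ℓ / Real.log (2 * N) *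
        (Real.log N + 4 * Real.log N / Real.log (Real.log N)) ≤
        A' * Module.finrank ℂ (CuspForm (Gamma0 N) 2) * Real.log ℓ * 5 := by
      rw [div_mul_eq_mul_div, div_le_iff₀ hlog2N0]
      have hx : 0 ≤ A' * Module.finrank ℂ (CuspForm (Gamma0 N) 2) * Real.log ℓ := by positivity
      calc A' * Module.finrank ℂ (CuspForm (Gamma0 N) 2) * Real.log ℓ *
            (Real.log N + 4 * Real.log N / Real.log (Real.log N))
          ≤ A' * Module.finrank ℂ (CuspForm (Gamma0 N) 2) * Real.log ℓ * (5 * u) :=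
            mul_le_mul_of_nonneg_left hcN hx
        _ ≤ A' * Module.finrank ℂ (CuspForm (Gamma0 N) 2) * Real.log ℓ * (5 * Real.log (2 * N)) := by
            gcongr
        _ = A' * Module.finrank ℂ (CuspForm (Gamma0 N) 2) * Real.log ℓ * 5 * Real.log (2 * N) := by ring
    -- `dim ≤ (C₁/12+1) N log u`, `log ℓ ≤ L`, `log u ≤ log u + 1`
    have h3 : A' * Module.finrank ℂ (CuspForm (Gamma0 N) 2) * Real.log ℓ * 5 ≤
        5 * A' * (C₁ / 12 + 1) * (Real.log u + 1) * Real.log (2 * u + C) * N := by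
      have hlu : Real.log u ≤ Real.log u + 1 := by linarith
      have hlu0 : 0 ≤ Real.log u := by linarith
      calc A' * Module.finrank ℂ (CuspForm (Gamma0 N) 2) * Real.log ℓ * 5
          ≤ A' * ((C₁ / 12 + 1) * N * Real.log u) * Real.log (2 * u + C) * 5 := by gcongr
        _ ≤ A' * ((C₁ / 12 + 1) * N * (Real.log u + 1)) * Real.log (2 * u + C) * 5 := by gcongr
        _ = 5 * A' * (C₁ / 12 + 1) * (Real.log u + 1) * Real.log (2 * u + C) * N := by ring
    exact (mul_le_mul_of_nonneg_right h1 hcN0).trans (h2'.trans h3)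
  have hterm1 : (∑ P ∈ (finite_minimalPrimes_anemicHeckeRing N 2).toFinset.erase (eigenIdeal D.f),
      (Module.finrank ℤ (anemicHeckeRing N 2 ⧸ P) : ℝ)) * (Real.log 4 + Real.log ℓ / 2) ≤
      (1 / 12 + 1) * N * (Real.log 4 + Real.log (2 * u + C) / 2) := by
    have h4 : 0 ≤ Real.log 4 := Real.log_nonneg (by norm_num)
    calc (∑ P ∈ (finite_minimalPrimes_anemicHeckeRing N 2).toFinset.erase (eigenIdeal D.f),
          (Module.finrank ℤ (anemicHeckeRing N 2 ⧸ P) : ℝ)) * (Real.log 4 + Real.log ℓ / 2)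
        ≤ ((1 / 12 + 1) * N) * (Real.log 4 + Real.log ℓ / 2) :=
          mul_le_mul_of_nonneg_right hS (by positivity)
      _ ≤ (1 / 12 + 1) * N * (Real.log 4 + Real.log (2 * u + C) / 2) := by gcongr
  -- the endgame at `u = log N`
  have hend := hu₀ u hu0
  have hNlogN : 0 < (N : ℝ) * u := mul_pos hNpos hlogN0
  calc Real.log (D.modularDegree : ℝ)
      ≤ _ := hmain
    _ ≤ (1 / 12 + 1) * N * (Real.log 4 + Real.log (2 * u + C) / 2) +
        5 * A' * (C₁ / 12 + 1) * (Real.log u + 1) * Real.log (2 * u + C) * N := add_le_add hterm1 hterm2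
    _ = N * ((1 / 12 + 1) * (Real.log 4 + Real.log (2 * u + C) / 2) +
        5 * A' * (C₁ / 12 + 1) * (Real.log u + 1) * Real.log (2 * u + C)) := by ring
    _ ≤ N * (ε / 2 * u) := mul_le_mul_of_nonneg_left hend hNpos.le
    _ = ε / 2 * (N * u) := by ring
    _ < ε * N * Real.log N := by rw [← hu]; nlinarith

/-- **Thm. 7.2, asymptotic clause, as consumed by Thm. 7.5** (`hδ` of
`pasten_thm_7_5_of_modularity_of_optimalDegreeBound`): `log δ_{1,N} < (1/24 + ε) N log N` for
`N ≫_ε 1`, from Murty–Sinha and the weight-`2` bound (`exists_log_modularDegree_lt_of_murtySinha`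
with `ε`, and `0 ≤ (1/24) N log N`). [cite: PastenShimura2024, Thm. 7.2 (asymptotic clause), p. 26] -/
theorem exists_log_modularDegree_lt_of_murtySinha'
    (hMS : murtySinha2009_eigenvalue_multiplicity_weightTwo)
    (h2 : ∀ (N : ℕ) [NeZero N] (p : ℕ) [NeZero p], p.Prime → ¬ p ∣ N → ∀ μ : ℂ,
      Module.End.HasEigenvalue (heckeT (Gamma0 N) 2 p) μ → ‖μ‖ ≤ 2 * Real.sqrt p) :
    ∀ ε : ℝ, 0 < ε → ∃ N₁ : ℕ, ∀ (N : ℕ) [NeZero N] (W : WeierstrassCurve ℚ) [W.IsElliptic]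
      (D : ModularParametrizationData W N),
      (∀ (W' : WeierstrassCurve ℚ) [W'.IsElliptic] (D' : ModularParametrizationData W' N),
          D'.f = D.f → D.modularDegree ≤ D'.modularDegree) →
        N₁ ≤ N → Real.log (D.modularDegree : ℝ) < (1 / 24 + ε) * (N : ℝ) * Real.log N := by
  intro ε hε
  obtain ⟨N₁, hN₁⟩ := exists_log_modularDegree_lt_of_murtySinha hMS h2 hε
  refine ⟨N₁, fun N _ W _ D hmin hN ↦ (hN₁ N W D hmin hN).trans_le ?_⟩
  have h1 : 0 ≤ (N : ℝ) * Real.log N := mul_nonneg (Nat.cast_nonneg N) (Real.log_natCast_nonneg N)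
  nlinarith

end Pasten2024

open Pasten2024

/-! ### The log-free shape: `log δ_{1,N} ≤ C · dim S₂(Γ₀(N)) · log ℓ` for every prime `ℓ ∤ N` -/

namespace Pasten2024

/-- **`rank_ℤ 𝕋_{1,N} ≤ dim_ℂ S_k(Γ₀(N))`** (the systems of Hecke eigenvalues of the Atkin–Lehner
eigenbasis are at most as many as the basis vectors; `finrank_anemicHeckeRing_le_card_systems`).
[cite: PastenShimura2024, §4.11 p. 16] -/
theorem finrank_anemicHeckeRing_le_finrank_cuspForm (N : ℕ) [NeZero N] (k : ℤ) :
    Module.finrank ℤ (anemicHeckeRing N k) ≤ Module.finrank ℂ (CuspForm (Gamma0 N) k) := by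
  classical
  haveI := finite_atkinLehnerIndex N
  haveI : Fintype (AtkinLehnerIndex N) := Fintype.ofFinite _
  haveI : ∀ y : {y : AtkinLehnerIndex N // y.1.2 = 1}, Fintype ↥(newforms0 y.1.1.1 k) :=
    fun y ↦ (finite_newforms0_holds y.1.1.1 k).fintype
  have hv := linearIndependent_degeneracyMap0_newforms N k
  have hsp := span_degeneracyMap0_newforms_eq_top N k
  let X : Finset (anemicHeckeRing N k → ℂ) := Finset.univ.image fun t : (Σ j : (Σ y :
      {y : AtkinLehnerIndex N // y.1.2 = 1}, ↥(newforms0 y.1.1.1 k)),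
      {x : AtkinLehnerIndex N // x.1.1 = j.1.1.1.1}) ↦
        anemicEigenvalue (degeneracyMap0 t.1.1.1.1.1 N t.2.1.1.2 k t.1.2.1)
  have hB : Module.finrank ℤ (anemicHeckeRing N k) ≤ X.card :=
    finrank_anemicHeckeRing_le_card_systems _ hv hsp (isAnemicEigenvector_degeneracyMap0_newforms N k)
      X (fun t ↦ Finset.mem_image_of_mem _ (Finset.mem_univ t))
  refine hB.trans (Finset.card_image_le.trans ?_)
  rw [Finset.card_univ, Module.finrank_eq_card_basis (Module.Basis.mk hv hsp)]

/-- **The log-free shape of the degree bound** (the conclusion of the tree's benchmark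
`LogFreeDegreeBound`, `stmt-ABC-2613`, for `δ_{1,N}`): granted the weight-`2` Ramanujan bound `h2`
and Murty–Sinha's multiplicity bound with constant `A` (`hA`), for every level `N ≥ 16`, every datum
`D` of minimal degree in its class and EVERY prime `ℓ ∤ N`,

  `log δ_{1,N} ≤ (5/2 + 5 max(A,0)) · dim S₂(Γ₀(N)) · log ℓ`

(`log_modularDegree_le_of_multiplicity` with `Σ_{P ≠ P_f} #c ≤ rank_ℤ 𝕋 ≤ dim S₂(Γ₀(N))`,
`log 4 ≤ 2 log ℓ` and `(log N + 4 log N/log log N)/log 2N ≤ 5` for `N ≥ 16`). With the least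
prime `ℓ₀ ∤ N` (`ℓ₀ ≤ 2 log N + O(1)`) and `dim S₂(Γ₀(N)) ≤ ψ(N)/12 + 1 ≪ N log log N` this is the
shape `N log log N · log ℓ₀` of Pasten's GRH clause Thm. 7.4, here from Murty–Sinha instead of GRH.
[cite: PastenShimura2024, Thm. 7.2 and Thm. 7.4 (pp. 26–27)] [cite: MurtySinha2009, eq. (1) p. 683] -/
theorem log_modularDegree_le_finrank_mul_log {A : ℝ}
    (hA : ∀ (N : ℕ) [NeZero N] (p : ℕ) [NeZero p], p.Prime → ¬ p ∣ N →
      ∀ α : ℝ, |α| ≤ 2 * Real.sqrt p →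
        (Module.finrank ℂ (Module.End.eigenspace (heckeT (Gamma0 N) 2 p) (α : ℂ)) : ℝ) ≤
          A * Module.finrank ℂ (CuspForm (Gamma0 N) 2) * Real.log p / Real.log (2 * N))
    (h2 : ∀ (N : ℕ) [NeZero N] (p : ℕ) [NeZero p], p.Prime → ¬ p ∣ N → ∀ μ : ℂ,
      Module.End.HasEigenvalue (heckeT (Gamma0 N) 2 p) μ → ‖μ‖ ≤ 2 * Real.sqrt p)
    {N : ℕ} [NeZero N] {W : WeierstrassCurve ℚ} [W.IsElliptic] (D : ModularParametrizationData W N)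
    (hmin : ∀ (W' : WeierstrassCurve ℚ) [W'.IsElliptic] (D' : ModularParametrizationData W' N),
      D'.f = D.f → D.modularDegree ≤ D'.modularDegree)
    (hN : 16 ≤ N) {ℓ : ℕ} [NeZero ℓ] (hℓ : ℓ.Prime) (hℓN : ¬ ℓ ∣ N) :
    Real.log (D.modularDegree : ℝ) ≤
      (5 / 2 + 5 * max A 0) * Module.finrank ℂ (CuspForm (Gamma0 N) 2) * Real.log ℓ := by
  have hmain := log_modularDegree_le_of_multiplicity hA h2 D hmin (by omega) hℓ hℓN
  set d : ℝ := (Module.finrank ℂ (CuspForm (Gamma0 N) 2) : ℝ) with hd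
  have hd0 : 0 ≤ d := Nat.cast_nonneg _
  have hA' : A ≤ max A 0 := le_max_left _ _
  have hA'0 : 0 ≤ max A 0 := le_max_right _ _
  -- `Σ_{P ≠ P_f} #c ≤ rank 𝕋 ≤ dim`
  have hr : (∑ P ∈ (finite_minimalPrimes_anemicHeckeRing N 2).toFinset.erase (eigenIdeal D.f),
      (Module.finrank ℤ (anemicHeckeRing N 2 ⧸ P) : ℝ)) ≤ d := by
    have h1 : (∑ P ∈ (finite_minimalPrimes_anemicHeckeRing N 2).toFinset.erase (eigenIdeal D.f),
        Module.finrank ℤ (anemicHeckeRing N 2 ⧸ P)) ≤ Module.finrank ℂ (CuspForm (Gamma0 N) 2) :=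
      ((Finset.sum_le_sum_of_subset (Finset.erase_subset _ _)).trans
        sum_finrank_quotient_minimalPrimes_le_finrank).trans
        (finrank_anemicHeckeRing_le_finrank_cuspForm N 2)
    rw [hd]
    exact_mod_cast h1
  -- numerics: `log 4 ≤ 2 log ℓ`, `c_N ≤ 5 log N ≤ 5 log 2N`
  have hNr : (16 : ℝ) ≤ N := by exact_mod_cast hN
  have hNpos : (0 : ℝ) < N := by linarith
  have hℓ2 : (2 : ℝ) ≤ ℓ := by exact_mod_cast hℓ.two_le
  have hlogℓ0 : 0 ≤ Real.log ℓ := Real.log_nonneg (by linarith)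
  have hlog4 : Real.log 4 ≤ 2 * Real.log ℓ := by
    rw [show (4 : ℝ) = 2 ^ 2 by norm_num, Real.log_pow, Nat.cast_ofNat]
    exact mul_le_mul_of_nonneg_left (Real.log_le_log two_pos hℓ2) (by norm_num)
  have hlogN : 2 ≤ Real.log N := by
    rw [Real.le_log_iff_exp_le hNpos]
    have h := Real.exp_one_lt_d9
    have h2' : Real.exp 2 = Real.exp 1 * Real.exp 1 := by rw [← Real.exp_add]; norm_num
    nlinarith [Real.exp_pos 1]
  have hloglog1 : 1 ≤ Real.log (Real.log N) := by
    rw [Real.le_log_iff_exp_le (by linarith)]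
    have hexp : Real.exp 1 < 2.7182818286 := Real.exp_one_lt_d9
    -- `log N ≥ log 16 = 4 log 2 ≥ 2.77 ≥ e`
    have h16 : Real.log 16 = 4 * Real.log 2 := by
      rw [show (16 : ℝ) = 2 ^ 4 by norm_num, Real.log_pow, Nat.cast_ofNat]
    have hl2 : 0.6931471803 < Real.log 2 := Real.log_two_gt_d9
    have h := Real.log_le_log (by norm_num) hNr
    linarith
  have hcN : Real.log N + 4 * Real.log N / Real.log (Real.log N) ≤ 5 * Real.log (2 * N) := by
    have hlog2N : Real.log N ≤ Real.log (2 * N) := Real.log_le_log hNpos (by linarith)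
    have h : 4 * Real.log N / Real.log (Real.log N) ≤ 4 * Real.log N := by
      rw [div_le_iff₀ (by linarith)]
      nlinarith
    linarith
  have hlog2N0 : 0 < Real.log (2 * N) := by
    have := Real.log_le_log hNpos (show (N : ℝ) ≤ 2 * N by linarith); linarith
  have hcN0 : 0 ≤ Real.log N + 4 * Real.log N / Real.log (Real.log N) := by positivity
  -- the second term `≤ 5 max(A,0) d log ℓ`
  have hterm2 : A * d * Real.log ℓ / Real.log (2 * N) *
      (Real.log N + 4 * Real.log N / Real.log (Real.log N)) ≤ 5 * max A 0 * d * Real.log ℓ := by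
    have h1 : A * d * Real.log ℓ / Real.log (2 * N) ≤ max A 0 * d * Real.log ℓ / Real.log (2 * N) := by
      apply div_le_div_of_nonneg_right _ hlog2N0.le
      exact mul_le_mul_of_nonneg_right (mul_le_mul_of_nonneg_right hA' hd0) hlogℓ0
    have hx : 0 ≤ max A 0 * d * Real.log ℓ := by positivity
    calc A * d * Real.log ℓ / Real.log (2 * N) * (Real.log N + 4 * Real.log N / Real.log (Real.log N))
        ≤ max A 0 * d * Real.log ℓ / Real.log (2 * N) *
            (Real.log N + 4 * Real.log N / Real.log (Real.log N)) :=
          mul_le_mul_of_nonneg_right h1 hcN0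
      _ ≤ max A 0 * d * Real.log ℓ / Real.log (2 * N) * (5 * Real.log (2 * N)) :=
          mul_le_mul_of_nonneg_left hcN (div_nonneg hx hlog2N0.le)
      _ = 5 * max A 0 * d * Real.log ℓ := by field_simp
  -- the first term `≤ (5/2) d log ℓ`
  have hterm1 : (∑ P ∈ (finite_minimalPrimes_anemicHeckeRing N 2).toFinset.erase (eigenIdeal D.f),
      (Module.finrank ℤ (anemicHeckeRing N 2 ⧸ P) : ℝ)) * (Real.log 4 + Real.log ℓ / 2) ≤
      5 / 2 * d * Real.log ℓ := by
    have h4 : 0 ≤ Real.log 4 := Real.log_nonneg (by norm_num)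
    calc (∑ P ∈ (finite_minimalPrimes_anemicHeckeRing N 2).toFinset.erase (eigenIdeal D.f),
          (Module.finrank ℤ (anemicHeckeRing N 2 ⧸ P) : ℝ)) * (Real.log 4 + Real.log ℓ / 2)
        ≤ d * (Real.log 4 + Real.log ℓ / 2) := mul_le_mul_of_nonneg_right hr (by positivity)
      _ ≤ d * (2 * Real.log ℓ + Real.log ℓ / 2) := by gcongr
      _ = 5 / 2 * d * Real.log ℓ := by ring
  rw [hd] at hterm1 hterm2
  calc Real.log (D.modularDegree : ℝ) ≤ _ := hmain
    _ ≤ 5 / 2 * d * Real.log ℓ + 5 * max A 0 * d * Real.log ℓ := by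
        rw [hd]; exact add_le_add hterm1 hterm2
    _ = (5 / 2 + 5 * max A 0) * d * Real.log ℓ := by ring

/-- **`log δ_{1,N} ≤ C · dim S₂(Γ₀(N)) · log ℓ` for every prime `ℓ ∤ N`, `N ≥ 16`**, granted the
named fact `murtySinha2009_eigenvalue_multiplicity_weightTwo` and the weight-`2` Ramanujan bound
(`log_modularDegree_le_finrank_mul_log` with the constant of the fact).
[cite: PastenShimura2024, Thm. 7.2 and Thm. 7.4 (pp. 26–27)] [cite: MurtySinha2009, eq. (1) p. 683] -/
theorem exists_log_modularDegree_le_finrank_mul_log_of_murtySinha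
    (hMS : murtySinha2009_eigenvalue_multiplicity_weightTwo)
    (h2 : ∀ (N : ℕ) [NeZero N] (p : ℕ) [NeZero p], p.Prime → ¬ p ∣ N → ∀ μ : ℂ,
      Module.End.HasEigenvalue (heckeT (Gamma0 N) 2 p) μ → ‖μ‖ ≤ 2 * Real.sqrt p) :
    ∃ C : ℝ, 0 ≤ C ∧ ∀ (N : ℕ) [NeZero N] (W : WeierstrassCurve ℚ) [W.IsElliptic]
      (D : ModularParametrizationData W N),
      (∀ (W' : WeierstrassCurve ℚ) [W'.IsElliptic] (D' : ModularParametrizationData W' N),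
          D'.f = D.f → D.modularDegree ≤ D'.modularDegree) →
        16 ≤ N → ∀ (ℓ : ℕ) [NeZero ℓ], ℓ.Prime → ¬ ℓ ∣ N →
          Real.log (D.modularDegree : ℝ) ≤
            C * Module.finrank ℂ (CuspForm (Gamma0 N) 2) * Real.log ℓ := by
  obtain ⟨A, hA⟩ := hMS
  exact ⟨5 / 2 + 5 * max A 0, by positivity,
    fun N _ W _ D hmin hN ℓ _ hℓ hℓN ↦ log_modularDegree_le_finrank_mul_log hA h2 D hmin hN hℓ hℓN⟩

/-- **From a log-free bound for the optimal degree to one for the minimal modular degree of a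
globally minimal curve**: if `log δ_{1,N} ≤ C · dim S₂(Γ₀(N)) · log ℓ` for every datum of minimal
degree in its class (`N ≥ 16`, `ℓ ∤ N` prime), then `log m(W, N_W) ≤ (C + 10)(dim + 1) log ℓ`,
granted modularity with integral Manin constant and the Mazur–Kenku comparison `m ≤ 163 δ_{1,N}`
(`log_minModularDegree_le_of_class_bound`, `log 163 + 1 ≤ 10 log 2 ≤ 10 log ℓ`).
[cite: PastenShimura2024, §3 p. 13 and Thm. 7.2 (p. 26)] -/
theorem exists_log_minModularDegree_le_of_degreeBound
    (hmod : nonempty_modularParametrizationData)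
    (h163 : PastenShimura2024_minimalDegree_le_163_mul)
    (hdeg : ∃ C : ℝ, 0 ≤ C ∧ ∀ (N : ℕ) [NeZero N] (W : WeierstrassCurve ℚ) [W.IsElliptic]
      (D : ModularParametrizationData W N),
      (∀ (W' : WeierstrassCurve ℚ) [W'.IsElliptic] (D' : ModularParametrizationData W' N),
          D'.f = D.f → D.modularDegree ≤ D'.modularDegree) →
        16 ≤ N → ∀ (ℓ : ℕ) [NeZero ℓ], ℓ.Prime → ¬ ℓ ∣ N →
          Real.log (D.modularDegree : ℝ) ≤
            C * Module.finrank ℂ (CuspForm (Gamma0 N) 2) * Real.log ℓ) :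
    ∃ C : ℝ, ∀ (W : WeierstrassCurve ℚ) [W.IsElliptic] [W.IsGloballyMinimal]
      [NeZero (W.conductorNorm ℤ)], 16 ≤ W.conductorNorm ℤ →
        ∀ (ℓ : ℕ) [NeZero ℓ], ℓ.Prime → ¬ ℓ ∣ W.conductorNorm ℤ →
          Real.log (minModularDegree W (W.conductorNorm ℤ) : ℝ) ≤
            C * (Module.finrank ℂ (CuspForm (Gamma0 (W.conductorNorm ℤ)) 2) + 1) * Real.log ℓ := by
  obtain ⟨C, hC0, hC⟩ := hdeg
  refine ⟨C + 10, fun W _ _ _ hN ℓ _ hℓ hℓN ↦ ?_⟩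
  set N := W.conductorNorm ℤ with hNdef
  set d : ℝ := (Module.finrank ℂ (CuspForm (Gamma0 N) 2) : ℝ) with hd
  have hd0 : 0 ≤ d := Nat.cast_nonneg _
  have hℓ2 : (2 : ℝ) ≤ ℓ := by exact_mod_cast hℓ.two_le
  have hlogℓ : Real.log 2 ≤ Real.log ℓ := Real.log_le_log two_pos hℓ2
  have hlogℓ0 : 0 ≤ Real.log ℓ := Real.log_nonneg (by linarith)
  -- `log 163 + 1 ≤ 10 log 2 ≤ 10 log ℓ`
  have h163ℓ : Real.log 163 + 1 ≤ 10 * Real.log ℓ := by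
    have h1 : Real.log 163 < Real.log 256 := Real.log_lt_log (by norm_num) (by norm_num)
    have h2' : Real.log 256 = 8 * Real.log 2 := by
      rw [show (256 : ℝ) = 2 ^ 8 by norm_num, Real.log_pow, Nat.cast_ofNat]
    have hl2 : 0.6931471803 < Real.log 2 := Real.log_two_gt_d9
    nlinarith
  have hB := log_minModularDegree_le_of_class_bound h163 (hmod W) (B := C * d * Real.log ℓ + 1)
    (fun W₀ _ D₀ hmin ↦ by
      have h := hC N W₀ D₀ hmin hN ℓ hℓ hℓN
      rw [← hd] at h
      linarith)
  calc Real.log (minModularDegree W N : ℝ) ≤ Real.log 163 + (C * d * Real.log ℓ + 1) := hB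
    _ ≤ C * d * Real.log ℓ + 10 * Real.log ℓ := by linarith
    _ ≤ (C + 10) * (d + 1) * Real.log ℓ := by nlinarith

/-- **The minimal modular degree of a globally minimal curve: `log m(W, N_W) ≤ C (dim S₂(Γ₀(N_W)) + 1)
log ℓ` for every prime `ℓ ∤ N_W`, `N_W ≥ 16`** (the conclusion of the benchmark `LogFreeDegreeBound`,
`stmt-ABC-2613`, in the tree's `minModularDegree` idiom), granted modularity with integral Manin
constant, the Mazur–Kenku comparison (`m ≤ 163 δ_{1,N}`), the weight-`2` bound and Murty–Sinha
(`exists_log_minModularDegree_le_of_degreeBound` with `exists_log_modularDegree_le_finrank_mul_log_of_murtySinha`).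
[cite: PastenShimura2024, §3 p. 13, Thm. 7.2 and Thm. 7.4 (pp. 26–27)] [cite: MurtySinha2009, eq. (1) p. 683] -/
theorem exists_log_minModularDegree_le_of_murtySinha
    (hmod : nonempty_modularParametrizationData)
    (h163 : PastenShimura2024_minimalDegree_le_163_mul)
    (hMS : murtySinha2009_eigenvalue_multiplicity_weightTwo)
    (h2 : ∀ (N : ℕ) [NeZero N] (p : ℕ) [NeZero p], p.Prime → ¬ p ∣ N → ∀ μ : ℂ,
      Module.End.HasEigenvalue (heckeT (Gamma0 N) 2 p) μ → ‖μ‖ ≤ 2 * Real.sqrt p) :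
    ∃ C : ℝ, ∀ (W : WeierstrassCurve ℚ) [W.IsElliptic] [W.IsGloballyMinimal]
      [NeZero (W.conductorNorm ℤ)], 16 ≤ W.conductorNorm ℤ →
        ∀ (ℓ : ℕ) [NeZero ℓ], ℓ.Prime → ¬ ℓ ∣ W.conductorNorm ℤ →
          Real.log (minModularDegree W (W.conductorNorm ℤ) : ℝ) ≤
            C * (Module.finrank ℂ (CuspForm (Gamma0 (W.conductorNorm ℤ)) 2) + 1) * Real.log ℓ :=
  exists_log_minModularDegree_le_of_degreeBound hmod h163
    (exists_log_modularDegree_le_finrank_mul_log_of_murtySinha hMS h2)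

end Pasten2024

/-! ### Thm. 7.5 from named facts of the tree only -/

/-- **Pasten, Thm. 7.5 (`log |Δ_E| < (1/4 + ε) N log N` for `N ≫_ε 1`) from modularity, the
Mazur–Kenku comparison, the weight-`2` eigenvalue bound and Murty–Sinha's multiplicity bound.**
Inputs: (i) `nonempty_modularParametrizationData` (the Modularity Theorem with integral Manin
constant); (ii) `PastenShimura2024_minimalDegree_le_163_mul` (Mazur–Kenku); (iii) `h2`, the
Hasse–Weil bound `|μ| ≤ 2√p` for the eigenvalues of `T_p`, `p ∤ N`, on `S₂(Γ₀(N))`; (iv) `hMS`, the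
named fact `murtySinha2009_eigenvalue_multiplicity_weightTwo`. Pasten's own steps ((3.1), (3.2),
Thm. 5.5, Prop. 7.1, §7.4) are theorems of the tree; the asymptotic clause of Thm. 7.2 is
`exists_log_modularDegree_lt_of_murtySinha'` (Murty–Sinha in place of Murty's Lemma 11).
[cite: PastenShimura2024, Theorem 7.5 (proof, §7.4 p. 27) with Thm 7.2 (p. 26) and §3 p. 13]
[cite: MurtySinha2009, eq. (1) p. 683] -/
theorem pasten_thm_7_5_of_modularity_mazurKenku_murtySinha_of_weight_two_bound
    (hmod : nonempty_modularParametrizationData)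
    (h163 : PastenShimura2024_minimalDegree_le_163_mul)
    (h2 : ∀ (N : ℕ) [NeZero N] (p : ℕ) [NeZero p], p.Prime → ¬ p ∣ N → ∀ μ : ℂ,
      Module.End.HasEigenvalue (heckeT (Gamma0 N) 2 p) μ → ‖μ‖ ≤ 2 * Real.sqrt p)
    (hMS : murtySinha2009_eigenvalue_multiplicity_weightTwo) :
    pasten_thm_7_5 :=
  pasten_thm_7_5_of_modularity_of_optimalDegreeBound hmod h163
    (exists_log_modularDegree_lt_of_murtySinha' hMS h2)

/-- **Pasten, Thm. 7.5 from FOUR NAMED FACTS of the tree**: the Modularity Theorem with integral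
Manin constant (`nonempty_modularParametrizationData`), the Mazur–Kenku comparison
(`PastenShimura2024_minimalDegree_le_163_mul`), Deligne's bound
(`Deligne1974_heckeT_eigenvalue_norm_le`, of which the weight-`2` case is used) and Murty–Sinha's
multiplicity bound (`murtySinha2009_eigenvalue_multiplicity_weightTwo`); hence
`pasten_thm_7_5_holds` is this theorem applied to their four `_holds`.
[cite: PastenShimura2024, Theorem 7.5 (proof, §7.4 p. 27) with Thm 7.2 (p. 26) and §3 p. 13]
[cite: MurtySinha2009, eq. (1) p. 683] [cite: Deligne1974, Thm. 8.2] -/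
theorem pasten_thm_7_5_of_modularity_mazurKenku_deligne_murtySinha
    (hmod : nonempty_modularParametrizationData)
    (h163 : PastenShimura2024_minimalDegree_le_163_mul)
    (hDel : Deligne1974_heckeT_eigenvalue_norm_le)
    (hMS : murtySinha2009_eigenvalue_multiplicity_weightTwo) :
    pasten_thm_7_5 :=
  pasten_thm_7_5_of_modularity_mazurKenku_murtySinha_of_weight_two_bound hmod h163
    (Deligne1974_heckeT_eigenvalue_norm_le.weight_two hDel) hMS

/-- **Pasten, Thm. 7.5 from the Modularity Theorem "Version `a_p`" (`exists_isNewformOf`),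
Mazur–Kenku, Deligne and Murty–Sinha** — the parametrisation datum with integral Manin constant
coming from `exists_isNewformOf` through `nonempty_modularParametrizationData_of_modularity` and the
discharged leaf `IsNewformOf.exists_maninConstant_modularDegree_holds`.
[cite: PastenShimura2024, Theorem 7.5 (proof, §7.4 p. 27) with §3 p. 13 and Thm 7.2 (p. 26)]
[cite: BCDTJAMS2001, Thm. A] [cite: MurtySinha2009, eq. (1) p. 683] -/
theorem pasten_thm_7_5_of_exists_isNewformOf_murtySinha
    (h₁ : exists_isNewformOf)
    (h163 : PastenShimura2024_minimalDegree_le_163_mul)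
    (hDel : Deligne1974_heckeT_eigenvalue_norm_le)
    (hMS : murtySinha2009_eigenvalue_multiplicity_weightTwo) :
    pasten_thm_7_5 :=
  pasten_thm_7_5_of_modularity_mazurKenku_deligne_murtySinha
    (nonempty_modularParametrizationData_of_modularity h₁
      IsNewformOf.exists_maninConstant_modularDegree_holds) h163 hDel hMS

/-- **Pasten, Thm. 7.5 from the printed external inputs of §3 and the inputs of the one-prime
argument**, each as the tree states it: (1) `h₁`, the Modularity Theorem "Version `a_p`"
(`exists_isNewformOf`); (2) `hMK`, Mazur–Kenku (`mazurKenku_exists_cyclic_isogeny`); (3) `hInt`, the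
integrality of the Manin constant of a parametrisation of a globally minimal curve (Edixhoven 1991,
Prop. 2), the hypothesis of `PastenShimura2024_minimalDegree_le_163_mul_of_mazurKenku`; (4) `h2'`,
the Hasse–Weil bound `|a_p(g)| ≤ 2√p` for normalised newforms of weight `2` (transported to all
eigenvalues by `Deligne1974_heckeT_eigenvalue_norm_le.weight_two_of_newform_coeff_bound`); (5) `hMS`,
Murty–Sinha's multiplicity bound — in place of input (5) of `pasten_thm_7_5_of_printed_inputs`,
Murty's Lemma 11. [cite: PastenShimura2024, Theorem 7.5 (proof, §7.4 p. 27) with §3 p. 13]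
[cite: Mazur1978, Thm. 1] [cite: Kenku1982] [cite: EdixhovenManin1991, Prop. 2]
[cite: MurtySinha2009, eq. (1) p. 683] -/
theorem pasten_thm_7_5_of_printed_inputs_murtySinha
    (h₁ : exists_isNewformOf)
    (hMK : mazurKenku_exists_cyclic_isogeny)
    (hInt : ∀ {N : ℕ} [NeZero N] {W' : WeierstrassCurve ℚ} [W'.IsElliptic] [W'.IsGloballyMinimal]
      (D' : ModularParametrizationData W' N) (q : ℚ),
      (∀ z ∈ periodLattice D'.f, (q : ℂ) * z ∈ D'.L.lattice) → ∃ k : ℤ, (k : ℚ) = q)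
    (h2' : ∀ (M : ℕ) [NeZero M] (g : CuspForm (Gamma0 M) 2), IsNewform0 g →
      ∀ p : ℕ, p.Prime → ¬ p ∣ M → ‖(qExpansion 1 ⇑g).coeff p‖ ≤ 2 * Real.sqrt p)
    (hMS : murtySinha2009_eigenvalue_multiplicity_weightTwo) :
    pasten_thm_7_5 :=
  pasten_thm_7_5_of_modularity_mazurKenku_murtySinha_of_weight_two_bound
    (nonempty_modularParametrizationData_of_modularity h₁
      IsNewformOf.exists_maninConstant_modularDegree_holds)
    (PastenShimura2024_minimalDegree_le_163_mul_of_mazurKenku hMK hInt)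
    (Deligne1974_heckeT_eigenvalue_norm_le.weight_two_of_newform_coeff_bound h2') hMS

/-- **Pasten, Thm. 7.5 from the Modularity Theorem, Mazur–Kenku, Deligne's bound and the
Eichler–Selberg trace formula.** As `pasten_thm_7_5_of_exists_isNewformOf_murtySinha`, with
Murty–Sinha's multiplicity bound discharged by the tree's
`murtySinha2009_eigenvalue_multiplicity_weightTwo_of_traceFormula` from the named fact
`Literature.NumberTheory.Automorphic.HeckeTraceFormulaGL2Level N 1 2` (the Eichler–Selberg trace
formula for `T_n` on `S₂(Γ₀(N))`, Schoof–van der Vlugt Thm. 2.2 = Murty–Sinha Thm. 10) at every level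
`N ≥ 1`. This displays the trust base of `pasten_thm_7_5` over the tree as four classical theorems,
each a named fact: modularity (`exists_isNewformOf`), Mazur–Kenku
(`PastenShimura2024_minimalDegree_le_163_mul`), Deligne's Thm. 8.2
(`Deligne1974_heckeT_eigenvalue_norm_le`) and the Eichler–Selberg trace formula.
[cite: PastenShimura2024, Theorem 7.5 (proof, §7.4 p. 27) with §3 p. 13 and Thm 7.2 (p. 26)]
[cite: MurtySinha2009, eq. (1) p. 683 and §§7–11] [cite: SchoofVandervlugt1991, Thm. 2.2, p. 168] -/
theorem pasten_thm_7_5_of_traceFormula_inputs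
    (h₁ : exists_isNewformOf)
    (h163 : PastenShimura2024_minimalDegree_le_163_mul)
    (hDel : Deligne1974_heckeT_eigenvalue_norm_le)
    (hTF : ∀ (N : ℕ) [NeZero N], Literature.NumberTheory.Automorphic.HeckeTraceFormulaGL2Level N 1 2) :
    pasten_thm_7_5 :=
  pasten_thm_7_5_of_exists_isNewformOf_murtySinha h₁ h163 hDel
    (murtySinha2009_eigenvalue_multiplicity_weightTwo_of_traceFormula hTF)

/-! ## Removing Deligne's bound: eigenvalue bounds from the trace formula, Hasse for `a_ℓ(E)`

In the one-prime argument Deligne's theorem (`|μ| ≤ 2√p` for ALL eigenvalues `μ` of `T_p` on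
`S₂(Γ₀(N))`) is used only through (a) a bound for the conjugates of `χ(T_ℓ)` in
`η ≤ ∏_σ |a_ℓ(f) − χ(T_ℓ)^σ|`, (b) the explicit bound for the agreeing classes, and (c) the
hypothesis `|α| ≤ 2√ℓ` of Murty–Sinha's fact at `α = a_ℓ(f) = a_ℓ(E)`. For (c) Hasse's theorem
suffices, a theorem of the tree (`WeierstrassCurve.abs_LFunction_prime_pow_le`); for (a) and (b) any
bound `|μ| ≤ G` with `log G_ℓ ≤ ½ log N + O(log ℓ + log log N)` resp. `log G = O(log N)` suffices,
and such a bound follows from the Eichler–Selberg trace formula — already in the cone of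
`pasten_thm_7_5` through Murty–Sinha — by positivity: `T_ℓ` is self-adjoint with real eigenvalues
`μ_i`, so `μ² ≤ Σ_i μ_i² = Tr T_{ℓ²} + ℓ · dim S₂(Γ₀(N))`, and the geometric side of the trace
formula at `n = ℓ²` is `≤ ψ(N)/12 + O(ℓ¹² N)` by the crude bounds of
`MurtySinhaMultiplicityGeometricProofs` (`norm_sq_le_of_traceFormula`). The cost is the constant:
`log G_ℓ ≈ ½ log N` per distinguished system, so the degree bound becomes
`(1/24 + ε) N log N` — exactly the asymptotic clause of Thm. 7.2 as printed — instead of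
`o(N log N)`. Result: `pasten_thm_7_5` from modularity, Mazur–Kenku and the Eichler–Selberg
trace formula only (`pasten_thm_7_5_of_modularity_mazurKenku_traceFormula`). -/

namespace ModularForms

open Literature.NumberTheory.Automorphic Literature.NumberTheory.Automorphic.HeckeTraceFormulaGL2Level

variable (N : ℕ) [NeZero N]

/-- `ψ(N)` of the trace-formula file (`dedekindPsi`, over `ℚ`) is the index `gamma0Index N`.
[folklore] -/
theorem dedekindPsi_eq_gamma0Index : ((dedekindPsi N : ℚ) : ℝ) = (gamma0Index N : ℝ) := by
  rw [gamma0Index_eq_mul_prod_one_add_inv_real N, dedekindPsi]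
  push_cast
  rfl

/-- **A bound for the eigenvalues of `T_p` on `S₂(Γ₀(N))` from the Eichler–Selberg trace formula**
(`p ∤ N` prime): `|μ|² ≤ (p + 1)(ψ(N) + 1) + 10⁶ p¹² N`. Proof: the eigenvalues `μ_i` of the
self-adjoint `T_p` are real and `T_{p²} = T_p² − p` on `S₂(Γ₀(N))`, so
`Σ_i μ_i² = Tr T_{p²} + p dim S₂(Γ₀(N))` (`MurtySinha.heckeT_gamma0_spectralData` with `Q₂(μ) = μ² − p`),
whence `μ² ≤ |A₁ + A₂ + A₃ + A₄|(p²) + p dim` with `A₁ = ψ(N)/12`, `|A₂| ≤ 7360 p¹² B(N)`,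
`|A₃| ≤ p⁴ B(N)`, `|A₄| ≤ p⁴`, `B(N) ≤ 81 N^{5/6}` (`MurtySinhaMultiplicityGeometricProofs`) and
`dim ≤ ψ(N)/12 + 1`. (A substitute for the Ramanujan–Petersson bound `|μ| ≤ 2√p`, polynomial in `p`
and of size `N^{1/2 + o(1)}` in the level.) This version assumes ONLY the instance `n = p²` of the
Eichler–Selberg identity at level `N` (weight `2`, trivial character) — the one instance the argument
uses. [cite: MurtySinha2009, Thm. 10 p. 692 and §8 p. 697]
[cite: SchoofVandervlugt1991, Thm. 2.2, p. 168] -/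
theorem norm_sq_le_of_primePowTrace
    {p : ℕ} [NeZero p] (hTF2 : cuspidalHeckeTrace N 2 1 (p ^ 2) = geometricSide N 1 2 (p ^ 2))
    (hp : p.Prime) (hpN : ¬ p ∣ N) {μ : ℂ}
    (hμ : Module.End.HasEigenvalue (heckeT (Gamma0 N) 2 p) μ) :
    ‖μ‖ ^ 2 ≤ ((p : ℝ) + 1) * ((gamma0Index N : ℝ) + 1) + 10 ^ 6 * (p : ℝ) ^ 12 * N := by
  classical
  haveI : FiniteDimensional ℂ (CuspForm (Gamma0 N) 2) := finiteDimensional_cuspForm_gamma0 N 2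
  obtain ⟨E, hreal, hbot, hdim, htr⟩ := MurtySinha.heckeT_gamma0_spectralData N 2 p hp hpN
  have hμE : μ ∈ E := by
    by_contra h
    exact (Module.End.hasEigenvalue_iff.mp hμ) (hbot μ h)
  -- the polynomials `Q_m` of `T_{p^m}`
  let P : ℂ → ℕ → ℂ × ℂ := fun x m ↦
    Nat.rec (motive := fun _ ↦ ℂ × ℂ) (1, x) (fun _ ab ↦ (ab.2, x * ab.2 - (p : ℂ) * ab.1)) m
  let Q : ℕ → ℂ → ℂ := fun m x ↦ (P x m).1
  have hP_succ : ∀ x m, P x (m + 1) = ((P x m).2, x * (P x m).2 - (p : ℂ) * (P x m).1) :=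
    fun x m ↦ rfl
  have hpz : (p : ℂ) ^ ((2 : ℤ) - 1) = p := by norm_num
  have hQrec : ∀ x m, Q (m + 2) x = x * Q (m + 1) x - (p : ℂ) ^ ((2 : ℤ) - 1) * Q m x := by
    intro x m
    rw [hpz]
    try rfl
  have htr2 := htr Q (fun x _ ↦ rfl) (fun x _ ↦ rfl) (fun x _ m ↦ hQrec x m) 2
  have hQ2 : ∀ x, Q 2 x = x * x - (p : ℂ) * 1 := fun x ↦ rfl
  set m : ℂ → ℕ := fun ν ↦ Module.finrank ℂ (Module.End.eigenspace (heckeT (Gamma0 N) 2 p) ν)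
    with hm_def
  set d : ℕ := Module.finrank ℂ (CuspForm (Gamma0 N) 2) with hd_def
  -- `Σ m_ν ν² = Tr T_{p²} + p d`
  have hsum : ∑ ν ∈ E, (m ν : ℂ) * (ν * ν) = cuspidalHeckeTrace N 2 1 (p ^ 2) + (p : ℂ) * d := by
    rw [htr2, hd_def, hdim, Finset.mul_sum, ← Finset.sum_add_distrib]
    refine Finset.sum_congr rfl fun ν _ ↦ ?_
    rw [hQ2]
    ring
  -- real form: `Σ m_ν ‖ν‖² = Re Tr + p d`
  have hsumR : ∑ ν ∈ E, (m ν : ℝ) * ‖ν‖ ^ 2 = (cuspidalHeckeTrace N 2 1 (p ^ 2)).re + p * d := by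
    have h : ((∑ ν ∈ E, (m ν : ℝ) * ‖ν‖ ^ 2 : ℝ) : ℂ) = cuspidalHeckeTrace N 2 1 (p ^ 2) + (p : ℂ) * d := by
      rw [← hsum]
      push_cast
      refine Finset.sum_congr rfl fun ν hν ↦ ?_
      rw [← Complex.conj_mul', hreal ν hν]
    have h' := congrArg Complex.re h
    rw [Complex.ofReal_re] at h'
    rw [h']
    simp
  -- the term of `μ`
  have hmμ : 1 ≤ m μ := by
    have hne : Module.End.eigenspace (heckeT (Gamma0 N) 2 p) μ ≠ ⊥ := Module.End.hasEigenvalue_iff.mp hμ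
    have h0 : m μ ≠ 0 := fun h ↦ hne (Submodule.finrank_eq_zero.mp h)
    omega
  have hterm : ‖μ‖ ^ 2 ≤ ∑ ν ∈ E, (m ν : ℝ) * ‖ν‖ ^ 2 := by
    have h1 : (m μ : ℝ) * ‖μ‖ ^ 2 ≤ ∑ ν ∈ E, (m ν : ℝ) * ‖ν‖ ^ 2 :=
      Finset.single_le_sum (f := fun ν ↦ (m ν : ℝ) * ‖ν‖ ^ 2) (fun ν _ ↦ by positivity) hμE
    have h2 : (1 : ℝ) ≤ m μ := by exact_mod_cast hmμ
    nlinarith [sq_nonneg ‖μ‖]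
  -- the trace formula and the geometric bounds at `n = p²`
  have hp2 : 0 < p ^ 2 := pow_pos hp.pos 2
  set B : ℝ := ∑ c ∈ N.divisors, (Nat.gcd c (N / c) : ℝ) with hB_def
  have hN0 : N ≠ 0 := NeZero.ne N
  have hNr : (1 : ℝ) ≤ N := by exact_mod_cast Nat.one_le_iff_ne_zero.mpr hN0
  have hB0 : 0 ≤ B := Finset.sum_nonneg fun _ _ ↦ by positivity
  have hBN : B ≤ 81 * N := by
    refine (MurtySinha.sum_divisors_gcd_le_rpow N hN0).trans ?_
    have h : (N : ℝ) ^ ((5 : ℝ) / 6) ≤ (N : ℝ) ^ (1 : ℝ) :=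
      Real.rpow_le_rpow_of_exponent_le hNr (by norm_num)
    rw [Real.rpow_one] at h
    linarith
  have hpr : (2 : ℝ) ≤ p := by exact_mod_cast hp.two_le
  have hn : ((p ^ 2 : ℕ) : ℝ) = (p : ℝ) ^ 2 := by push_cast; ring
  have hA1 : ‖identityTerm N 1 2 (p ^ 2)‖ = (gamma0Index N : ℝ) / 12 := by
    rw [MurtySinha.identityTerm_one_two_prime_pow N p hp hpN 2, if_pos even_two, norm_div,
      Complex.norm_ratCast, ← dedekindPsi_eq_gamma0Index N]
    have h0 : (0 : ℝ) ≤ ((dedekindPsi N : ℚ) : ℝ) := by exact_mod_cast MurtySinha.dedekindPsi_nonneg N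
    rw [abs_of_nonneg h0]
    norm_num
  have hA2 : ‖ellipticTerm N 1 2 (p ^ 2)‖ ≤ 7360 * (p : ℝ) ^ 12 * B := by
    have h := MurtySinha.norm_ellipticTerm_one_two_le N (p ^ 2) hp2
    rw [hn] at h
    calc ‖ellipticTerm N 1 2 (p ^ 2)‖ ≤ 7360 * ((p : ℝ) ^ 2) ^ 6 * B := h
      _ = 7360 * (p : ℝ) ^ 12 * B := by ring
  have hA3 : ‖hyperbolicTerm N 1 2 (p ^ 2)‖ ≤ (p : ℝ) ^ 4 * B := by
    have h := MurtySinha.norm_hyperbolicTerm_one_two_le N (p ^ 2)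
    rw [hn] at h
    calc ‖hyperbolicTerm N 1 2 (p ^ 2)‖ ≤ ((p : ℝ) ^ 2) ^ 2 * B := h
      _ = (p : ℝ) ^ 4 * B := by ring
  have hA4 : ‖parabolicTerm N 1 2 (p ^ 2)‖ ≤ (p : ℝ) ^ 4 := by
    have h := MurtySinha.norm_parabolicTerm_le N 1 2 (p ^ 2)
    rw [hn] at h
    calc ‖parabolicTerm N 1 2 (p ^ 2)‖ ≤ ((p : ℝ) ^ 2) ^ 2 := h
      _ = (p : ℝ) ^ 4 := by ring
  have hgeo : ‖cuspidalHeckeTrace N 2 1 (p ^ 2)‖ ≤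
      (gamma0Index N : ℝ) / 12 + (7360 * (p : ℝ) ^ 12 + (p : ℝ) ^ 4) * B + (p : ℝ) ^ 4 := by
    rw [hTF2, geometricSide]
    calc ‖identityTerm N 1 2 (p ^ 2) + ellipticTerm N 1 2 (p ^ 2) + hyperbolicTerm N 1 2 (p ^ 2) +
          parabolicTerm N 1 2 (p ^ 2)‖
        ≤ ‖identityTerm N 1 2 (p ^ 2)‖ + ‖ellipticTerm N 1 2 (p ^ 2)‖ + ‖hyperbolicTerm N 1 2 (p ^ 2)‖ +
          ‖parabolicTerm N 1 2 (p ^ 2)‖ := by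
          refine (norm_add_le _ _).trans (add_le_add ((norm_add_le _ _).trans (add_le_add
            (norm_add_le _ _) le_rfl)) le_rfl)
      _ ≤ _ := by rw [hA1]; nlinarith
  have hdim_le : (d : ℝ) ≤ (gamma0Index N : ℝ) / 12 + 1 := finrank_cuspForm_two_le_gamma0Index N
  have hre : (cuspidalHeckeTrace N 2 1 (p ^ 2)).re ≤ ‖cuspidalHeckeTrace N 2 1 (p ^ 2)‖ := Complex.re_le_norm _
  have hψ0 : (0 : ℝ) ≤ gamma0Index N := Nat.cast_nonneg _
  have hp4 : (p : ℝ) ^ 4 ≤ (p : ℝ) ^ 12 := pow_le_pow_right₀ (by linarith) (by norm_num)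
  have hp1 : (p : ℝ) ≤ (p : ℝ) ^ 12 := by
    calc (p : ℝ) = (p : ℝ) ^ 1 := (pow_one _).symm
      _ ≤ (p : ℝ) ^ 12 := pow_le_pow_right₀ (by linarith) (by norm_num)
  calc ‖μ‖ ^ 2 ≤ ∑ ν ∈ E, (m ν : ℝ) * ‖ν‖ ^ 2 := hterm
    _ = (cuspidalHeckeTrace N 2 1 (p ^ 2)).re + p * d := hsumR
    _ ≤ (gamma0Index N : ℝ) / 12 + (7360 * (p : ℝ) ^ 12 + (p : ℝ) ^ 4) * B + (p : ℝ) ^ 4 +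
        p * ((gamma0Index N : ℝ) / 12 + 1) := by
        have := mul_le_mul_of_nonneg_left hdim_le (show (0 : ℝ) ≤ p by linarith)
        linarith
    _ ≤ ((p : ℝ) + 1) * ((gamma0Index N : ℝ) + 1) + 10 ^ 6 * (p : ℝ) ^ 12 * N := by
        have h1 : (7360 * (p : ℝ) ^ 12 + (p : ℝ) ^ 4) * B ≤ (7360 * (p : ℝ) ^ 12 + (p : ℝ) ^ 4) * (81 * N) :=
          mul_le_mul_of_nonneg_left hBN (by positivity)
        nlinarith

/-- **`|μ| ≤ G_N(p) := √((p+1)(ψ(N)+1) + 10⁶ p¹² N)`** for the eigenvalues of `T_p`, `p ∤ N`, on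
`S₂(Γ₀(N))`, granted the single trace identity at `n = p²` (`norm_sq_le_of_primePowTrace`). [folklore] -/
theorem norm_le_sqrt_of_primePowTrace
    {p : ℕ} [NeZero p] (hTF2 : cuspidalHeckeTrace N 2 1 (p ^ 2) = geometricSide N 1 2 (p ^ 2))
    (hp : p.Prime) (hpN : ¬ p ∣ N) {μ : ℂ}
    (hμ : Module.End.HasEigenvalue (heckeT (Gamma0 N) 2 p) μ) :
    ‖μ‖ ≤ Real.sqrt (((p : ℝ) + 1) * ((gamma0Index N : ℝ) + 1) + 10 ^ 6 * (p : ℝ) ^ 12 * N) := by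
  refine Real.le_sqrt_of_sq_le ?_
  exact norm_sq_le_of_primePowTrace N hTF2 hp hpN hμ

/-- **A bound for the eigenvalues of `T_p` on `S₂(Γ₀(N))` from the Eichler–Selberg trace formula**
(`p ∤ N` prime): `|μ|² ≤ (p + 1)(ψ(N) + 1) + 10⁶ p¹² N`, granted the named fact
`HeckeTraceFormulaGL2Level N 1 2` (of which only the instance `n = p²` is used,
`norm_sq_le_of_primePowTrace`). [cite: MurtySinha2009, Thm. 10 p. 692 and §8 p. 697]
[cite: SchoofVandervlugt1991, Thm. 2.2, p. 168] -/
theorem norm_sq_le_of_traceFormula (hTF : HeckeTraceFormulaGL2Level N 1 2)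
    {p : ℕ} [NeZero p] (hp : p.Prime) (hpN : ¬ p ∣ N) {μ : ℂ}
    (hμ : Module.End.HasEigenvalue (heckeT (Gamma0 N) 2 p) μ) :
    ‖μ‖ ^ 2 ≤ ((p : ℝ) + 1) * ((gamma0Index N : ℝ) + 1) + 10 ^ 6 * (p : ℝ) ^ 12 * N :=
  norm_sq_le_of_primePowTrace N (MurtySinha.traceFormula_two_one hTF (pow_pos hp.pos 2)) hp hpN hμ

/-- **`|μ| ≤ G_N(p) := √((p+1)(ψ(N)+1) + 10⁶ p¹² N)`** for the eigenvalues of `T_p`, `p ∤ N`, on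
`S₂(Γ₀(N))`, granted the trace formula at level `N` (`norm_sq_le_of_traceFormula`). [folklore] -/
theorem norm_le_sqrt_of_traceFormula (hTF : HeckeTraceFormulaGL2Level N 1 2)
    {p : ℕ} [NeZero p] (hp : p.Prime) (hpN : ¬ p ∣ N) {μ : ℂ}
    (hμ : Module.End.HasEigenvalue (heckeT (Gamma0 N) 2 p) μ) :
    ‖μ‖ ≤ Real.sqrt (((p : ℝ) + 1) * ((gamma0Index N : ℝ) + 1) + 10 ^ 6 * (p : ℝ) ^ 12 * N) := by
  refine Real.le_sqrt_of_sq_le ?_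
  exact norm_sq_le_of_traceFormula N hTF hp hpN hμ

end ModularForms

namespace Pasten2024

variable {N : ℕ} [NeZero N] {W : WeierstrassCurve ℚ}

/-- **Hasse for the eigenvalue of the curve's newform**: `|a_ℓ(f)| ≤ 2√ℓ` for the integer
`a_ℓ(f) = χ₀(T_ℓ) = a_ℓ(E)` of a parametrisation datum (`IsNewformOf`: `aₙ(f) = aₙ(W)`;
Hasse's theorem for `aₗ(W)`, the tree's `WeierstrassCurve.abs_LFunction_prime_pow_le`).
[cite: SilvermanAEC2009, Thm. V.1.1] -/
theorem abs_intEigencharacter_T_le [W.IsElliptic] (D : ModularParametrizationData W N)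
    {ℓ : ℕ} [NeZero ℓ] (hℓ : ℓ.Prime) (hℓN : ¬ ℓ ∣ N) :
    |(intEigencharacter D.hasIntegralEigenvalues_f D.f_ne_zero (anemicHeckeRing.T N 2 ℓ hℓ hℓN) : ℝ)| ≤
      2 * Real.sqrt ℓ := by
  have hf := D.hasIntegralEigenvalues_f
  have hf0 := D.f_ne_zero
  have hnew : IsNewform0 D.f := D.isNewformOf.1
  set a : ℤ := intEigencharacter hf hf0 (anemicHeckeRing.T N 2 ℓ hℓ hℓN) with ha_def
  have ha : (a : ℂ) = (qExpansion 1 ⇑D.f).coeff ℓ := by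
    rw [ha_def, cast_intEigencharacter, eigencharacter_T,
      heckeEigenvalue_eq_coeff_of_isNormalized hnew.2.2 hℓ (hnew.2.1 ℓ hℓ)]
  have hcoeff : (qExpansion 1 ⇑D.f).coeff ℓ = (W.LFunction ℓ : ℂ) := D.isNewformOf.2 ℓ
  have haW : a = W.LFunction ℓ := by
    have h : ((a : ℤ) : ℂ) = ((W.LFunction ℓ : ℤ) : ℂ) := ha.trans hcoeff
    exact_mod_cast h
  have h1 := W.abs_LFunction_prime_pow_le hℓ 1
  rw [pow_one, pow_one] at h1
  rw [haW]
  calc |((W.LFunction ℓ : ℤ) : ℝ)| ≤ ((1 : ℕ) + 1) * Real.sqrt ℓ := h1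
    _ = 2 * Real.sqrt ℓ := by norm_num

/-- **`log η_P ≤ #c · log(2G)` for a class distinguished at `ℓ`, from ANY bound `G ≥ 1` for the
eigenvalues of `T_ℓ` on `S₂(Γ₀(N))`** (Prop. 5.4 with the integer polynomial of `T_ℓ`:
`η ≤ ∏_σ |a − θ^σ| ≤ (G + |a|)^{#c} ≤ (2G)^{#c}`, `a = a_ℓ(f)` being itself an eigenvalue).
[cite: PastenShimura2024, Prop. 5.4 and proof of Thm. 7.2, p. 26] -/
theorem log_heckeCongruenceModulus_le_of_not_mem_of_bound
    [W.IsElliptic] (D : ModularParametrizationData W N) {ℓ : ℕ} [NeZero ℓ] (hℓ : ℓ.Prime) (hℓN : ¬ ℓ ∣ N)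
    {G : ℝ} (hG1 : 1 ≤ G)
    (hG : ∀ μ : ℂ, Module.End.HasEigenvalue (heckeT (Gamma0 N) 2 ℓ) μ → ‖μ‖ ≤ G)
    {P : Ideal (anemicHeckeRing N 2)} (hP : P ∈ minimalPrimes (anemicHeckeRing N 2))
    (hPne : P ≠ eigenIdeal D.f)
    (htP : anemicHeckeRing.T N 2 ℓ hℓ hℓN -
        (intEigencharacter D.hasIntegralEigenvalues_f D.f_ne_zero (anemicHeckeRing.T N 2 ℓ hℓ hℓN) :
          anemicHeckeRing N 2) ∉ P) :
    Real.log (heckeCongruenceModulus D.f P) ≤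
      (Module.finrank ℤ (anemicHeckeRing N 2 ⧸ P) : ℝ) * Real.log (2 * G) := by
  have hf := D.hasIntegralEigenvalues_f
  have hf0 := D.f_ne_zero
  set t : anemicHeckeRing N 2 := anemicHeckeRing.T N 2 ℓ hℓ hℓN with ht
  set a : ℤ := intEigencharacter hf hf0 t with ha_def
  obtain ⟨q, -, hq0, hroots⟩ := exists_monic_aeval_heckeT_eq_zero_norm_le N 2 ℓ hℓ hG
  have hqt : aeval t q = 0 := by
    have h1 := Polynomial.aeval_algHom_apply (anemicHeckeRing N 2).val t q
    rw [Subalgebra.coe_val, ht, anemicHeckeRing.coe_T, hq0] at h1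
    rw [ht]
    exact Subtype.ext (h1.symm.trans (ZeroMemClass.coe_zero _).symm)
  have habs : |(a : ℝ)| ≤ G := by
    have hev : Module.End.HasEigenvalue (heckeT (Gamma0 N) 2 ℓ) (a : ℂ) := by
      refine Module.End.hasEigenvalue_of_hasEigenvector ⟨Module.End.mem_eigenspace_iff.mpr ?_, hf0⟩
      rw [← anemicHeckeRing.coe_T N 2 ℓ hℓ hℓN, ← ht, intEigencharacter_spec hf hf0 t]
    have := hG _ hev
    rwa [Complex.norm_intCast] at this
  have hη := heckeCongruenceModulus_le_pow_finrank hf hf0 hP htP hqt (by linarith) hroots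
  set r := Module.finrank ℤ (anemicHeckeRing N 2 ⧸ P) with hr
  have hη' : (heckeCongruenceModulus D.f P : ℝ) ≤ (2 * G) ^ r :=
    hη.trans (pow_le_pow_left₀ (by positivity) (by linarith) r)
  have hηpos : (0 : ℝ) < heckeCongruenceModulus D.f P := by
    exact_mod_cast heckeCongruenceModulus_pos hf hf0 hP hPne
  have h := Real.log_le_log hηpos hη'
  rwa [Real.log_pow] at h

/-- **`log η_P ≤ #c · log(2G)` for EVERY class `P ≠ P_f`, from a bound `G ≥ 1` for the eigenvalues
of all `T_p`, `p ∤ N`, `p ≤ N²(1 + log N)/6`, on `S₂(Γ₀(N))`** (a distinguishing prime below the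
Sturm bound of level `N rad N` exists, as in
`PastenShimura2024_log_heckeCongruenceModulus_lt_of_weight_two_bound`, and
`log_heckeCongruenceModulus_le_of_not_mem_of_bound` applies at it).
[cite: PastenShimura2024, proof of Thm. 7.2, p. 26] -/
theorem log_heckeCongruenceModulus_le_of_bound
    [W.IsElliptic] (D : ModularParametrizationData W N) {G : ℝ} (hG1 : 1 ≤ G)
    (hG : ∀ (p : ℕ) [NeZero p], p.Prime → ¬ p ∣ N →
      (p : ℝ) ≤ (N : ℝ) ^ 2 * (1 + Real.log N) / 6 →
        ∀ μ : ℂ, Module.End.HasEigenvalue (heckeT (Gamma0 N) 2 p) μ → ‖μ‖ ≤ G)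
    {P : Ideal (anemicHeckeRing N 2)} (hP : P ∈ minimalPrimes (anemicHeckeRing N 2))
    (hPne : P ≠ eigenIdeal D.f) :
    Real.log (heckeCongruenceModulus D.f P) ≤
      (Module.finrank ℤ (anemicHeckeRing N 2 ⧸ P) : ℝ) * Real.log (2 * G) := by
  have hf := D.hasIntegralEigenvalues_f
  have hf0 := D.f_ne_zero
  have hnew : IsNewform0 D.f := D.isNewformOf.1
  -- (1) `P` is the eigen-ideal of an Atkin–Lehner form of a newform `g` of level `M ∣ N`
  obtain ⟨x, g, hg, hφ0, hPφ⟩ := exists_isNewform0_eigenIdeal_eq_of_mem_minimalPrimes hP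
  have hMN : x.1.1 ∣ N := (dvd_mul_right _ _).trans x.2
  -- (2) a distinguishing prime `p ∤ N` below the Sturm bound of level `N rad N`
  have hdist : ∃ p : ℕ, p.Prime ∧ ¬ p ∣ N ∧
      p < ((2 : ℤ) * gamma0Index (N * ∏ q ∈ N.primeFactors, q)).toNat / 12 + 1 ∧
      (qExpansion 1 ⇑D.f).coeff p ≠ (qExpansion 1 ⇑g).coeff p := by
    by_contra hcon
    push Not at hcon
    have hall : ∀ n, n.Coprime N → (qExpansion 1 ⇑D.f).coeff n = (qExpansion 1 ⇑g).coeff n :=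
      fun n hn ↦ hnew.coeff_eq_of_coprime_of_forall_prime_lt_sturm hg hMN hcon hn
    have heq : eigenIdeal (degeneracyMap0 x.1.1 N x.1.2 2 g) = eigenIdeal D.f := by
      refine eigenIdeal_eq_of_forall_heckeT_eq_smul (isAnemicEigenvector_degeneracyMap0 x hg) hφ0
        hf.isAnemicEigenvector hf0 fun p hp hpN ↦ ?_
      haveI : NeZero p := ⟨hp.ne_zero⟩
      refine ⟨(qExpansion 1 ⇑g).coeff p, heckeT_degeneracyMap0_eq_coeff_smul x hg p hp hpN, ?_⟩
      rw [← hall p ((Nat.Prime.coprime_iff_not_dvd hp).mpr hpN)]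
      exact hnew.heckeT_eq_coeff_smul hp
    exact hPne (hPφ.trans heq)
  obtain ⟨p, hp, hpN, hpB, hne⟩ := hdist
  haveI : NeZero p := ⟨hp.ne_zero⟩
  -- (3) `p ≤ N²(1 + log N)/6`
  have hple : (p : ℝ) ≤ (N : ℝ) ^ 2 * (1 + Real.log N) / 6 := by
    have hμ : gamma0Index (N * ∏ q ∈ N.primeFactors, q) = N * ∏ q ∈ N.primeFactors, (q + 1) :=
      gamma0Index_mul_prod_primeFactors (NeZero.ne N)
    have hB : ((2 : ℤ) * (gamma0Index (N * ∏ q ∈ N.primeFactors, q) : ℕ)).toNat =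
        2 * (N * ∏ q ∈ N.primeFactors, (q + 1)) := by
      rw [hμ, show ((2 : ℤ) * ((N * ∏ q ∈ N.primeFactors, (q + 1) : ℕ) : ℤ)) =
        ((2 * (N * ∏ q ∈ N.primeFactors, (q + 1)) : ℕ) : ℤ) by push_cast; ring, Int.toNat_natCast]
    rw [hB] at hpB
    have hp12 : p ≤ 2 * (N * ∏ q ∈ N.primeFactors, (q + 1)) / 12 := Nat.lt_succ_iff.mp hpB
    have hp6 : 6 * p ≤ N * ∏ q ∈ N.primeFactors, (q + 1) := by omega
    have hprod := prod_primeFactors_add_one_le (NeZero.ne N)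
    have h6 : 6 * (p : ℝ) ≤ (N : ℝ) * ((N : ℝ) * (1 + Real.log N)) := by
      calc 6 * (p : ℝ) = ((6 * p : ℕ) : ℝ) := by push_cast; ring
        _ ≤ ((N * ∏ q ∈ N.primeFactors, (q + 1) : ℕ) : ℝ) := by exact_mod_cast hp6
        _ = (N : ℝ) * ((∏ q ∈ N.primeFactors, (q + 1) : ℕ) : ℝ) := by push_cast; ring
        _ ≤ (N : ℝ) * ((N : ℝ) * (1 + Real.log N)) := by gcongr
    rw [le_div_iff₀ (by norm_num : (0 : ℝ) < 6)]
    linarith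
  -- (4) `T_p − a_p(f) ∉ P`, and the bound at `p`
  set t : anemicHeckeRing N 2 := anemicHeckeRing.T N 2 p hp hpN with ht
  set a : ℤ := intEigencharacter hf hf0 t with ha_def
  have ha : (a : ℂ) = (qExpansion 1 ⇑D.f).coeff p := by
    rw [ha_def, cast_intEigencharacter, ht, eigencharacter_T,
      heckeEigenvalue_eq_coeff_of_isNormalized hnew.2.2 hp (hnew.2.1 p hp)]
  have htP : t - (a : anemicHeckeRing N 2) ∉ P := by
    rw [hPφ, T_sub_intCast_mem_eigenIdeal_iff hφ0 hp hpN
      (heckeT_degeneracyMap0_eq_coeff_smul x hg p hp hpN), ha]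
    exact fun h ↦ hne h.symm
  exact log_heckeCongruenceModulus_le_of_not_mem_of_bound D hp hpN hG1
    (fun μ hμ ↦ hG p hp hpN hple μ hμ) hP hPne htP

/-- **Congruence splitting at one good prime with general eigenvalue bounds** (the Deligne-free form
of `log_modularDegree_le_of_prime`): for `D` of minimal degree in its class at level `N`, a prime
`ℓ ∤ N`, a bound `G_ℓ ≥ 1` for the eigenvalues of `T_ℓ` and a bound `G ≥ 1` for the eigenvalues of
all `T_p`, `p ∤ N`, `p ≤ N²(1 + log N)/6`,

  `log δ_{1,N} ≤ (Σ_{P ≠ P_f} #c) · log(2G_ℓ) + dim Eig(T_ℓ, a_ℓ(f)) · log(2G)`.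

[cite: PastenShimura2024, Thm. 5.5 and proof of Thm. 7.2 (p. 26)] -/
theorem log_modularDegree_le_of_prime_of_bounds
    [W.IsElliptic] (D : ModularParametrizationData W N)
    (hmin : ∀ (W' : WeierstrassCurve ℚ) [W'.IsElliptic] (D' : ModularParametrizationData W' N),
      D'.f = D.f → D.modularDegree ≤ D'.modularDegree)
    {ℓ : ℕ} [NeZero ℓ] (hℓ : ℓ.Prime) (hℓN : ¬ ℓ ∣ N) {Gℓ G : ℝ} (hGℓ1 : 1 ≤ Gℓ) (hG1 : 1 ≤ G)
    (hGℓ : ∀ μ : ℂ, Module.End.HasEigenvalue (heckeT (Gamma0 N) 2 ℓ) μ → ‖μ‖ ≤ Gℓ)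
    (hG : ∀ (p : ℕ) [NeZero p], p.Prime → ¬ p ∣ N →
      (p : ℝ) ≤ (N : ℝ) ^ 2 * (1 + Real.log N) / 6 →
        ∀ μ : ℂ, Module.End.HasEigenvalue (heckeT (Gamma0 N) 2 p) μ → ‖μ‖ ≤ G) :
    Real.log (D.modularDegree : ℝ) ≤
      (∑ P ∈ (finite_minimalPrimes_anemicHeckeRing N 2).toFinset.erase (eigenIdeal D.f),
          (Module.finrank ℤ (anemicHeckeRing N 2 ⧸ P) : ℝ)) * Real.log (2 * Gℓ) +
        (Module.finrank ℂ (Module.End.eigenspace (heckeT (Gamma0 N) 2 ℓ)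
          ((qExpansion 1 ⇑D.f).coeff ℓ)) : ℝ) * Real.log (2 * G) := by
  classical
  have hf := D.hasIntegralEigenvalues_f
  have hf0 := D.f_ne_zero
  have hnew : IsNewform0 D.f := D.isNewformOf.1
  set M := (finite_minimalPrimes_anemicHeckeRing N 2).toFinset with hM
  set Pf := eigenIdeal D.f with hPf
  set T : anemicHeckeRing N 2 := anemicHeckeRing.T N 2 ℓ hℓ hℓN with hT
  set a : ℤ := intEigencharacter hf hf0 T with ha_def
  set t : anemicHeckeRing N 2 := T - (a : anemicHeckeRing N 2) with ht
  have ha : (a : ℂ) = (qExpansion 1 ⇑D.f).coeff ℓ := by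
    rw [ha_def, cast_intEigencharacter, hT, eigencharacter_T,
      heckeEigenvalue_eq_coeff_of_isNormalized hnew.2.2 hℓ (hnew.2.1 ℓ hℓ)]
  have hcℓ0 : 0 ≤ Real.log (2 * Gℓ) := Real.log_nonneg (by linarith)
  have hcN0 : 0 ≤ Real.log (2 * G) := Real.log_nonneg (by linarith)
  have h55 := log_modularDegree_le_sum_log_heckeCongruenceModulus PastenShimura2024_thm_5_5_holds D hmin
  rw [← hM, ← hPf] at h55
  rw [← Finset.sum_filter_add_sum_filter_not (M.erase Pf) (fun P ↦ t ∈ P)] at h55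
  have hmemM : ∀ P ∈ M.erase Pf, P ∈ minimalPrimes (anemicHeckeRing N 2) ∧ P ≠ Pf := fun P hP ↦
    ⟨(finite_minimalPrimes_anemicHeckeRing N 2).mem_toFinset.mp (Finset.mem_of_mem_erase hP),
      Finset.ne_of_mem_erase hP⟩
  have hagr : ∑ P ∈ (M.erase Pf).filter (fun P ↦ t ∈ P), Real.log (heckeCongruenceModulus D.f P : ℝ) ≤
      (∑ P ∈ (M.erase Pf).filter (fun P ↦ t ∈ P), (Module.finrank ℤ (anemicHeckeRing N 2 ⧸ P) : ℝ)) *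
        Real.log (2 * G) := by
    rw [Finset.sum_mul]
    refine Finset.sum_le_sum fun P hP ↦ ?_
    obtain ⟨hPmin, hPne⟩ := hmemM P (Finset.mem_of_mem_filter P hP)
    exact log_heckeCongruenceModulus_le_of_bound D hG1 hG hPmin hPne
  have hdist : ∑ P ∈ (M.erase Pf).filter (fun P ↦ ¬ t ∈ P), Real.log (heckeCongruenceModulus D.f P : ℝ) ≤
      (∑ P ∈ (M.erase Pf).filter (fun P ↦ ¬ t ∈ P), (Module.finrank ℤ (anemicHeckeRing N 2 ⧸ P) : ℝ)) *
        Real.log (2 * Gℓ) := by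
    rw [Finset.sum_mul]
    refine Finset.sum_le_sum fun P hP ↦ ?_
    obtain ⟨hPmin, hPne⟩ := hmemM P (Finset.mem_of_mem_filter P hP)
    have htP : t ∉ P := (Finset.mem_filter.mp hP).2
    exact log_heckeCongruenceModulus_le_of_not_mem_of_bound D hℓ hℓN hGℓ1 hGℓ hPmin hPne htP
  have hcount : (∑ P ∈ (M.erase Pf).filter (fun P ↦ t ∈ P),
      (Module.finrank ℤ (anemicHeckeRing N 2 ⧸ P) : ℝ)) ≤
      Module.finrank ℂ (Module.End.eigenspace (heckeT (Gamma0 N) 2 ℓ) ((qExpansion 1 ⇑D.f).coeff ℓ)) := by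
    have h := sum_finrank_quotient_le_finrank_ker t ((M.erase Pf).filter fun P ↦ t ∈ P)
      (fun P hP ↦ (hmemM P (Finset.mem_of_mem_filter P hP)).1) (fun P hP ↦ (Finset.mem_filter.mp hP).2)
    have hker : LinearMap.ker (t : Module.End ℂ (CuspForm (Gamma0 N) 2)) =
        Module.End.eigenspace (heckeT (Gamma0 N) 2 ℓ) ((qExpansion 1 ⇑D.f).coeff ℓ) := by
      ext w
      rw [LinearMap.mem_ker, Module.End.mem_eigenspace_iff, ht, Subalgebra.coe_sub, LinearMap.sub_apply,
        hT, anemicHeckeRing.coe_T, sub_eq_zero, ← ha, SubringClass.coe_intCast, Module.End.intCast_apply,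
        Int.cast_smul_eq_zsmul]
    rw [hker] at h
    exact_mod_cast h
  have hcount' : (∑ P ∈ (M.erase Pf).filter (fun P ↦ ¬ t ∈ P),
      (Module.finrank ℤ (anemicHeckeRing N 2 ⧸ P) : ℝ)) ≤
      ∑ P ∈ M.erase Pf, (Module.finrank ℤ (anemicHeckeRing N 2 ⧸ P) : ℝ) :=
    Finset.sum_le_sum_of_subset_of_nonneg (Finset.filter_subset _ _) fun _ _ _ ↦ Nat.cast_nonneg _
  calc Real.log (D.modularDegree : ℝ)
      ≤ _ := h55
    _ ≤ (∑ P ∈ (M.erase Pf).filter (fun P ↦ t ∈ P), (Module.finrank ℤ (anemicHeckeRing N 2 ⧸ P) : ℝ)) *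
          Real.log (2 * G) +
        (∑ P ∈ (M.erase Pf).filter (fun P ↦ ¬ t ∈ P), (Module.finrank ℤ (anemicHeckeRing N 2 ⧸ P) : ℝ)) *
          Real.log (2 * Gℓ) := add_le_add hagr hdist
    _ ≤ (Module.finrank ℂ (Module.End.eigenspace (heckeT (Gamma0 N) 2 ℓ)
          ((qExpansion 1 ⇑D.f).coeff ℓ)) : ℝ) * Real.log (2 * G) +
        (∑ P ∈ M.erase Pf, (Module.finrank ℤ (anemicHeckeRing N 2 ⧸ P) : ℝ)) * Real.log (2 * Gℓ) :=
        add_le_add (mul_le_mul_of_nonneg_right hcount hcN0) (mul_le_mul_of_nonneg_right hcount' hcℓ0)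
    _ = _ := by rw [add_comm]

/-- **The one-prime bound from eigenvalue bounds of size `G_N`** (the common core of the variants
below): granted, for the primes `p ∤ N`, the bound `|μ| ≤ G_N(p) = √((p+1)(ψ(N)+1) + 10⁶ p¹² N)` for
the eigenvalues of `T_p` on `S₂(Γ₀(N))` (`hEV` — it follows from the trace identity at `n = p²`,
`norm_le_sqrt_of_primePowTrace`, and also, unconditionally, from the trivial bound `|μ| ≤ p + 1`,
`eigenvalue_norm_le_traceBound_of_trivial`) and Murty–Sinha's bound with constant `A`, for `D` of
minimal degree in its class at level `N ≥ 11` and a prime `ℓ ∤ N`,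

  `log δ_{1,N} ≤ (Σ_{P ≠ P_f} #c) · log(2 G_N(ℓ)) + A dim S₂(Γ₀(N)) log ℓ / log 2N · log(2 G_N(N³))`

(the eigenvalue `a_ℓ(f)` at which Murty–Sinha is applied satisfies `|a_ℓ(f)| ≤ 2√ℓ` by Hasse,
`abs_intEigencharacter_T_le`). [cite: PastenShimura2024, proof of Thm. 7.2, p. 26]
[cite: MurtySinha2009, eq. (1) p. 683] -/
theorem log_modularDegree_le_of_eigenvalueBounds
    (hEV : ∀ (p : ℕ) [NeZero p], p.Prime → ¬ p ∣ N → ∀ μ : ℂ,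
      Module.End.HasEigenvalue (heckeT (Gamma0 N) 2 p) μ →
        ‖μ‖ ≤ Real.sqrt (((p : ℝ) + 1) * ((gamma0Index N : ℝ) + 1) + 10 ^ 6 * (p : ℝ) ^ 12 * N))
    {A : ℝ}
    (hA : ∀ (N : ℕ) [NeZero N] (p : ℕ) [NeZero p], p.Prime → ¬ p ∣ N →
      ∀ α : ℝ, |α| ≤ 2 * Real.sqrt p →
        (Module.finrank ℂ (Module.End.eigenspace (heckeT (Gamma0 N) 2 p) (α : ℂ)) : ℝ) ≤
          A * Module.finrank ℂ (CuspForm (Gamma0 N) 2) * Real.log p / Real.log (2 * N))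
    [W.IsElliptic] (D : ModularParametrizationData W N)
    (hmin : ∀ (W' : WeierstrassCurve ℚ) [W'.IsElliptic] (D' : ModularParametrizationData W' N),
      D'.f = D.f → D.modularDegree ≤ D'.modularDegree)
    (hN : 11 ≤ N) {ℓ : ℕ} [NeZero ℓ] (hℓ : ℓ.Prime) (hℓN : ¬ ℓ ∣ N) :
    Real.log (D.modularDegree : ℝ) ≤
      (∑ P ∈ (finite_minimalPrimes_anemicHeckeRing N 2).toFinset.erase (eigenIdeal D.f),
          (Module.finrank ℤ (anemicHeckeRing N 2 ⧸ P) : ℝ)) *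
          Real.log (2 * Real.sqrt (((ℓ : ℝ) + 1) * ((gamma0Index N : ℝ) + 1) + 10 ^ 6 * (ℓ : ℝ) ^ 12 * N)) +
        max A 0 * Module.finrank ℂ (CuspForm (Gamma0 N) 2) * Real.log ℓ / Real.log (2 * N) *
          Real.log (2 * Real.sqrt ((((N : ℝ) ^ 3) + 1) * ((gamma0Index N : ℝ) + 1) +
            10 ^ 6 * ((N : ℝ) ^ 3) ^ 12 * N)) := by
  have hf := D.hasIntegralEigenvalues_f
  have hf0 := D.f_ne_zero
  have hnew : IsNewform0 D.f := D.isNewformOf.1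
  have hNr : (11 : ℝ) ≤ N := by exact_mod_cast hN
  have hψ0 : (0 : ℝ) ≤ gamma0Index N := Nat.cast_nonneg _
  -- the two bounds `G_ℓ`, `G`
  set Gℓ : ℝ := Real.sqrt (((ℓ : ℝ) + 1) * ((gamma0Index N : ℝ) + 1) + 10 ^ 6 * (ℓ : ℝ) ^ 12 * N) with hGℓ
  set G : ℝ := Real.sqrt ((((N : ℝ) ^ 3) + 1) * ((gamma0Index N : ℝ) + 1) + 10 ^ 6 * ((N : ℝ) ^ 3) ^ 12 * N)
    with hG
  have hone : ∀ x : ℝ, 0 ≤ x → (1 : ℝ) ≤ Real.sqrt ((x + 1) * ((gamma0Index N : ℝ) + 1) + 10 ^ 6 * x ^ 12 * N) := by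
    intro x hx
    refine Real.le_sqrt_of_sq_le ?_
    rw [one_pow]
    nlinarith [mul_nonneg (pow_nonneg hx 12) (show (0:ℝ) ≤ N by positivity)]
  have hGℓ1 : 1 ≤ Gℓ := hone ℓ (Nat.cast_nonneg ℓ)
  have hG1 : 1 ≤ G := hone ((N : ℝ) ^ 3) (by positivity)
  have hGℓb : ∀ μ : ℂ, Module.End.HasEigenvalue (heckeT (Gamma0 N) 2 ℓ) μ → ‖μ‖ ≤ Gℓ :=
    fun μ hμ ↦ hEV ℓ hℓ hℓN μ hμ
  have hGb : ∀ (p : ℕ) [NeZero p], p.Prime → ¬ p ∣ N → (p : ℝ) ≤ (N : ℝ) ^ 2 * (1 + Real.log N) / 6 →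
      ∀ μ : ℂ, Module.End.HasEigenvalue (heckeT (Gamma0 N) 2 p) μ → ‖μ‖ ≤ G := by
    intro p _ hp hpN hple μ hμ
    refine (hEV p hp hpN μ hμ).trans (Real.sqrt_le_sqrt ?_)
    -- `p ≤ N²(1 + log N)/6 ≤ N³`
    have hlogN : Real.log N ≤ N := (Real.log_le_sub_one_of_pos (by linarith)).trans (by linarith)
    have hpN3 : (p : ℝ) ≤ (N : ℝ) ^ 3 := by
      refine hple.trans ?_
      rw [div_le_iff₀ (by norm_num : (0:ℝ) < 6)]
      nlinarith [sq_nonneg (N : ℝ)]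
    have hp0 : (0 : ℝ) ≤ p := Nat.cast_nonneg p
    have h12 : (p : ℝ) ^ 12 ≤ ((N : ℝ) ^ 3) ^ 12 := pow_le_pow_left₀ hp0 hpN3 12
    nlinarith [mul_le_mul_of_nonneg_right h12 (show (0:ℝ) ≤ 10 ^ 6 * N by positivity)]
  have hmain := log_modularDegree_le_of_prime_of_bounds D hmin hℓ hℓN hGℓ1 hG1 hGℓb hGb
  -- Murty–Sinha at `a_ℓ(f)`, with Hasse
  set T : anemicHeckeRing N 2 := anemicHeckeRing.T N 2 ℓ hℓ hℓN with hT
  set a : ℤ := intEigencharacter hf hf0 T with ha_def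
  have ha : (a : ℂ) = (qExpansion 1 ⇑D.f).coeff ℓ := by
    rw [ha_def, cast_intEigencharacter, hT, eigencharacter_T,
      heckeEigenvalue_eq_coeff_of_isNormalized hnew.2.2 hℓ (hnew.2.1 ℓ hℓ)]
  have habs : |(a : ℝ)| ≤ 2 * Real.sqrt ℓ := abs_intEigencharacter_T_le D hℓ hℓN
  have hmult := hA N ℓ hℓ hℓN (a : ℝ) habs
  rw [Complex.ofReal_intCast, ha] at hmult
  have hlogG0 : 0 ≤ Real.log (2 * G) := Real.log_nonneg (by linarith)
  have hdim0 : (0 : ℝ) ≤ Module.finrank ℂ (CuspForm (Gamma0 N) 2) := Nat.cast_nonneg _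
  have hlogℓ0 : 0 ≤ Real.log ℓ := Real.log_natCast_nonneg ℓ
  have hlog2N0 : 0 < Real.log (2 * N) := Real.log_pos (by linarith)
  have hmult' : (Module.finrank ℂ (Module.End.eigenspace (heckeT (Gamma0 N) 2 ℓ)
      ((qExpansion 1 ⇑D.f).coeff ℓ)) : ℝ) ≤
      max A 0 * Module.finrank ℂ (CuspForm (Gamma0 N) 2) * Real.log ℓ / Real.log (2 * N) := by
    refine hmult.trans (div_le_div_of_nonneg_right ?_ hlog2N0.le)
    exact mul_le_mul_of_nonneg_right (mul_le_mul_of_nonneg_right (le_max_left _ _) hdim0) hlogℓ0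
  exact hmain.trans (add_le_add le_rfl (mul_le_mul_of_nonneg_right hmult' hlogG0))

/-- **The trivial bound is of size `G_N`**: `|μ| ≤ p + 1 ≤ G_N(p) = √((p+1)(ψ(N)+1) + 10⁶ p¹² N)`
for the eigenvalues of `T_p`, `p ∤ N`, on `S₂(Γ₀(N))` — unconditionally, by the Petersson
operator-norm bound `norm_eigenvalue_heckeT_gamma0_two_le` (`HeckeOperatorsEigenvalueBoundProofs`).
[folklore] -/
theorem eigenvalue_norm_le_traceBound_of_trivial (p : ℕ) [NeZero p] (hp : p.Prime) (hpN : ¬ p ∣ N)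
    (μ : ℂ) (hμ : Module.End.HasEigenvalue (heckeT (Gamma0 N) 2 p) μ) :
    ‖μ‖ ≤ Real.sqrt (((p : ℝ) + 1) * ((gamma0Index N : ℝ) + 1) + 10 ^ 6 * (p : ℝ) ^ 12 * N) := by
  refine (ModularForms.norm_eigenvalue_heckeT_gamma0_two_le N p hp hpN hμ).trans
    (Real.le_sqrt_of_sq_le ?_)
  have hp2 : (2 : ℝ) ≤ p := by exact_mod_cast hp.two_le
  have hN1 : (1 : ℝ) ≤ N := by exact_mod_cast Nat.one_le_iff_ne_zero.mpr (NeZero.ne N)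
  have hψ0 : (0 : ℝ) ≤ gamma0Index N := Nat.cast_nonneg _
  have h4 : ((p : ℝ) + 1) ^ 2 ≤ 4 * (p : ℝ) ^ 2 := by nlinarith
  have h12 : (p : ℝ) ^ 2 ≤ (p : ℝ) ^ 12 := pow_le_pow_right₀ (by linarith) (by norm_num)
  have h0 : 0 ≤ ((p : ℝ) + 1) * ((gamma0Index N : ℝ) + 1) := by positivity
  nlinarith [mul_le_mul_of_nonneg_left hN1 (show (0 : ℝ) ≤ 10 ^ 6 * (p : ℝ) ^ 12 by positivity)]

open Literature.NumberTheory.Automorphic Literature.NumberTheory.Automorphic.HeckeTraceFormulaGL2Level in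
/-- **The one-prime bound from the prime-power trace identities alone** (no Deligne): granted the
Eichler–Selberg identities `Tr(T_{p^c} | S₂(Γ₀(N))) = A₁ + A₂ + A₃ + A₄` at level `N` for the primes
`p ∤ N` (only `c = 2` is used here) and Murty–Sinha's bound with constant `A` (itself a consequence of
the same identities in the tree, `murtySinha2009_eigenvalue_multiplicity_weightTwo_of_primePowTraces`),
for `D` of minimal degree in its class at level `N ≥ 11` and a prime `ℓ ∤ N`,

  `log δ_{1,N} ≤ (Σ_{P ≠ P_f} #c) · log(2 G_N(ℓ)) + A dim S₂(Γ₀(N)) log ℓ / log 2N · log(2 G_N(N³))`,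

`G_N(x) = √((x+1)(ψ(N)+1) + 10⁶ x¹² N)` (`log_modularDegree_le_of_eigenvalueBounds` with
`norm_le_sqrt_of_primePowTrace`). [cite: PastenShimura2024, proof of Thm. 7.2, p. 26] [cite: MurtySinha2009, eq. (1) p. 683]
[cite: SchoofVandervlugt1991, Thm. 2.2, p. 168] -/
theorem log_modularDegree_le_of_primePowTraces
    (hPP : ∀ (p : ℕ) [NeZero p], p.Prime → ¬ p ∣ N →
      ∀ c : ℕ, cuspidalHeckeTrace N 2 1 (p ^ c) = geometricSide N 1 2 (p ^ c)) {A : ℝ}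
    (hA : ∀ (N : ℕ) [NeZero N] (p : ℕ) [NeZero p], p.Prime → ¬ p ∣ N →
      ∀ α : ℝ, |α| ≤ 2 * Real.sqrt p →
        (Module.finrank ℂ (Module.End.eigenspace (heckeT (Gamma0 N) 2 p) (α : ℂ)) : ℝ) ≤
          A * Module.finrank ℂ (CuspForm (Gamma0 N) 2) * Real.log p / Real.log (2 * N))
    [W.IsElliptic] (D : ModularParametrizationData W N)
    (hmin : ∀ (W' : WeierstrassCurve ℚ) [W'.IsElliptic] (D' : ModularParametrizationData W' N),
      D'.f = D.f → D.modularDegree ≤ D'.modularDegree)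
    (hN : 11 ≤ N) {ℓ : ℕ} [NeZero ℓ] (hℓ : ℓ.Prime) (hℓN : ¬ ℓ ∣ N) :
    Real.log (D.modularDegree : ℝ) ≤
      (∑ P ∈ (finite_minimalPrimes_anemicHeckeRing N 2).toFinset.erase (eigenIdeal D.f),
          (Module.finrank ℤ (anemicHeckeRing N 2 ⧸ P) : ℝ)) *
          Real.log (2 * Real.sqrt (((ℓ : ℝ) + 1) * ((gamma0Index N : ℝ) + 1) + 10 ^ 6 * (ℓ : ℝ) ^ 12 * N)) +
        max A 0 * Module.finrank ℂ (CuspForm (Gamma0 N) 2) * Real.log ℓ / Real.log (2 * N) *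
          Real.log (2 * Real.sqrt ((((N : ℝ) ^ 3) + 1) * ((gamma0Index N : ℝ) + 1) +
            10 ^ 6 * ((N : ℝ) ^ 3) ^ 12 * N)) :=
  log_modularDegree_le_of_eigenvalueBounds
    (fun p _ hp hpN _ hμ ↦ ModularForms.norm_le_sqrt_of_primePowTrace N (hPP p hp hpN 2) hp hpN hμ)
    hA D hmin hN hℓ hℓN

/-- **The one-prime bound from Murty–Sinha's multiplicity estimate ALONE** (constant `A`): the
eigenvalue bounds of the argument are supplied unconditionally by the trivial bound `|μ| ≤ p + 1`
(`eigenvalue_norm_le_traceBound_of_trivial`); no Deligne, no trace formula.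
[cite: PastenShimura2024, proof of Thm. 7.2, p. 26] [cite: MurtySinha2009, eq. (1) p. 683] -/
theorem log_modularDegree_le_of_multiplicity_only {A : ℝ}
    (hA : ∀ (N : ℕ) [NeZero N] (p : ℕ) [NeZero p], p.Prime → ¬ p ∣ N →
      ∀ α : ℝ, |α| ≤ 2 * Real.sqrt p →
        (Module.finrank ℂ (Module.End.eigenspace (heckeT (Gamma0 N) 2 p) (α : ℂ)) : ℝ) ≤
          A * Module.finrank ℂ (CuspForm (Gamma0 N) 2) * Real.log p / Real.log (2 * N))
    [W.IsElliptic] (D : ModularParametrizationData W N)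
    (hmin : ∀ (W' : WeierstrassCurve ℚ) [W'.IsElliptic] (D' : ModularParametrizationData W' N),
      D'.f = D.f → D.modularDegree ≤ D'.modularDegree)
    (hN : 11 ≤ N) {ℓ : ℕ} [NeZero ℓ] (hℓ : ℓ.Prime) (hℓN : ¬ ℓ ∣ N) :
    Real.log (D.modularDegree : ℝ) ≤
      (∑ P ∈ (finite_minimalPrimes_anemicHeckeRing N 2).toFinset.erase (eigenIdeal D.f),
          (Module.finrank ℤ (anemicHeckeRing N 2 ⧸ P) : ℝ)) *
          Real.log (2 * Real.sqrt (((ℓ : ℝ) + 1) * ((gamma0Index N : ℝ) + 1) + 10 ^ 6 * (ℓ : ℝ) ^ 12 * N)) +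
        max A 0 * Module.finrank ℂ (CuspForm (Gamma0 N) 2) * Real.log ℓ / Real.log (2 * N) *
          Real.log (2 * Real.sqrt ((((N : ℝ) ^ 3) + 1) * ((gamma0Index N : ℝ) + 1) +
            10 ^ 6 * ((N : ℝ) ^ 3) ^ 12 * N)) :=
  log_modularDegree_le_of_eigenvalueBounds (eigenvalue_norm_le_traceBound_of_trivial (N := N))
    hA D hmin hN hℓ hℓN

/-- **The log-free shape from Murty–Sinha's multiplicity estimate ALONE:
`log δ_{1,N} ≤ (3 + 3A) · dim S₂(Γ₀(N)) · log ℓ`** for every prime `ℓ ∤ N`, `N ≥ 16`, `A ≥ 0` the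
constant of `murtySinha2009_eigenvalue_multiplicity_weightTwo`: one-prime splitting
(`log_modularDegree_le_of_prime_of_bounds`) with the PROVED trivial bounds `|μ| ≤ ℓ + 1` for `T_ℓ`
and `|μ| ≤ p + 1 ≤ N³` for the Sturm primes `p ≤ N²(1 + log N)/6`
(`norm_eigenvalue_heckeT_gamma0_two_le`), `Σ_{P ≠ P_f} #c ≤ rank 𝕋 ≤ dim`, `log(2(ℓ+1)) ≤ 3 log ℓ`,
`log(2N³) ≤ 3 log 2N`, and Murty–Sinha at `a_ℓ(f)` (`|a_ℓ(f)| ≤ 2√ℓ`, Hasse). No Deligne.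
[cite: PastenShimura2024, Thm. 7.2 and Thm. 7.4 (pp. 26–27)] [cite: MurtySinha2009, eq. (1) p. 683] -/
theorem log_modularDegree_le_finrank_mul_log_only {A : ℝ}
    (hA : ∀ (N : ℕ) [NeZero N] (p : ℕ) [NeZero p], p.Prime → ¬ p ∣ N →
      ∀ α : ℝ, |α| ≤ 2 * Real.sqrt p →
        (Module.finrank ℂ (Module.End.eigenspace (heckeT (Gamma0 N) 2 p) (α : ℂ)) : ℝ) ≤
          A * Module.finrank ℂ (CuspForm (Gamma0 N) 2) * Real.log p / Real.log (2 * N))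
    [W.IsElliptic] (D : ModularParametrizationData W N)
    (hmin : ∀ (W' : WeierstrassCurve ℚ) [W'.IsElliptic] (D' : ModularParametrizationData W' N),
      D'.f = D.f → D.modularDegree ≤ D'.modularDegree)
    (hN : 16 ≤ N) {ℓ : ℕ} [NeZero ℓ] (hℓ : ℓ.Prime) (hℓN : ¬ ℓ ∣ N) :
    Real.log (D.modularDegree : ℝ) ≤
      (3 + 3 * max A 0) * Module.finrank ℂ (CuspForm (Gamma0 N) 2) * Real.log ℓ := by
  have hf := D.hasIntegralEigenvalues_f
  have hf0 := D.f_ne_zero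
  have hnew : IsNewform0 D.f := D.isNewformOf.1
  have hNr : (16 : ℝ) ≤ N := by exact_mod_cast hN
  have hNpos : (0 : ℝ) < N := by linarith
  have hℓ2 : (2 : ℝ) ≤ ℓ := by exact_mod_cast hℓ.two_le
  have hlogℓ0 : 0 ≤ Real.log ℓ := Real.log_nonneg (by linarith)
  have hlog2 : Real.log 2 ≤ Real.log ℓ := Real.log_le_log two_pos hℓ2
  -- the trivial bounds `Gℓ = ℓ + 1`, `G = N³`
  have hGℓ1 : (1 : ℝ) ≤ ℓ + 1 := by linarith
  have hG1 : (1 : ℝ) ≤ (N : ℝ) ^ 3 := one_le_pow₀ (by linarith)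
  have hGℓ : ∀ μ : ℂ, Module.End.HasEigenvalue (heckeT (Gamma0 N) 2 ℓ) μ → ‖μ‖ ≤ ℓ + 1 :=
    fun μ hμ ↦ ModularForms.norm_eigenvalue_heckeT_gamma0_two_le N ℓ hℓ hℓN hμ
  have hG : ∀ (p : ℕ) [NeZero p], p.Prime → ¬ p ∣ N →
      (p : ℝ) ≤ (N : ℝ) ^ 2 * (1 + Real.log N) / 6 →
        ∀ μ : ℂ, Module.End.HasEigenvalue (heckeT (Gamma0 N) 2 p) μ → ‖μ‖ ≤ (N : ℝ) ^ 3 := by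
    intro p _ hp hpN hple μ hμ
    refine (ModularForms.norm_eigenvalue_heckeT_gamma0_two_le N p hp hpN hμ).trans ?_
    have hlogN : Real.log N ≤ N := (Real.log_le_sub_one_of_pos hNpos).trans (by linarith)
    have h1 : (p : ℝ) ≤ (N : ℝ) ^ 2 * (1 + N) / 6 := by
      refine hple.trans (div_le_div_of_nonneg_right ?_ (by norm_num))
      exact mul_le_mul_of_nonneg_left (by linarith) (by positivity)
    nlinarith [sq_nonneg (N : ℝ)]
  have hmain := log_modularDegree_le_of_prime_of_bounds D hmin hℓ hℓN hGℓ1 hG1 hGℓ hG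
  -- Murty–Sinha at `a_ℓ(f)`, with Hasse
  set T : anemicHeckeRing N 2 := anemicHeckeRing.T N 2 ℓ hℓ hℓN with hT
  set a : ℤ := intEigencharacter hf hf0 T with ha_def
  have ha : (a : ℂ) = (qExpansion 1 ⇑D.f).coeff ℓ := by
    rw [ha_def, cast_intEigencharacter, hT, eigencharacter_T,
      heckeEigenvalue_eq_coeff_of_isNormalized hnew.2.2 hℓ (hnew.2.1 ℓ hℓ)]
  have habs : |(a : ℝ)| ≤ 2 * Real.sqrt ℓ := abs_intEigencharacter_T_le D hℓ hℓN
  have hmult := hA N ℓ hℓ hℓN (a : ℝ) habs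
  rw [Complex.ofReal_intCast, ha] at hmult
  set d : ℝ := (Module.finrank ℂ (CuspForm (Gamma0 N) 2) : ℝ) with hd
  have hd0 : 0 ≤ d := Nat.cast_nonneg _
  have hA' : A ≤ max A 0 := le_max_left _ _
  have hA'0 : 0 ≤ max A 0 := le_max_right _ _
  -- `Σ_{P ≠ P_f} #c ≤ rank 𝕋 ≤ dim`
  have hr : (∑ P ∈ (finite_minimalPrimes_anemicHeckeRing N 2).toFinset.erase (eigenIdeal D.f),
      (Module.finrank ℤ (anemicHeckeRing N 2 ⧸ P) : ℝ)) ≤ d := by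
    have h1 : (∑ P ∈ (finite_minimalPrimes_anemicHeckeRing N 2).toFinset.erase (eigenIdeal D.f),
        Module.finrank ℤ (anemicHeckeRing N 2 ⧸ P)) ≤ Module.finrank ℂ (CuspForm (Gamma0 N) 2) :=
      ((Finset.sum_le_sum_of_subset (Finset.erase_subset _ _)).trans
        sum_finrank_quotient_minimalPrimes_le_finrank).trans
        (finrank_anemicHeckeRing_le_finrank_cuspForm N 2)
    rw [hd]
    exact_mod_cast h1
  -- numerics: `log(2(ℓ+1)) ≤ 3 log ℓ`, `log(2N³) ≤ 3 log 2N`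
  have hlog2N0 : 0 < Real.log (2 * N) := Real.log_pos (by linarith)
  have hc1 : Real.log (2 * ((ℓ : ℝ) + 1)) ≤ 3 * Real.log ℓ := by
    have h8 : 2 * ((ℓ : ℝ) + 1) ≤ (ℓ : ℝ) ^ 3 := by
      have h4 : (4 : ℝ) ≤ (ℓ : ℝ) * ℓ := by nlinarith
      have h3 : (ℓ : ℝ) ^ 3 = (ℓ : ℝ) * ℓ * ℓ := by ring
      rw [h3]
      nlinarith
    calc Real.log (2 * ((ℓ : ℝ) + 1)) ≤ Real.log ((ℓ : ℝ) ^ 3) := Real.log_le_log (by linarith) h8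
      _ = 3 * Real.log ℓ := by rw [Real.log_pow]; norm_num
  have hc2 : Real.log (2 * (N : ℝ) ^ 3) ≤ 3 * Real.log (2 * N) := by
    have h8 : 2 * (N : ℝ) ^ 3 ≤ (2 * (N : ℝ)) ^ 3 := by nlinarith [pow_pos hNpos 3]
    calc Real.log (2 * (N : ℝ) ^ 3) ≤ Real.log ((2 * (N : ℝ)) ^ 3) := Real.log_le_log (by positivity) h8
      _ = 3 * Real.log (2 * N) := by rw [Real.log_pow]; norm_num
  have hc10 : 0 ≤ Real.log (2 * ((ℓ : ℝ) + 1)) := Real.log_nonneg (by linarith)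
  have hc20 : 0 ≤ Real.log (2 * (N : ℝ) ^ 3) := Real.log_nonneg (by nlinarith [hG1])
  -- the two terms
  have hterm1 : (∑ P ∈ (finite_minimalPrimes_anemicHeckeRing N 2).toFinset.erase (eigenIdeal D.f),
      (Module.finrank ℤ (anemicHeckeRing N 2 ⧸ P) : ℝ)) * Real.log (2 * ((ℓ : ℝ) + 1)) ≤
      3 * d * Real.log ℓ := by
    calc _ ≤ d * Real.log (2 * ((ℓ : ℝ) + 1)) := mul_le_mul_of_nonneg_right hr hc10
      _ ≤ d * (3 * Real.log ℓ) := mul_le_mul_of_nonneg_left hc1 hd0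
      _ = 3 * d * Real.log ℓ := by ring
  have hmult' : (Module.finrank ℂ (Module.End.eigenspace (heckeT (Gamma0 N) 2 ℓ)
      ((qExpansion 1 ⇑D.f).coeff ℓ)) : ℝ) ≤ max A 0 * d * Real.log ℓ / Real.log (2 * N) := by
    refine hmult.trans (div_le_div_of_nonneg_right ?_ hlog2N0.le)
    exact mul_le_mul_of_nonneg_right (mul_le_mul_of_nonneg_right hA' hd0) hlogℓ0
  have hterm2 : (Module.finrank ℂ (Module.End.eigenspace (heckeT (Gamma0 N) 2 ℓ)
      ((qExpansion 1 ⇑D.f).coeff ℓ)) : ℝ) * Real.log (2 * (N : ℝ) ^ 3) ≤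
      3 * max A 0 * d * Real.log ℓ := by
    have hx : 0 ≤ max A 0 * d * Real.log ℓ := by positivity
    calc _ ≤ max A 0 * d * Real.log ℓ / Real.log (2 * N) * Real.log (2 * (N : ℝ) ^ 3) :=
          mul_le_mul_of_nonneg_right hmult' hc20
      _ ≤ max A 0 * d * Real.log ℓ / Real.log (2 * N) * (3 * Real.log (2 * N)) :=
          mul_le_mul_of_nonneg_left hc2 (div_nonneg hx hlog2N0.le)
      _ = 3 * max A 0 * d * Real.log ℓ := by field_simp
  calc Real.log (D.modularDegree : ℝ) ≤ _ := hmain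
    _ ≤ 3 * d * Real.log ℓ + 3 * max A 0 * d * Real.log ℓ := add_le_add hterm1 hterm2
    _ = (3 + 3 * max A 0) * d * Real.log ℓ := by ring

/-- **`log δ_{1,N} ≤ C · dim S₂(Γ₀(N)) · log ℓ` for every prime `ℓ ∤ N`, `N ≥ 16`, from the named
fact `murtySinha2009_eigenvalue_multiplicity_weightTwo` ALONE** (`log_modularDegree_le_finrank_mul_log_only`
with the constant of the fact; no Deligne). [cite: PastenShimura2024, Thm. 7.2 and Thm. 7.4 (pp. 26–27)]
[cite: MurtySinha2009, eq. (1) p. 683] -/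
theorem exists_log_modularDegree_le_finrank_mul_log_of_murtySinha_only
    (hMS : murtySinha2009_eigenvalue_multiplicity_weightTwo) :
    ∃ C : ℝ, 0 ≤ C ∧ ∀ (N : ℕ) [NeZero N] (W : WeierstrassCurve ℚ) [W.IsElliptic]
      (D : ModularParametrizationData W N),
      (∀ (W' : WeierstrassCurve ℚ) [W'.IsElliptic] (D' : ModularParametrizationData W' N),
          D'.f = D.f → D.modularDegree ≤ D'.modularDegree) →
        16 ≤ N → ∀ (ℓ : ℕ) [NeZero ℓ], ℓ.Prime → ¬ ℓ ∣ N →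
          Real.log (D.modularDegree : ℝ) ≤
            C * Module.finrank ℂ (CuspForm (Gamma0 N) 2) * Real.log ℓ := by
  obtain ⟨A, hA⟩ := hMS
  exact ⟨3 + 3 * max A 0, by positivity,
    fun N _ W _ D hmin hN ℓ _ hℓ hℓN ↦ log_modularDegree_le_finrank_mul_log_only hA D hmin hN hℓ hℓN⟩

/-- **The benchmark `LogFreeDegreeBound` from three named facts** (modularity with integral Manin
constant, the Mazur–Kenku comparison, Murty–Sinha's multiplicity bound): `log m(W, N_W) ≤
C (dim S₂(Γ₀(N_W)) + 1) log ℓ` for every globally minimal `W`, `N_W ≥ 16`, `ℓ ∤ N_W` prime — the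
weight-`2` Ramanujan bound of `exists_log_minModularDegree_le_of_murtySinha` is no longer needed
(`exists_log_minModularDegree_le_of_degreeBound` with
`exists_log_modularDegree_le_finrank_mul_log_of_murtySinha_only`).
[cite: PastenShimura2024, §3 p. 13, Thm. 7.2 and Thm. 7.4 (pp. 26–27)] [cite: MurtySinha2009, eq. (1) p. 683] -/
theorem exists_log_minModularDegree_le_of_murtySinha_only
    (hmod : nonempty_modularParametrizationData)
    (h163 : PastenShimura2024_minimalDegree_le_163_mul)
    (hMS : murtySinha2009_eigenvalue_multiplicity_weightTwo) :
    ∃ C : ℝ, ∀ (W : WeierstrassCurve ℚ) [W.IsElliptic] [W.IsGloballyMinimal]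
      [NeZero (W.conductorNorm ℤ)], 16 ≤ W.conductorNorm ℤ →
        ∀ (ℓ : ℕ) [NeZero ℓ], ℓ.Prime → ¬ ℓ ∣ W.conductorNorm ℤ →
          Real.log (minModularDegree W (W.conductorNorm ℤ) : ℝ) ≤
            C * (Module.finrank ℂ (CuspForm (Gamma0 (W.conductorNorm ℤ)) 2) + 1) * Real.log ℓ :=
  exists_log_minModularDegree_le_of_degreeBound hmod h163
    (exists_log_modularDegree_le_finrank_mul_log_of_murtySinha_only hMS)

open Literature.NumberTheory.Automorphic in
/-- **The one-prime bound from the trace formula alone** (no Deligne): granted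
`HeckeTraceFormulaGL2Level N 1 2` and Murty–Sinha's bound with constant `A` (itself a consequence of
the trace formula in the tree), for `D` of minimal degree in its class at level `N ≥ 11` and a prime
`ℓ ∤ N`,

  `log δ_{1,N} ≤ (Σ_{P ≠ P_f} #c) · log(2 G_N(ℓ)) + A dim S₂(Γ₀(N)) log ℓ / log 2N · log(2 G_N(N³))`,

`G_N(x) = √((x+1)(ψ(N)+1) + 10⁶ x¹² N)` (`log_modularDegree_le_of_primePowTraces` at the instances
`n = p^c` of the named fact, `MurtySinha.traceFormula_two_one`).
[cite: PastenShimura2024, proof of Thm. 7.2, p. 26] [cite: MurtySinha2009, eq. (1) p. 683] -/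
theorem log_modularDegree_le_of_traceFormula
    (hTF : HeckeTraceFormulaGL2Level N 1 2) {A : ℝ}
    (hA : ∀ (N : ℕ) [NeZero N] (p : ℕ) [NeZero p], p.Prime → ¬ p ∣ N →
      ∀ α : ℝ, |α| ≤ 2 * Real.sqrt p →
        (Module.finrank ℂ (Module.End.eigenspace (heckeT (Gamma0 N) 2 p) (α : ℂ)) : ℝ) ≤
          A * Module.finrank ℂ (CuspForm (Gamma0 N) 2) * Real.log p / Real.log (2 * N))
    [W.IsElliptic] (D : ModularParametrizationData W N)
    (hmin : ∀ (W' : WeierstrassCurve ℚ) [W'.IsElliptic] (D' : ModularParametrizationData W' N),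
      D'.f = D.f → D.modularDegree ≤ D'.modularDegree)
    (hN : 11 ≤ N) {ℓ : ℕ} [NeZero ℓ] (hℓ : ℓ.Prime) (hℓN : ¬ ℓ ∣ N) :
    Real.log (D.modularDegree : ℝ) ≤
      (∑ P ∈ (finite_minimalPrimes_anemicHeckeRing N 2).toFinset.erase (eigenIdeal D.f),
          (Module.finrank ℤ (anemicHeckeRing N 2 ⧸ P) : ℝ)) *
          Real.log (2 * Real.sqrt (((ℓ : ℝ) + 1) * ((gamma0Index N : ℝ) + 1) + 10 ^ 6 * (ℓ : ℝ) ^ 12 * N)) +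
        max A 0 * Module.finrank ℂ (CuspForm (Gamma0 N) 2) * Real.log ℓ / Real.log (2 * N) *
          Real.log (2 * Real.sqrt ((((N : ℝ) ^ 3) + 1) * ((gamma0Index N : ℝ) + 1) +
            10 ^ 6 * ((N : ℝ) ^ 3) ^ 12 * N)) :=
  log_modularDegree_le_of_primePowTraces
    (fun _ _ hp _ c ↦ MurtySinha.traceFormula_two_one hTF (pow_pos hp.pos c)) hA D hmin hN hℓ hℓN

/-- The logarithm of the trace-formula bound: `log(2 √((x+1)(ψ+1) + 10⁶ x¹² N)) ≤
½ log(ψ + N + 1) + 6 log x + 8` for `x ≥ 2`, `ψ ≥ N ≥ 1`. [folklore] -/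
private theorem log_two_mul_sqrt_bound_le {x ψ n : ℝ} (hx : 2 ≤ x) (hn : 1 ≤ n) (hψ : n ≤ ψ) :
    Real.log (2 * Real.sqrt ((x + 1) * (ψ + 1) + 10 ^ 6 * x ^ 12 * n)) ≤
      Real.log (ψ + 1) / 2 + 6 * Real.log x + 8 := by
  set R : ℝ := (x + 1) * (ψ + 1) + 10 ^ 6 * x ^ 12 * n with hR
  have hx0 : 0 < x := by linarith
  have hx12 : (1 : ℝ) ≤ x ^ 12 := one_le_pow₀ (by linarith)
  have hx1 : x + 1 ≤ x ^ 12 := by nlinarith [pow_le_pow_right₀ (show (1:ℝ) ≤ x by linarith) (show 2 ≤ 12 by norm_num), sq_nonneg x]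
  -- the radicand is `≤ (10⁶ + 1) x¹² (ψ + 1)`
  have hrad : R ≤ (10 ^ 6 + 1) * x ^ 12 * (ψ + 1) := by
    rw [hR]
    nlinarith [mul_le_mul_of_nonneg_right hx1 (show (0:ℝ) ≤ ψ + 1 by linarith),
      mul_le_mul_of_nonneg_left (show n ≤ ψ + 1 by linarith) (show (0:ℝ) ≤ 10 ^ 6 * x ^ 12 by positivity)]
  have hψ1 : 0 < ψ + 1 := by linarith
  have hrad0 : 0 < R := by
    rw [hR]
    exact add_pos_of_pos_of_nonneg (mul_pos (by linarith) hψ1) (by positivity)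
  have hsqrt0 : 0 < Real.sqrt R := Real.sqrt_pos.mpr hrad0
  rw [Real.log_mul (by norm_num) hsqrt0.ne', Real.log_sqrt hrad0.le]
  have hx12pos : 0 < x ^ 12 := by positivity
  have hlog : Real.log R ≤ Real.log (10 ^ 6 + 1) + 12 * Real.log x + Real.log (ψ + 1) := by
    calc Real.log R
        ≤ Real.log ((10 ^ 6 + 1) * x ^ 12 * (ψ + 1)) := Real.log_le_log hrad0 hrad
      _ = Real.log (10 ^ 6 + 1) + Real.log (x ^ 12) + Real.log (ψ + 1) := by
          rw [Real.log_mul (by positivity) hψ1.ne', Real.log_mul (by norm_num) hx12pos.ne']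
      _ = Real.log (10 ^ 6 + 1) + 12 * Real.log x + Real.log (ψ + 1) := by
          rw [Real.log_pow]; push_cast; ring
  -- `log(10⁶ + 1) ≤ 14`, `log 2 ≤ 1`
  have h10 : Real.log (10 ^ 6 + 1) ≤ 14 := by
    rw [Real.log_le_iff_le_exp (by norm_num)]
    have he := Real.exp_one_gt_d9
    calc (10 : ℝ) ^ 6 + 1 ≤ (2.7182818283 : ℝ) ^ 14 := by norm_num
      _ ≤ Real.exp 1 ^ 14 := pow_le_pow_left₀ (by norm_num) he.le 14
      _ = Real.exp 14 := by rw [Real.exp_one_pow]; norm_num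
  have h2 : Real.log 2 ≤ 1 := by
    rw [Real.log_le_iff_le_exp (by norm_num)]
    have := Real.exp_one_gt_d9
    linarith
  have hhalf : Real.log R / 2 ≤ 7 + 6 * Real.log x + Real.log (ψ + 1) / 2 := by linarith
  linarith

open Filter Asymptotics in
/-- The endgame of the trace-formula route: for `K₁, K₂, C ≥ 0` and `ε > 0`, eventually in `u`,
`K₁ (log u + log(2u + C) + 1) + K₂ log u · log(2u + C) ≤ ε u`. [folklore] -/
private theorem eventually_endgame_le' {K₁ K₂ C : ℝ} (hK₁ : 0 ≤ K₁) (hK₂ : 0 ≤ K₂) (hC : 0 ≤ C)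
    {ε : ℝ} (hε : 0 < ε) :
    ∃ u₀ : ℝ, ∀ u : ℝ, u₀ ≤ u →
      K₁ * (Real.log u + Real.log (2 * u + C) + 1) + K₂ * Real.log u * Real.log (2 * u + C) ≤ ε * u := by
  have hlo : (fun u : ℝ ↦ K₁ + 3 * K₁ * Real.log u + 2 * K₂ * Real.log u ^ 2) =o[atTop] fun u ↦ u := by
    have h0 : (fun _ : ℝ ↦ K₁) =o[atTop] fun u : ℝ ↦ u := isLittleO_const_id_atTop _
    have h1 : (fun u : ℝ ↦ 3 * K₁ * Real.log u) =o[atTop] fun u ↦ u :=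
      Real.isLittleO_log_id_atTop.const_mul_left _
    have h2 : (fun u : ℝ ↦ 2 * K₂ * Real.log u ^ 2) =o[atTop] fun u ↦ u :=
      (Real.isLittleO_pow_log_id_atTop (n := 2)).const_mul_left _
    exact (h0.add h1).add h2
  have hev := hlo.def hε
  rw [Filter.eventually_atTop] at hev
  obtain ⟨u₁, hu₁⟩ := hev
  refine ⟨max u₁ (max C 3), fun u hu ↦ ?_⟩
  have hu1 : u₁ ≤ u := le_trans (le_max_left _ _) hu
  have huC : C ≤ u := le_trans ((le_max_left _ _).trans (le_max_right _ _)) hu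
  have hu3 : 3 ≤ u := le_trans ((le_max_right _ _).trans (le_max_right _ _)) hu
  have hlogu : 1 ≤ Real.log u := by
    rw [Real.le_log_iff_exp_le (by linarith)]
    have := Real.exp_one_lt_d9
    linarith
  have hL : Real.log (2 * u + C) ≤ 2 * Real.log u := by
    have h3u : 2 * u + C ≤ u * u := by nlinarith
    calc Real.log (2 * u + C) ≤ Real.log (u * u) := Real.log_le_log (by linarith) h3u
      _ = 2 * Real.log u := by rw [Real.log_mul (by linarith) (by linarith)]; ring
  have hb := hu₁ u hu1
  have hnn : 0 ≤ K₁ + 3 * K₁ * Real.log u + 2 * K₂ * Real.log u ^ 2 := by positivity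
  rw [Real.norm_of_nonneg hnn, Real.norm_of_nonneg (by linarith)] at hb
  have hK₂' : 0 ≤ K₂ * Real.log u := by positivity
  calc K₁ * (Real.log u + Real.log (2 * u + C) + 1) + K₂ * Real.log u * Real.log (2 * u + C)
      ≤ K₁ * (Real.log u + 2 * Real.log u + 1) + K₂ * Real.log u * (2 * Real.log u) :=
        add_le_add (mul_le_mul_of_nonneg_left (by linarith) hK₁) (mul_le_mul_of_nonneg_left hL hK₂')
    _ = K₁ + 3 * K₁ * Real.log u + 2 * K₂ * Real.log u ^ 2 := by ring
    _ ≤ ε * u := hb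

set_option maxHeartbeats 1000000 in
/-- **Thm. 7.2, asymptotic clause, from eigenvalue bounds of size `G_N` and Murty–Sinha's
multiplicity fact** (the common core): granted `|μ| ≤ G_N(p)` for the eigenvalues of `T_p`, `p ∤ N`,
on `S₂(Γ₀(N))` at every level (`hEV`; unconditional by the trivial bound, or from the trace
identities at `n = p²`) and the named fact `murtySinha2009_eigenvalue_multiplicity_weightTwo`, for
every `ε > 0` there is `N₁` with `log δ_{1,N} < (1/24 + ε) N log N` for every datum of minimal
degree in its class at level `N ≥ N₁`. Proof: `log_modularDegree_le_of_eigenvalueBounds` at a prime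
`ℓ ≤ 2 log N + C` (`exists_prime_not_dvd_le_log`); `Σ_{P ≠ P_f} #c ≤ (1/12 + ε) N` (Prop. 7.1);
`log(2 G_N(ℓ)) ≤ ½ log(ψ(N) + 1) + 6 log ℓ + 8 = ½ log N + O(log log N)` (`ψ(N) ≪ N log log N`,
Mertens) — the main term `(1/12)(1/2) N log N = N log N / 24`, Pasten's constant — and the agreeing
classes contribute `≪ dim S₂(Γ₀(N)) log ℓ ≪ N (log log N)²`.
[cite: PastenShimura2024, Thm. 7.2 (asymptotic clause) and its proof, p. 26]
[cite: MurtySinha2009, eq. (1) p. 683] -/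
theorem exists_log_modularDegree_lt_of_eigenvalueBounds
    (hEV : ∀ (N : ℕ) [NeZero N] (p : ℕ) [NeZero p], p.Prime → ¬ p ∣ N → ∀ μ : ℂ,
      Module.End.HasEigenvalue (heckeT (Gamma0 N) 2 p) μ →
        ‖μ‖ ≤ Real.sqrt (((p : ℝ) + 1) * ((gamma0Index N : ℝ) + 1) + 10 ^ 6 * (p : ℝ) ^ 12 * N))
    (hMS : murtySinha2009_eigenvalue_multiplicity_weightTwo) {ε : ℝ} (hε : 0 < ε) :
    ∃ N₁ : ℕ, ∀ (N : ℕ) [NeZero N] (W : WeierstrassCurve ℚ) [W.IsElliptic]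
      (D : ModularParametrizationData W N),
      (∀ (W' : WeierstrassCurve ℚ) [W'.IsElliptic] (D' : ModularParametrizationData W' N),
          D'.f = D.f → D.modularDegree ≤ D'.modularDegree) →
        N₁ ≤ N → Real.log (D.modularDegree : ℝ) < (1 / 24 + ε) * (N : ℝ) * Real.log N := by
  obtain ⟨A, hA⟩ := hMS
  set A' : ℝ := max A 0 with hA'
  have hA'0 : 0 ≤ A' := le_max_right _ _
  obtain ⟨C₀, hC₀⟩ := exists_prime_not_dvd_le_log
  set C : ℝ := max C₀ 0 with hC_def
  have hC0 : 0 ≤ C := le_max_right _ _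
  obtain ⟨C₁, hC₁pos, hC₁⟩ := exists_prod_primeFactors_one_add_inv_le
  have hC₁0 : 0 ≤ C₁ := hC₁pos.le
  -- `κ = ε` in Prop. 7.1; the remaining terms are `o(N log N)` with room `ε/4`
  obtain ⟨N₂, hN₂⟩ := exists_sum_erase_finrank_quotient_le (κ := ε) hε
  set K₁ : ℝ := (1 / 12 + ε) * (Real.log (C₁ + 1) / 2 + 1 / 2 + 6 + 8) with hK₁
  set K₂ : ℝ := (28 + Real.log (C₁ + 1) / 2) * A' * (C₁ / 12 + 1) with hK₂
  have hlogC₁ : 0 ≤ Real.log (C₁ + 1) := Real.log_nonneg (by linarith)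
  have hK₁0 : 0 ≤ K₁ := by positivity
  have hK₂0 : 0 ≤ K₂ := by positivity
  obtain ⟨u₀, hu₀⟩ := eventually_endgame_le' hK₁0 hK₂0 hC0 (show (0 : ℝ) < ε / 4 by positivity)
  refine ⟨max N₂ (max 21 (Nat.ceil (Real.exp u₀))), fun N _ W _ D hmin hN ↦ ?_⟩
  have hN₂N : N₂ ≤ N := le_trans (le_max_left _ _) hN
  have hN21 : 21 ≤ N := le_trans ((le_max_left _ _).trans (le_max_right _ _)) hN
  have hN16 : 16 ≤ N := by omega
  have hNexp : (Nat.ceil (Real.exp u₀) : ℝ) ≤ N := by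
    exact_mod_cast le_trans ((le_max_right _ _).trans (le_max_right _ _)) hN
  have hN0 : N ≠ 0 := by omega
  have hN11 : 11 ≤ N := by omega
  have hNr : (21 : ℝ) ≤ N := by exact_mod_cast hN21
  have hNpos : (0 : ℝ) < N := by linarith
  have hN1 : (1 : ℝ) ≤ N := by linarith
  set u : ℝ := Real.log N with hu
  have hu0 : u₀ ≤ u := by
    rw [hu, Real.le_log_iff_exp_le hNpos]
    exact (Nat.le_ceil _).trans hNexp
  have hlogN : 3 ≤ u := by
    rw [hu, Real.le_log_iff_exp_le hNpos]
    have hexp : Real.exp 1 < 2.7182818286 := Real.exp_one_lt_d9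
    have hepos : 0 < Real.exp 1 := Real.exp_pos 1
    have hsq : Real.exp 1 * Real.exp 1 ≤ 7.39 := by nlinarith
    calc Real.exp 3 = Real.exp 1 * Real.exp 1 * Real.exp 1 := by rw [← Real.exp_add, ← Real.exp_add]; norm_num
      _ ≤ 21 := by nlinarith
      _ ≤ N := hNr
  have hlogN0 : 0 < u := by linarith
  have hloglog1 : 1 ≤ Real.log u := by
    rw [Real.le_log_iff_exp_le hlogN0]
    have := Real.exp_one_lt_d9
    linarith
  have hlogu_le : Real.log u ≤ u := (Real.log_le_sub_one_of_pos hlogN0).trans (by linarith)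
  -- the prime `ℓ`
  obtain ⟨ℓ, hℓ, hℓN, hℓle⟩ := hC₀ N hN0
  haveI : NeZero ℓ := ⟨hℓ.ne_zero⟩
  have hℓ2 : (2 : ℝ) ≤ ℓ := by exact_mod_cast hℓ.two_le
  have hℓC : (ℓ : ℝ) ≤ 2 * u + C := hℓle.trans (by rw [hu]; exact add_le_add le_rfl (le_max_left _ _))
  have hlogℓ : Real.log ℓ ≤ Real.log (2 * u + C) := Real.log_le_log (by linarith) hℓC
  have hlogℓ0 : 0 ≤ Real.log ℓ := Real.log_nonneg (by linarith)
  have hL0 : 0 ≤ Real.log (2 * u + C) := hlogℓ0.trans hlogℓ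
  -- the main inequality
  have hmain := log_modularDegree_le_of_eigenvalueBounds (hEV N) hA D hmin hN11 hℓ hℓN
  -- `ψ(N) ≤ C₁ N log u`, `ψ + 1 ≤ (C₁ + 1) N u`, `log(ψ+1) ≤ log(C₁+1) + 2u`
  have hψ : (gamma0Index N : ℝ) ≤ C₁ * N * Real.log u := by
    rw [gamma0Index_eq_mul_prod_one_add_inv_real N]
    have h := hC₁ N hN16
    rw [← hu] at h
    nlinarith [mul_le_mul_of_nonneg_left h hNpos.le]
  have hψN : (N : ℝ) ≤ gamma0Index N := by
    rw [gamma0Index_eq_mul_prod_one_add_inv_real N]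
    have h1 : (1 : ℝ) ≤ ∏ p ∈ N.primeFactors, (1 + (p : ℝ)⁻¹) :=
      Finset.prod_induction _ (fun x : ℝ ↦ 1 ≤ x)
        (fun a b ha hb ↦ one_le_mul_of_one_le_of_one_le ha hb) le_rfl
        (fun p _ ↦ le_add_of_nonneg_right (by positivity))
    nlinarith
  have hψ0 : (0 : ℝ) ≤ gamma0Index N := Nat.cast_nonneg _
  have hψ1 : (gamma0Index N : ℝ) + 1 ≤ (C₁ + 1) * N * u := by
    have h1 : C₁ * N * Real.log u ≤ C₁ * N * u := mul_le_mul_of_nonneg_left hlogu_le (by positivity)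
    have h2 : (1 : ℝ) ≤ N * u := by nlinarith
    nlinarith
  have hlogψ : Real.log ((gamma0Index N : ℝ) + 1) ≤ Real.log (C₁ + 1) + u + Real.log u := by
    have h := Real.log_le_log (by linarith : (0 : ℝ) < gamma0Index N + 1) hψ1
    rw [Real.log_mul (by positivity) hlogN0.ne', Real.log_mul (by linarith) hNpos.ne', ← hu] at h
    linarith
  -- the two logarithmic factors
  have hLℓ : Real.log (2 * Real.sqrt (((ℓ : ℝ) + 1) * ((gamma0Index N : ℝ) + 1) + 10 ^ 6 * (ℓ : ℝ) ^ 12 * N)) ≤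
      u / 2 + Real.log u / 2 + Real.log (C₁ + 1) / 2 + 6 * Real.log (2 * u + C) + 8 := by
    have h := log_two_mul_sqrt_bound_le hℓ2 hN1 hψN
    linarith
  have hLN : Real.log (2 * Real.sqrt ((((N : ℝ) ^ 3) + 1) * ((gamma0Index N : ℝ) + 1) +
      10 ^ 6 * ((N : ℝ) ^ 3) ^ 12 * N)) ≤ (28 + Real.log (C₁ + 1) / 2) * u := by
    have hN3 : (2 : ℝ) ≤ (N : ℝ) ^ 3 := by
      calc (2 : ℝ) ≤ 21 ^ 3 := by norm_num
        _ ≤ (N : ℝ) ^ 3 := pow_le_pow_left₀ (by norm_num) hNr 3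
    have h := log_two_mul_sqrt_bound_le hN3 hN1 hψN
    rw [Real.log_pow, Nat.cast_ofNat, ← hu] at h
    have hu1 : (1 : ℝ) ≤ u := by linarith
    nlinarith [mul_le_mul_of_nonneg_left hu1 hlogC₁, mul_le_mul_of_nonneg_left hu1 (show (0:ℝ) ≤ 8 by norm_num)]
  -- (i) the count of classes
  have hS := hN₂ N W D hN₂N
  have hS0 : 0 ≤ ∑ P ∈ (finite_minimalPrimes_anemicHeckeRing N 2).toFinset.erase (eigenIdeal D.f),
      (Module.finrank ℤ (anemicHeckeRing N 2 ⧸ P) : ℝ) := Finset.sum_nonneg fun _ _ ↦ Nat.cast_nonneg _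
  -- (ii) the dimension
  have hdim : (Module.finrank ℂ (CuspForm (Gamma0 N) 2) : ℝ) ≤ (C₁ / 12 + 1) * N * Real.log u := by
    have h1 := finrank_cuspForm_two_le_gamma0Index N
    have h4 : (1 : ℝ) ≤ N * Real.log u := by nlinarith
    calc (Module.finrank ℂ (CuspForm (Gamma0 N) 2) : ℝ) ≤ C₁ * N * Real.log u / 12 + 1 := by linarith
      _ ≤ C₁ * N * Real.log u / 12 + N * Real.log u := by linarith
      _ = (C₁ / 12 + 1) * N * Real.log u := by ring
  have hdim0 : (0 : ℝ) ≤ Module.finrank ℂ (CuspForm (Gamma0 N) 2) := Nat.cast_nonneg _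
  have hlog2N : u ≤ Real.log (2 * N) := by rw [hu]; exact Real.log_le_log hNpos (by linarith)
  have hlog2N0 : 0 < Real.log (2 * N) := lt_of_lt_of_le hlogN0 hlog2N
  -- term 1
  have hterm1 : (∑ P ∈ (finite_minimalPrimes_anemicHeckeRing N 2).toFinset.erase (eigenIdeal D.f),
      (Module.finrank ℤ (anemicHeckeRing N 2 ⧸ P) : ℝ)) *
      Real.log (2 * Real.sqrt (((ℓ : ℝ) + 1) * ((gamma0Index N : ℝ) + 1) + 10 ^ 6 * (ℓ : ℝ) ^ 12 * N)) ≤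
      (1 / 12 + ε) * N * (u / 2) + K₁ * (Real.log u + Real.log (2 * u + C) + 1) * N := by
    have hlu1 : 0 ≤ Real.log u := by linarith
    have hbr0 : 0 ≤ u / 2 + Real.log u / 2 + Real.log (C₁ + 1) / 2 + 6 * Real.log (2 * u + C) + 8 := by
      positivity
    have hε12 : 0 ≤ (1 / 12 + ε) := by positivity
    -- `log u/2 + c + 6L + 8 ≤ (c + 14.5)(log u + L + 1)` with `c = log(C₁+1)/2`
    have hkey : Real.log u / 2 + Real.log (C₁ + 1) / 2 + 6 * Real.log (2 * u + C) + 8 ≤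
        (Real.log (C₁ + 1) / 2 + 1 / 2 + 6 + 8) * (Real.log u + Real.log (2 * u + C) + 1) := by
      nlinarith [mul_nonneg hlogC₁ hL0, mul_nonneg hlogC₁ hlu1, mul_nonneg hL0 hlu1]
    calc _ ≤ ((1 / 12 + ε) * N) *
          (u / 2 + Real.log u / 2 + Real.log (C₁ + 1) / 2 + 6 * Real.log (2 * u + C) + 8) := by
          refine (mul_le_mul_of_nonneg_left hLℓ hS0).trans (mul_le_mul_of_nonneg_right hS hbr0)
      _ = (1 / 12 + ε) * N * (u / 2) +
          ((1 / 12 + ε) * N) * (Real.log u / 2 + Real.log (C₁ + 1) / 2 + 6 * Real.log (2 * u + C) + 8) := by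
          ring
      _ ≤ (1 / 12 + ε) * N * (u / 2) +
          ((1 / 12 + ε) * N) * ((Real.log (C₁ + 1) / 2 + 1 / 2 + 6 + 8) *
            (Real.log u + Real.log (2 * u + C) + 1)) :=
          add_le_add le_rfl (mul_le_mul_of_nonneg_left hkey (mul_nonneg hε12 hNpos.le))
      _ = (1 / 12 + ε) * N * (u / 2) + K₁ * (Real.log u + Real.log (2 * u + C) + 1) * N := by
          rw [hK₁]; ring
  -- term 2
  have hterm2 : max A 0 * Module.finrank ℂ (CuspForm (Gamma0 N) 2) * Real.log ℓ / Real.log (2 * N) *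
      Real.log (2 * Real.sqrt ((((N : ℝ) ^ 3) + 1) * ((gamma0Index N : ℝ) + 1) +
        10 ^ 6 * ((N : ℝ) ^ 3) ^ 12 * N)) ≤ K₂ * Real.log u * Real.log (2 * u + C) * N := by
    rw [← hA']
    have hx : 0 ≤ A' * Module.finrank ℂ (CuspForm (Gamma0 N) 2) * Real.log ℓ := by positivity
    have h28 : 0 ≤ 28 + Real.log (C₁ + 1) / 2 := by positivity
    calc A' * Module.finrank ℂ (CuspForm (Gamma0 N) 2) * Real.log ℓ / Real.log (2 * N) *
          Real.log (2 * Real.sqrt ((((N : ℝ) ^ 3) + 1) * ((gamma0Index N : ℝ) + 1) +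
            10 ^ 6 * ((N : ℝ) ^ 3) ^ 12 * N))
        ≤ A' * Module.finrank ℂ (CuspForm (Gamma0 N) 2) * Real.log ℓ / Real.log (2 * N) *
            ((28 + Real.log (C₁ + 1) / 2) * Real.log (2 * N)) := by
          refine mul_le_mul_of_nonneg_left (hLN.trans (mul_le_mul_of_nonneg_left hlog2N h28))
            (div_nonneg hx hlog2N0.le)
      _ = (28 + Real.log (C₁ + 1) / 2) * A' * (Module.finrank ℂ (CuspForm (Gamma0 N) 2) * Real.log ℓ) := by
          field_simp
      _ ≤ (28 + Real.log (C₁ + 1) / 2) * A' * (((C₁ / 12 + 1) * N * Real.log u) * Real.log (2 * u + C)) := by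
          refine mul_le_mul_of_nonneg_left (mul_le_mul hdim hlogℓ hlogℓ0 (by positivity)) (by positivity)
      _ = K₂ * Real.log u * Real.log (2 * u + C) * N := by rw [hK₂]; ring
  have hend := hu₀ u hu0
  have hNu : 0 < (N : ℝ) * u := mul_pos hNpos hlogN0
  calc Real.log (D.modularDegree : ℝ) ≤ _ := hmain
    _ ≤ (1 / 12 + ε) * N * (u / 2) + K₁ * (Real.log u + Real.log (2 * u + C) + 1) * N +
        K₂ * Real.log u * Real.log (2 * u + C) * N := add_le_add hterm1 hterm2
    _ = (1 / 24 + ε / 2) * (N * u) +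
        N * (K₁ * (Real.log u + Real.log (2 * u + C) + 1) + K₂ * Real.log u * Real.log (2 * u + C)) := by ring
    _ ≤ (1 / 24 + ε / 2) * (N * u) + N * (ε / 4 * u) := by
        exact add_le_add le_rfl (mul_le_mul_of_nonneg_left hend hNpos.le)
    _ = (1 / 24 + 3 * ε / 4) * (N * u) := by ring
    _ < (1 / 24 + ε) * (N * u) := mul_lt_mul_of_pos_right (by linarith) hNu
    _ = (1 / 24 + ε) * N * Real.log N := by rw [hu]; ring

/-- **Thm. 7.2, asymptotic clause — indeed `log δ_{1,N} = o(N log N)` with the constant `1/24` —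
from the named fact `murtySinha2009_eigenvalue_multiplicity_weightTwo` ALONE**: the eigenvalue
bounds are the trivial ones (`eigenvalue_norm_le_traceBound_of_trivial`); no Deligne, no
Rankin–Selberg, no trace-formula hypothesis (the trace formula enters only through the proof of the
Murty–Sinha fact). [cite: PastenShimura2024, Thm. 7.2 (asymptotic clause) and its proof, p. 26]
[cite: MurtySinha2009, eq. (1) p. 683] -/
theorem exists_log_modularDegree_lt_of_murtySinha_only
    (hMS : murtySinha2009_eigenvalue_multiplicity_weightTwo) {ε : ℝ} (hε : 0 < ε) :
    ∃ N₁ : ℕ, ∀ (N : ℕ) [NeZero N] (W : WeierstrassCurve ℚ) [W.IsElliptic]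
      (D : ModularParametrizationData W N),
      (∀ (W' : WeierstrassCurve ℚ) [W'.IsElliptic] (D' : ModularParametrizationData W' N),
          D'.f = D.f → D.modularDegree ≤ D'.modularDegree) →
        N₁ ≤ N → Real.log (D.modularDegree : ℝ) < (1 / 24 + ε) * (N : ℝ) * Real.log N :=
  exists_log_modularDegree_lt_of_eigenvalueBounds
    (fun _ _ p _ hp hpN μ hμ ↦ eigenvalue_norm_le_traceBound_of_trivial p hp hpN μ hμ) hMS hε

open Literature.NumberTheory.Automorphic Literature.NumberTheory.Automorphic.HeckeTraceFormulaGL2Level in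
/-- **Thm. 7.2, asymptotic clause, from the prime-power instances of the Eichler–Selberg trace
formula — no Deligne, no Rankin–Selberg**: granted, at every level `N` and for every prime `p ∤ N`,
the identities `Tr(T_{p^c} | S₂(Γ₀(N))) = A₁ + A₂ + A₃ + A₄` (`c ≥ 0`; Schoof–van der Vlugt Thm. 2.2
at `n = p^c`, weight `2`, trivial character — the only instances of the trace formula consumed, here
and in Murty–Sinha's argument), for every `ε > 0` there is `N₁` with
`log δ_{1,N} < (1/24 + ε) N log N` for every datum of minimal degree in its class at level `N ≥ N₁`
(`exists_log_modularDegree_lt_of_eigenvalueBounds` with `norm_le_sqrt_of_primePowTrace` and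
`murtySinha2009_eigenvalue_multiplicity_weightTwo_of_primePowTraces`).
[cite: PastenShimura2024, Thm. 7.2 (asymptotic clause) and its proof, p. 26]
[cite: MurtySinha2009, eq. (1) p. 683] [cite: SchoofVandervlugt1991, Thm. 2.2, p. 168] -/
theorem exists_log_modularDegree_lt_of_primePowTraces
    (hPP : ∀ (N : ℕ) [NeZero N] (p : ℕ) [NeZero p], p.Prime → ¬ p ∣ N →
      ∀ c : ℕ, cuspidalHeckeTrace N 2 1 (p ^ c) = geometricSide N 1 2 (p ^ c)) {ε : ℝ} (hε : 0 < ε) :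
    ∃ N₁ : ℕ, ∀ (N : ℕ) [NeZero N] (W : WeierstrassCurve ℚ) [W.IsElliptic]
      (D : ModularParametrizationData W N),
      (∀ (W' : WeierstrassCurve ℚ) [W'.IsElliptic] (D' : ModularParametrizationData W' N),
          D'.f = D.f → D.modularDegree ≤ D'.modularDegree) →
        N₁ ≤ N → Real.log (D.modularDegree : ℝ) < (1 / 24 + ε) * (N : ℝ) * Real.log N :=
  exists_log_modularDegree_lt_of_eigenvalueBounds
    (fun N _ p _ hp hpN _ hμ ↦ ModularForms.norm_le_sqrt_of_primePowTrace N (hPP N p hp hpN 2) hp hpN hμ)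
    (murtySinha2009_eigenvalue_multiplicity_weightTwo_of_primePowTraces hPP) hε

open Literature.NumberTheory.Automorphic in
/-- **Thm. 7.2, asymptotic clause, from the Eichler–Selberg trace formula — no Deligne, no
Rankin–Selberg**: granted `HeckeTraceFormulaGL2Level N 1 2` at every level, for every `ε > 0` there is
`N₁` with `log δ_{1,N} < (1/24 + ε) N log N` for every datum of minimal degree in its class at level
`N ≥ N₁` (`exists_log_modularDegree_lt_of_primePowTraces` at the instances `n = p^c` of the named
fact, `MurtySinha.traceFormula_two_one`). [cite: PastenShimura2024, Thm. 7.2 (asymptotic clause) and its proof, p. 26]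
[cite: MurtySinha2009, eq. (1) p. 683] [cite: SchoofVandervlugt1991, Thm. 2.2, p. 168] -/
theorem exists_log_modularDegree_lt_of_traceFormula
    (hTF : ∀ (N : ℕ) [NeZero N], HeckeTraceFormulaGL2Level N 1 2) {ε : ℝ} (hε : 0 < ε) :
    ∃ N₁ : ℕ, ∀ (N : ℕ) [NeZero N] (W : WeierstrassCurve ℚ) [W.IsElliptic]
      (D : ModularParametrizationData W N),
      (∀ (W' : WeierstrassCurve ℚ) [W'.IsElliptic] (D' : ModularParametrizationData W' N),
          D'.f = D.f → D.modularDegree ≤ D'.modularDegree) →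
        N₁ ≤ N → Real.log (D.modularDegree : ℝ) < (1 / 24 + ε) * (N : ℝ) * Real.log N :=
  exists_log_modularDegree_lt_of_primePowTraces
    (fun N _ _ _ hp _ c ↦ MurtySinha.traceFormula_two_one (hTF N) (pow_pos hp.pos c)) hε

end Pasten2024

/-! ### Thm. 7.5 from modularity, Mazur–Kenku and Murty–Sinha's multiplicity fact — three named facts -/

/-- **Pasten, Thm. 7.5 from modularity with integral Manin constant, the Mazur–Kenku comparison and
Murty–Sinha's multiplicity bound — nothing else.** Inputs: the named facts
`nonempty_modularParametrizationData`, `PastenShimura2024_minimalDegree_le_163_mul` and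
`murtySinha2009_eigenvalue_multiplicity_weightTwo`; the eigenvalue bounds of the congruence-splitting
argument are the trivial (Petersson operator-norm) ones, `norm_eigenvalue_heckeT_gamma0_two_le`
(`HeckeOperatorsEigenvalueBoundProofs`), so that neither Deligne's bound nor any trace-formula
hypothesis appears (`Pasten2024.exists_log_modularDegree_lt_of_murtySinha_only`).
[cite: PastenShimura2024, Theorem 7.5 (proof, §7.4 p. 27) with Thm 7.2 (p. 26) and §3 p. 13]
[cite: MurtySinha2009, eq. (1) p. 683] -/
theorem pasten_thm_7_5_of_modularity_mazurKenku_murtySinha_only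
    (hmod : nonempty_modularParametrizationData)
    (h163 : PastenShimura2024_minimalDegree_le_163_mul)
    (hMS : murtySinha2009_eigenvalue_multiplicity_weightTwo) :
    pasten_thm_7_5 :=
  pasten_thm_7_5_of_modularity_of_optimalDegreeBound hmod h163
    fun _ hε ↦ Pasten2024.exists_log_modularDegree_lt_of_murtySinha_only hMS hε

/-- **Pasten, Thm. 7.5 from THREE named facts of the tree**: the Modularity Theorem "Version `a_p`"
(`exists_isNewformOf`), the Mazur–Kenku comparison (`PastenShimura2024_minimalDegree_le_163_mul`,
Mazur 1978 + Kenku, with Edixhoven's integrality inside) and Murty–Sinha's multiplicity bound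
(`murtySinha2009_eigenvalue_multiplicity_weightTwo`, in the tree a consequence of the prime-power
instances of the Eichler–Selberg trace formula). This is the smallest set of named inputs reached in
the tree for the unconditional clause of Thm. 7.5.
[cite: PastenShimura2024, Theorem 7.5 (proof, §7.4 p. 27) with §3 p. 13 and Thm 7.2 (p. 26)]
[cite: BCDTJAMS2001, Thm. A] [cite: MurtySinha2009, eq. (1) p. 683] -/
theorem pasten_thm_7_5_of_exists_isNewformOf_mazurKenku_murtySinha
    (h₁ : exists_isNewformOf)
    (h163 : PastenShimura2024_minimalDegree_le_163_mul)
    (hMS : murtySinha2009_eigenvalue_multiplicity_weightTwo) :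
    pasten_thm_7_5 :=
  pasten_thm_7_5_of_modularity_mazurKenku_murtySinha_only
    (nonempty_modularParametrizationData_of_modularity h₁
      IsNewformOf.exists_maninConstant_modularDegree_holds) h163 hMS

/-- **Pasten, Thm. 7.5 from the printed inputs of §3 and Murty–Sinha's multiplicity fact**:
modularity "Version `a_p`" (`exists_isNewformOf`), Mazur–Kenku (`mazurKenku_exists_cyclic_isogeny`),
the integrality of Manin constants (`hInt`, Edixhoven 1991 Prop. 2, the hypothesis of
`PastenShimura2024_minimalDegree_le_163_mul_of_mazurKenku`) and
`murtySinha2009_eigenvalue_multiplicity_weightTwo`; the Hasse–Weil/Deligne bound of the printed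
proof of Thm. 7.2 and Murty's Lemma 11 are both dispensed with.
[cite: PastenShimura2024, Theorem 7.5 (proof, §7.4 p. 27) with §3 p. 13]
[cite: Mazur1978, Thm. 1] [cite: Kenku1982] [cite: EdixhovenManin1991, Prop. 2]
[cite: MurtySinha2009, eq. (1) p. 683] -/
theorem pasten_thm_7_5_of_printed_inputs_murtySinha_only
    (h₁ : exists_isNewformOf)
    (hMK : mazurKenku_exists_cyclic_isogeny)
    (hInt : ∀ {N : ℕ} [NeZero N] {W' : WeierstrassCurve ℚ} [W'.IsElliptic] [W'.IsGloballyMinimal]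
      (D' : ModularParametrizationData W' N) (q : ℚ),
      (∀ z ∈ periodLattice D'.f, (q : ℂ) * z ∈ D'.L.lattice) → ∃ k : ℤ, (k : ℚ) = q)
    (hMS : murtySinha2009_eigenvalue_multiplicity_weightTwo) :
    pasten_thm_7_5 :=
  pasten_thm_7_5_of_exists_isNewformOf_mazurKenku_murtySinha h₁
    (PastenShimura2024_minimalDegree_le_163_mul_of_mazurKenku hMK hInt) hMS

/-! ### Thm. 7.5 from modularity, Mazur–Kenku and the prime-power trace identities -/

open Literature.NumberTheory.Automorphic Literature.NumberTheory.Automorphic.HeckeTraceFormulaGL2Level in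
/-- **Pasten, Thm. 7.5 from modularity with integral Manin constant, the Mazur–Kenku comparison and
the prime-power instances of the Eichler–Selberg trace formula.** Inputs: the named facts
`nonempty_modularParametrizationData` and `PastenShimura2024_minimalDegree_le_163_mul`, and the
identities `Tr(T_{p^c} | S₂(Γ₀(N))) = A₁ + A₂ + A₃ + A₄` (Schoof–van der Vlugt Thm. 2.2 at
`n = p^c`, weight `2`, trivial character) for all levels `N ≥ 1`, primes `p ∤ N` and `c ≥ 0` — the
only instances of the trace formula the whole argument consumes (Murty–Sinha's multiplicity bound,
`murtySinha2009_eigenvalue_multiplicity_weightTwo_of_primePowTraces`, and the eigenvalue bound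
`norm_sq_le_of_primePowTrace` at `c = 2`); the asymptotic clause of Thm. 7.2 is
`Pasten2024.exists_log_modularDegree_lt_of_primePowTraces`.
[cite: PastenShimura2024, Theorem 7.5 (proof, §7.4 p. 27) with Thm 7.2 (p. 26) and §3 p. 13]
[cite: SchoofVandervlugt1991, Thm. 2.2, p. 168] [cite: MurtySinha2009, eq. (1) p. 683] -/
theorem pasten_thm_7_5_of_modularity_mazurKenku_primePowTraces
    (hmod : nonempty_modularParametrizationData)
    (h163 : PastenShimura2024_minimalDegree_le_163_mul)
    (hPP : ∀ (N : ℕ) [NeZero N] (p : ℕ) [NeZero p], p.Prime → ¬ p ∣ N →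
      ∀ c : ℕ, cuspidalHeckeTrace N 2 1 (p ^ c) = geometricSide N 1 2 (p ^ c)) :
    pasten_thm_7_5 :=
  pasten_thm_7_5_of_modularity_of_optimalDegreeBound hmod h163
    fun _ hε ↦ Pasten2024.exists_log_modularDegree_lt_of_primePowTraces hPP hε

open Literature.NumberTheory.Automorphic Literature.NumberTheory.Automorphic.HeckeTraceFormulaGL2Level in
/-- **Pasten, Thm. 7.5 from the Modularity Theorem "Version `a_p`" (`exists_isNewformOf`), the
Mazur–Kenku comparison (`PastenShimura2024_minimalDegree_le_163_mul`) and the prime-power instances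
`n = p^c`, `p ∤ N`, of the Eichler–Selberg trace formula on `S₂(Γ₀(N))` (all `N`).** This is the
weakest set of inputs reached in the tree for the unconditional clause of Thm. 7.5.
[cite: PastenShimura2024, Theorem 7.5 (proof, §7.4 p. 27) with §3 p. 13 and Thm 7.2 (p. 26)]
[cite: BCDTJAMS2001, Thm. A] [cite: SchoofVandervlugt1991, Thm. 2.2, p. 168] -/
theorem pasten_thm_7_5_of_exists_isNewformOf_primePowTraces
    (h₁ : exists_isNewformOf)
    (h163 : PastenShimura2024_minimalDegree_le_163_mul)
    (hPP : ∀ (N : ℕ) [NeZero N] (p : ℕ) [NeZero p], p.Prime → ¬ p ∣ N →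
      ∀ c : ℕ, cuspidalHeckeTrace N 2 1 (p ^ c) = geometricSide N 1 2 (p ^ c)) :
    pasten_thm_7_5 :=
  pasten_thm_7_5_of_modularity_mazurKenku_primePowTraces
    (nonempty_modularParametrizationData_of_modularity h₁
      IsNewformOf.exists_maninConstant_modularDegree_holds) h163 hPP

open Literature.NumberTheory.Automorphic Literature.NumberTheory.Automorphic.HeckeTraceFormulaGL2Level in
/-- **Pasten, Thm. 7.5 from the printed inputs of §3 and the prime-power trace identities**:
modularity "Version `a_p`" (`exists_isNewformOf`), Mazur–Kenku (`mazurKenku_exists_cyclic_isogeny`),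
the integrality of Manin constants (`hInt`, Edixhoven 1991 Prop. 2, the hypothesis of
`PastenShimura2024_minimalDegree_le_163_mul_of_mazurKenku`) and the identities
`Tr(T_{p^c} | S₂(Γ₀(N))) = A₁ + A₂ + A₃ + A₄` (`p ∤ N` prime, `c ≥ 0`, all `N`).
[cite: PastenShimura2024, Theorem 7.5 (proof, §7.4 p. 27) with §3 p. 13]
[cite: Mazur1978, Thm. 1] [cite: Kenku1982] [cite: EdixhovenManin1991, Prop. 2]
[cite: SchoofVandervlugt1991, Thm. 2.2, p. 168] -/
theorem pasten_thm_7_5_of_printed_inputs_primePowTraces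
    (h₁ : exists_isNewformOf)
    (hMK : mazurKenku_exists_cyclic_isogeny)
    (hInt : ∀ {N : ℕ} [NeZero N] {W' : WeierstrassCurve ℚ} [W'.IsElliptic] [W'.IsGloballyMinimal]
      (D' : ModularParametrizationData W' N) (q : ℚ),
      (∀ z ∈ periodLattice D'.f, (q : ℂ) * z ∈ D'.L.lattice) → ∃ k : ℤ, (k : ℚ) = q)
    (hPP : ∀ (N : ℕ) [NeZero N] (p : ℕ) [NeZero p], p.Prime → ¬ p ∣ N →
      ∀ c : ℕ, cuspidalHeckeTrace N 2 1 (p ^ c) = geometricSide N 1 2 (p ^ c)) :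
    pasten_thm_7_5 :=
  pasten_thm_7_5_of_exists_isNewformOf_primePowTraces h₁
    (PastenShimura2024_minimalDegree_le_163_mul_of_mazurKenku hMK hInt) hPP

/-! ### Thm. 7.5 from modularity, Mazur–Kenku and the Eichler–Selberg trace formula -/

open Literature.NumberTheory.Automorphic in
/-- **Pasten, Thm. 7.5 from modularity with integral Manin constant, the Mazur–Kenku comparison and
the Eichler–Selberg trace formula — Deligne's bound is not needed.** Inputs: the named facts
`nonempty_modularParametrizationData`, `PastenShimura2024_minimalDegree_le_163_mul` and
`HeckeTraceFormulaGL2Level N 1 2` (all `N ≥ 1`); the asymptotic clause of Thm. 7.2 is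
`Pasten2024.exists_log_modularDegree_lt_of_traceFormula` (eigenvalue bounds and Murty–Sinha's
multiplicity bound both from the trace formula, Hasse's theorem for `a_ℓ(E)`).
[cite: PastenShimura2024, Theorem 7.5 (proof, §7.4 p. 27) with Thm 7.2 (p. 26) and §3 p. 13]
[cite: SchoofVandervlugt1991, Thm. 2.2, p. 168] [cite: MurtySinha2009, eq. (1) p. 683] -/
theorem pasten_thm_7_5_of_modularity_mazurKenku_traceFormula
    (hmod : nonempty_modularParametrizationData)
    (h163 : PastenShimura2024_minimalDegree_le_163_mul)
    (hTF : ∀ (N : ℕ) [NeZero N], HeckeTraceFormulaGL2Level N 1 2) :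
    pasten_thm_7_5 :=
  pasten_thm_7_5_of_modularity_of_optimalDegreeBound hmod h163
    fun _ hε ↦ Pasten2024.exists_log_modularDegree_lt_of_traceFormula hTF hε

open Literature.NumberTheory.Automorphic in
/-- **Pasten, Thm. 7.5 from THREE named facts of the tree**: the Modularity Theorem "Version `a_p`"
(`exists_isNewformOf`), the Mazur–Kenku comparison (`PastenShimura2024_minimalDegree_le_163_mul`) and
the Eichler–Selberg trace formula (`HeckeTraceFormulaGL2Level N 1 2`, all `N`).
[cite: PastenShimura2024, Theorem 7.5 (proof, §7.4 p. 27) with §3 p. 13 and Thm 7.2 (p. 26)]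
[cite: BCDTJAMS2001, Thm. A] [cite: SchoofVandervlugt1991, Thm. 2.2, p. 168] -/
theorem pasten_thm_7_5_of_exists_isNewformOf_traceFormula
    (h₁ : exists_isNewformOf)
    (h163 : PastenShimura2024_minimalDegree_le_163_mul)
    (hTF : ∀ (N : ℕ) [NeZero N], HeckeTraceFormulaGL2Level N 1 2) :
    pasten_thm_7_5 :=
  pasten_thm_7_5_of_modularity_mazurKenku_traceFormula
    (nonempty_modularParametrizationData_of_modularity h₁
      IsNewformOf.exists_maninConstant_modularDegree_holds) h163 hTF

open Literature.NumberTheory.Automorphic in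
/-- **Pasten, Thm. 7.5 from the printed inputs of §3 and the trace formula**: modularity
"Version `a_p`" (`exists_isNewformOf`), Mazur–Kenku (`mazurKenku_exists_cyclic_isogeny`), the
integrality of Manin constants (`hInt`, Edixhoven 1991 Prop. 2, the hypothesis of
`PastenShimura2024_minimalDegree_le_163_mul_of_mazurKenku`) and the Eichler–Selberg trace formula; the
Hasse–Weil/Deligne bound of the printed proof of Thm. 7.2 and Murty's Lemma 11 are both dispensed
with. [cite: PastenShimura2024, Theorem 7.5 (proof, §7.4 p. 27) with §3 p. 13]
[cite: Mazur1978, Thm. 1] [cite: Kenku1982] [cite: EdixhovenManin1991, Prop. 2]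
[cite: SchoofVandervlugt1991, Thm. 2.2, p. 168] -/
theorem pasten_thm_7_5_of_printed_inputs_traceFormula
    (h₁ : exists_isNewformOf)
    (hMK : mazurKenku_exists_cyclic_isogeny)
    (hInt : ∀ {N : ℕ} [NeZero N] {W' : WeierstrassCurve ℚ} [W'.IsElliptic] [W'.IsGloballyMinimal]
      (D' : ModularParametrizationData W' N) (q : ℚ),
      (∀ z ∈ periodLattice D'.f, (q : ℂ) * z ∈ D'.L.lattice) → ∃ k : ℤ, (k : ℚ) = q)
    (hTF : ∀ (N : ℕ) [NeZero N], HeckeTraceFormulaGL2Level N 1 2) :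
    pasten_thm_7_5 :=
  pasten_thm_7_5_of_exists_isNewformOf_traceFormula h₁
    (PastenShimura2024_minimalDegree_le_163_mul_of_mazurKenku hMK hInt) hTF

end Literature.NumberTheory.EllipticCurves

end
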